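/-
Copyright: cell `langlands-arthur-audit` (papers/Langlands/langlands-arthur-audit), unit `pub-arthur-down-g57`
(downstream tracer, gen 57).  Thirty-eighth file of the downstream register (module M269 of the cell's MODULE-MAP, CLAIMed in `lean/MODULE-MAP3.md`
2026-08-24; M267 / M268 are the TYPER line's `Leaves/RunningTextInvocationsInPrint6.lean` / `…7.lean`).  `Downstream.lean` (tranches 1–4) … `Downstream37.lean`
(128–131, module M266, 158 kB of the gate's 200 kB content cap) hold the register so far; this file continues it, APPEND-ONLY in the same conventions and the same
namespace `…Arthur2013.Downstream`.  v1 imports `…Downstream33` AND `…Downstream22` — two SIBLINGS, not the heads `…Downstream36` / `…Downstream37` of the down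
line, for the reason M254, M261 and M266 recorded: the hub's olean store for this library is frozen (ops-buildfix B18-3; this unit's probe 2026-08-24T20:33Z:
`import …Downstream37` and `import …Downstream36` → « remote:stale:35:unbuilt »), while `Downstream33.lean` (unchanged since 2026-08-23) and `Downstream22.lean`
(unchanged since 2026-08-22) elaborate with their current content (probe `HOME/pub-arthur-down-g57/work/Probe22.lean`, both imports, rc 0).  Through
`…Downstream33` this tranche uses `…Downstream5` (tranche 28: `Consumers28.MokGSp4` = row C191, `Implications28`, `mokGSp4_of_leaves`) and `…Downstream`
(`Nodes`, `Consumers` {`GeeTaibi` = row A4, `TaibiInner` = row A3}, `BookInputs`, `MokInputs`, `Implications`, `geeTaibi_of_leaves`, `taibiInner_of_leaves`);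
through `…Downstream22` tranche 82 (`Consumers82` {…, `ELstableTempered`, `ELmain`} = row C209, `Implications82`, `el_of_rows`).  Nothing of tranches 83–131
is used.
v1 = the hundred-and-thirty-second tranche (`Consumers132`: THE FIELD-COVERAGE AUDIT's DESK LIST CONCLUDED FOR THREE ROWS — row C126 J. Enns – H. Lee
(censused 2026-08-18 from arXiv:2112.12256, unit `pub-arthur-down-g5`) IDENTIFIED with row C209 (the same paper PUBLISHED, Doc. Math. 29 (2024) 863–919, typed in tranche 82 from the
publisher's text) and REFINED from the version of record by the two by-number invocations tranche 82 does not carry — `ELjlTransfer` = Lemma 4.1.6 ⇐ the book's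
Theorem 1.4.1 BY NUMBER ∧ row A3, `ELgalois` = Theorem 4.1.4 ⇐ row C191 (C. P. Mok, Compos. Math. 150 (2014), « [44, Theorem 3.5] ») — and by the printed chain
to Theorem 4.5.1 (`E_ELstableTemperedVoR`, `E_ELmainVoR`: second supply edges for tranche 82's two fields); row C139 D. Ginzburg – D. Soudry, J. Number Theory
235 (2022) (`GSmultiplicities` ⇐ the book's Theorem 1.5.2 BY NUMBER; `GSdoubleDescent` = the Arthur-free main Theorem 3.4; `GSexactJ` ⇐ the book by name ∧
Theorem 3.4); row C131 D. Jiang – L. Zhang, Geom. Funct. Anal. 24 (2014) (`JZtransferL` ⇐ the book ∧ Mok's memoir, definition level); `Implications132`;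
bookkeeping theorems incl. `c209_vor_route_of_t82_rows`).  Nothing of the first thirty-seven files is redeclared or changed.
v2 (same unit) = the hundred-and-thirty-third tranche APPENDED (the audit's desk list continued: the two experimental congruence papers that reach the book through
row C3 — row C78 J. Bergström – N. Dummigan – T. Mégarbané, Exp. Math. 27 (2018) (`Consumers133.BDMexamples` ⇐ C3 ★ ∧ C3 ★★) and row C149 J. Bergström –
N. Dummigan – D. Farmer – S. Koutsoliotas, J. Théor. Nombres Bordeaux 31 (2020) (`BDFKexamples` ⇐ C3 ★ ∧ C3 ★★ ∧ row C97 `Consumers32.MegarbaneSO`); `Implications133`;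
bookkeeping theorems; v1 untouched; texts staged by this unit under `HOME/pub-arthur-down-g57/primaries/`).
v3 (same unit) = the hundred-and-thirty-fourth tranche APPENDED (the audit's desk list concluded: row C142 L. Cai – Y. Fan, Adv. Math. 410 (2022) (`Consumers134.CFrelSC`
⇐ Mok ∧ row C25 `Consumers34.BPPlancherel`) and row C152 in its latest text state, N. Matringe arXiv:2409.20240v6 (node `MatLCTassume`, `MatLCTclassical` ⇐ node ∧ book ∧
Mok ∧ row B105 `Consumers26.JantzenLiu`); `Implications134`; bookkeeping theorems; v1 – v2 untouched).
v4 (same unit) = the hundred-and-thirty-fifth tranche APPENDED (the audit's desk list, last row: B16 C. Cunningham – A. Fiori – A. Moussaoui – J. Mracek – B. Xu,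
Mem. Amer. Math. Soc. 276 (2022) no. 1353, read from the arXiv v5 PDF text staged by this unit: node `Consumers135.CFMMXvoganLLC` ⇐ book ∧ the Chapter-9 leaf
`Consumers8.InnerTwists`, `CFMMXpurePackets` ⇐ book ∧ leaf ∧ row B75 `Consumers45.MoeglinMult1`, `CFMMXexamples` ⇐ book ∧ packets ∧ node; `Implications135`;
bookkeeping theorems; v1 – v3 untouched).
v5 (same unit) = ONE DOCSTRING CORRECTION in tranche 134 (C152): [Vgen] = S. Varma, Forum Math. 29 (2017) IS census row B83 (second-hand, no typed field, text wanted
acq-08103), not « not a census row »; no declaration, statement or edge changed.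
v6 (same unit) = the hundred-and-thirty-sixth tranche APPENDED (PDF TEXT STATES: the by-number, star-marked citations of Chenevier – Renard that rows C78 and C149
PRINT and the held corpus TeX conversion drops — premises of tranche 133 confirmed, two docstrings of tranche 133 refined to point there; row C142's rewritten
arXiv v2 = the published title typed as `Consumers136.CFv2part3` ⇐ Mok ∧ row C25 and `CFrelSCv2` ⇐ it; `Implications136`; bookkeeping theorems; no statement
of v1 – v5 changed).
v7 (unit `pub-arthur-down-g58`, downstream tracer gen 58) = the hundred-and-thirty-seventh tranche APPENDED (THE 2026-08-25 arXiv MAILING: the one replacement that meets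
the census — row C251 H. T. Dang, arXiv:2608.14145 v2 of 2026-08-24, whose NEW §5 Theorem 5.2 / Corollary 5.3 (type-Va occurrence, « Unconditional theorem, via [36,
Thm. 11.4] » = Rösner – Weissauer = the census's control row C18 / E4) is typed as `Consumers137.DangTypeVa` with a premise-free edge; tranche 100's `Consumers100.DangRB`
(Theorem 2.4 / Proposition 4.4) re-found verbatim in v2; `Implications137`; bookkeeping theorems; no statement of v1 – v6 changed).
v8 (same unit) = ERRATUM TO THE TRANCHE-137 DOCSTRING, wording only: v7's summary sentence « every quotation tranche 100 took from v1 … re-found verbatim (… only the abstract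
and the status paragraph are rewritten) » over-stated the v1 / v2 concordance of row C251 and is replaced by the itemised concordance (the typed statement's words unchanged;
§1.4's and §4.2's supplier brackets RENUMBERED [36, 39, 14, 37] → [36, 44, 14, 42], same works; abstract, status paragraph, §1.4's last clause, Table 1 rewritten), with v2's
bibliography line [37] added to the `--` comments; no declaration, statement or proof changed.
-/
import HarnessLib
import Literature.NumberTheory.Automorphic.Arthur2013.Downstream33
import Literature.NumberTheory.Automorphic.Arthur2013.Downstream22

/-!
# Downstream of Arthur (2013), Mok (2015), KMSW (2014): the typed register, thirty-eighth file (tranches ≥ 132)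

**What is reproduced.**  As in the first thirty-seven files: for published theorems that invoke J. Arthur, *The Endoscopic Classification of Representations* (AMS
Colloq. Publ. 61, 2013) [cite: Arthur2013] — directly, or through typed rows of the register — one HYPOTHESIS `E_…` per statement quoting the sentences in
which the paper invokes them, recording WHICH nodes of the dependency DAG and of the register the proof consumes; and bookkeeping theorems composing these
hypotheses with the packaged inputs `BookInputs` / `MokInputs` of `Downstream.lean` and with the `…_of_leaves` theorems of tranches 1 and 28 and the edges of
tranche 82.  Quotations are exact substrings of the texts STAGED by unit `pub-arthur-down-g56` under `HOME/pub-arthur-down-g56/primaries/` (`KEYS.tsv`,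
`SHA256SUMS` there; used in place) and by this unit under `HOME/pub-arthur-down-g57/primaries/` (`KEYS.tsv`, `SHA256SUMS`): `vor-C126/` (rows C126 ≡ C209:
the EMS Press version of record of Doc. Math. 29 (2024) 863–919, doi:10.4171/dm/960, CC BY 4.0, PDF sha256 e8b4cc4295a9…, pypdf text, 57 pp.; pNNNN = PDF page,
Ln = line; the dropped Greek / accented glyphs of this extraction — « Let be a regular cuspidal … », « NrWGF!GSp4.F/ » for r̄ : G_F → GSp₄(𝔽) — verbatim),
`paper-arxiv-2008.02462/` (row C139: the held corpus TeX of arXiv:2008.02462v1 = 2020-08-06, the only arXiv version, 78 chunks of the store text; pNNNN = CHUNK,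
Ln = line, TeX verbatim; the Journal of Number Theory version of record, doi:10.1016/j.jnt.2021.08.012, was NOT compared), `paper-arxiv-1212.6580/` (row C131:
the held corpus TeX of arXiv:1212.6580, v2 of 2013-04-20 per the arXiv API, 29 chunks; the GAFA version of record, doi:10.1007/s00039-014-0266-7, was NOT
compared), and this unit's `paper-arxiv-1109.5392/` (row C191's held TeX, C. P. Mok, Compos. Math. 150 (2014), 36 chunks — two loci, for the concordance of
C126's « [44, Theorem 3.5] » / « [44, Remark 3.3 (3)] ») and `paper-arxiv-1807.03988/` (row A4's held TeX, T. Gee – O. Taïbi, J. Éc. polytech. Math. 6 (2019),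
41 chunks — one locus, for the reading of C126's « [28, Theorem 5.1.2] »).  Independent re-check: `HOME/pub-arthur-down-g57/tree/quotecheck_ds38.py` re-finds
every `pNNNN:La-b "…"` quotation of this file in those page files.

**Deliberately not here.**  Any content of a node; any claim that a downstream theorem is true or false; a second typing of what tranche 82 typed for the
Enns – Lee paper (its `Consumers82.ELstableTempered` = Corollary 4.1.1 ∧ Lemma 4.1.7 and `ELmain` = Theorem 4.5.1 are USED here, through the import of
`…Downstream22`, not re-declared); C126's Remark 4.1.5 (expectations and known cases of irreducibility, « [59, Theorem 1.1] » = row C82, « [58] » — a remark,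
no premise of anything); C139's §4 list of candidate poles « from [JLZ13] » (D. Jiang – B. Liu – L. Zhang, Pacific J. Math. 264 (2013); the text discloses that
« the proof in [JLZ13] uses Arthur's results » and uses the list « merely as a list of points » — recorded in the tranche docstring, no field, no premise);
C139's metaplectic case as a consumer of anything beyond what the text names (below); C131's Theorem 4.12 (Main) and its §§2–4 (eulerian global zeta integrals,
unramified computation: Arthur-free — no field); the exact-support computations (a `DownstreamSupport` section follows once the olean store is rebuilt; the
expected supports are stated in the tranche docstring).  No Mathlib, no `axiom`, no `sorry`, no `opaque`.
-/

set_option autoImplicit false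

namespace Literature.NumberTheory.Automorphic.Arthur2013

namespace Downstream

/-! ## Hundred-and-thirty-second tranche (v1 of this file, unit `pub-arthur-down-g57`, downstream tracer gen 57): THE FIELD-COVERAGE AUDIT's DESK LIST,
CONCLUDED FOR THREE ROWS — C126 (≡ C209; refinement fields `ELjlTransfer`, `ELgalois` and two second supply edges for tranche 82's fields), C139
(`GSmultiplicities`, `GSdoubleDescent`, `GSexactJ` — D. Ginzburg – D. Soudry, J. Number Theory 235 (2022) 1–156), C131 (`JZtransferL` — D. Jiang – L. Zhang,
Geom. Funct. Anal. 24 (2014) 552–609)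

WHY.  Unit `pub-arthur-down-g56` matched the census's 547 row ids against the register's structure fields (cell `GAPS.md` G-DN-529) and typed twelve of the
graded-but-untyped residue in tranches 128–131; its end-of-seat packet (G-DN-533 (B)) staged the texts of three more — C126, C139, C131 — for this tranche.
READING THEM AGAINST THE REGISTER FIRST CHANGED THE PLAN FOR C126: the paper censused on 2026-08-18 as row C126 from its arXiv text (J. Enns – H. Lee,
arXiv:2112.12256, block `[g5b]`) is the paper censused on 2026-08-22 as row C209 from its publisher text (Doc. Math. 29 (2024) 863–919, block `[g33b]`, « MR-number
citers of the book, II ») and TYPED in tranche 82 (`Downstream22.lean` v2: `Consumers82.ELstableTempered` = Corollary 4.1.1 ∧ Lemma 4.1.7 ⇐ book ∧ A4 ∧ A3,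
`ELmain` = Theorem 4.5.1 ⇐ `ELstableTempered`) — ONE paper, two row ids; the audit's « C126 without a field » is an artefact of the double id, not a gap.  So
this tranche does NOT re-type the paper.  It records the identification and adds, from the version of record down-g56 staged (`vor-C126/`), exactly what tranche
82's reading of the §1 sentence « various results on Arthur multiplicity formula [2, 28, 54] » does not carry: the two places where §4.1 invokes a typed input BY
NUMBER — Lemma 4.1.6 (« [2, Theorem 1.4.1] », the book; « [54, Theorem 4.0.1] », row A3) and Theorem 4.1.4 (« [44, Theorem 3.5] », row C191 = C. P. Mok,
Compos. Math. 150 (2014), tranche 28's `Consumers28.MokGSp4`, a CONDUIT row resting on the book and A4) — and the printed chain by which both feed Theorem 4.5.1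
(Remark 4.2.4 / Proposition 4.2.7 ⇐ Lemma 4.1.7 ∧ Theorem 4.1.4; Lemma 4.4.4 ⇐ « [28, Theorem 7.4.1] » = A4; Corollary 4.4.7 ⇐ Lemmas 4.4.4, 4.1.7; Lemma
4.4.14 ⇐ Proposition 4.2.7 (iii) ∧ Corollary 4.4.7; Theorem 4.5.1 ⇐ Lemmas 4.4.14, 4.4.15 ∧ Theorem 3.3.8), typed as SECOND SUPPLY EDGES for tranche 82's two
fields (the pattern of tranche 128's `E_BasicAssumptionQS0` / `QSp` for tranche 51's node).  C139 and C131 are typed as the census graded them (G-i, no status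
sentence): a by-number recall of the book's Theorem 1.5.2 and a remark-level consequence over an Arthur-free main theorem (C139); a definition-level consequence
of the book's and Mok's transfer (C131).

TEXTS (pNNNN.txt / Ln as in the file docstring; artefacts verbatim).  `vor-C126/` (C126 ≡ C209; bib `EnnsLee2024ModpLGCGSp4`): masthead p0001:L1-4 "Doc. Math. 29 (2024), 863–919 DOI 10.4171/DM/960© 2024 Deutsche Mathematiker-Vereinigung Published by EMS Press This work is licensed under a CC BY 4.0 license", title and
authors p0001:L5-7 "Modplocal-global compatibility for GSp4.Qp/in the ordinary case John Enns and Heejong Lee", dateline p0057:L2-3 "Communicated by Chandrashekhar Khare Received 30 January 2023; revised 23 February 2024.".  `paper-arxiv-2008.02462/` (C139; bib `GinzburgSoudry2022DoubleDescent`): title p0001:L1 "Double descent in classical groups".  `paper-arxiv-1212.6580/` (C131; bib `JiangZhang2014HermitianType`): title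
p0001:L1 "A Product of Tensor Product L-functions of Quasi-split Classical Groups of Hermitian Type".

(1) ROW C126 ≡ ROW C209 (census `[g5b]` G-iii-type from the arXiv text; `[g33b]` G-iii from the VoR; the SAME paper).  The status sentence tranche 82 quoted from
the publisher text stands verbatim in the staged VoR, 2024: p0037:L5-7 "Arthur described a classification of the discrete spectrum of GSp4with central charac- terin [1]. This classification was proven in [28], conditional on unpublished results of Arthur, Moeglin and Waldspurger. We freely use consequences of the classification below." ([1] = Arthur 2004, [28] = Gee – Taïbi = row A4).  THE TWO BY-NUMBER INVOCATIONS.  (a) LEMMA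
4.1.6 (a weak Jacquet – Langlands transfer from the compact-mod-centre inner form to GSp4, for regular algebraic cuspidal π′ with an attached mod p Galois
representation): its proof restricts to the derived group (an inner form of Sp4), transfers to GL5 and descends to Sp4 — p0038:L30-36 "Proof. LetHWDGderbe the derived subgroup of G. ThenHis an inner form of Sp4which splits at all finite places. By a theorem of Hiraga–Saito [28, Theorem 5.1.2], 0jH.AF/con- tains a regular algebraic cuspidal automorphic representation of H.AF/which we denote byQ0. By [54, Theorem 4.0.1], there exists a self-dual regular algebraic discrete automor- phic representation …of GL5.AF/which is a transfer of Q0. It is moreover cuspidal by [49, Theorem A]. Then by [2, Theorem 1.4.1], there exists a regular algebraic discrete automorphic representation Qof Sp4.AF/whose transfer to GL 5.AF/is…." […]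
p0038:L38-40 "Note that at all finite places v,Q0 v andQvhave the same L-parameter (these L-parameters are constructed in [2])." — « [2, Theorem 1.4.1] » = THE BOOK BY NUMBER (the existence half of the book's Theorem 1.5.2 for Sp4, stated as Theorem 1.4.1 for
a simple generic parameter; by the register's convention for a by-number citation of the book, classes B / C, the premise is the book at all ranks, `∀ N,
ν.Everything N`); « [54, Theorem 4.0.1] » = O. Taïbi, J. Eur. Math. Soc. 21 (2019) = row A3 ↦ `Consumers.TaibiInner`; « [28, Theorem 5.1.2] » is cited FOR A THEOREM
OF HIRAGA – SAITO — in row A4's held text (`paper-arxiv-1807.03988/`, T. Gee – O. Taïbi) the one statement so attributed reads p0024:L54-55 "Let us now formulate a direct consequence of [HiragaSaito], ignoring multiplicities." p0024:L57-61 "Theorem 31 (Hiraga–Saito). The map $\res^{\bG'}_\bG$ is surjective, and so any discrete automorphic representation for $\bG$ is an automorphic restriction of a discrete automorphic representation for $\bG'$. In other words, there exists a surjective map" […]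
(Hiraga – Saito, Mem. Amer. Math. Soc. 215 (2012): Arthur-free) — so [28] is here a CONDUIT for a published Arthur-free theorem, not a premise (the convention of
tranche 125's `E_JZnlioU` for « [18, Proposition 9.1] »); [49] Ramakrishnan, [14] Clozel, [57] Wallach, [46] Patrikis, [24] Gan – Takeda (Sp4): published,
Arthur-free, absorbed.  Typed: `ELjlTransfer` ⇐ book ∧ A3.  (b) THEOREM 4.1.4 (Galois representations r_{π,ℓ,ι} : G_F → GSp4(ℚ̄_ℓ) for stable tempered π of the
inner form, with local-global compatibility): p0038:L2-5 "Proof. The existence of r;`; satisfying the local-global compatibility with the stated Hodge–Tate weights follows from [52, Theorem B] together with [44, Theorem 3.5]. The symplecticity and similitude character in (i) follow from [4, Corollary 1.3] (cf. [44, Remark 3.3 (3)])." — « [52, Theorem B] » = C. M. Sorensen, J. Inst. Math. Jussieu 8 (2009) (the Jacquet – Langlands transfer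
for stable tempered representations; pre-book, not a census row; absorbed, as in tranche 82); « [4, Corollary 1.3] » = Bellaïche – Chenevier, Compos. Math. 147
(2011): Arthur-free, absorbed; « [44, Theorem 3.5] » = C. P. Mok, Compos. Math. 150 (2014) 523–567 = census row C191, typed in tranche 28 as the conduit field
`Consumers28.MokGSp4` (⇐ book ∧ A4: « we crucially rely on Arthur's works on endoscopic classification … for the group GSp_4 [A1,A2] ») from its held arXiv text
(`paper-arxiv-1109.5392/`), where the cited statement is the §3 summary theorem — p0015:L86 "We summarize the discussion of this section as:" p0015:L88-89 "Theorem 3.5. Suppose that $\Pi$ is a cuspidal automorphic representation on $\GSp_4(\mathbf{A}_F)$ satisfying the hypotheses in the beginning of section 3.2. Then for each prime $p$, there exists a continuous semi-simple Galois representation" […] — of which the field's quoted Theorem 3.1 (simple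
generic parameters) is the key case, and « [44, Remark 3.3 (3)] » is p0014:L52 "3. The main theorem of Bellaiche-Chenevier [BC2] gives the result that the image of $\rho_p$ lies in $\GSp_4(\barQp)$."  Typed: `ELgalois` ⇐ row C191.  (c) THE CHAIN TO THEOREM
4.5.1, as the VoR prints it: Remark 4.2.4 p0041:L28-29 "Moreover, such is necessarily stable and tempered by Lemma 4.1.7, and we can apply Theorem 4.1.4 to obtain" […]; Proposition 4.2.7's proof p0042:L20-25 "Proof. By Lemma 4.1.7 and the irreducibility of Nr, we know that the automorphic repre- sentation associated with Hecke eigensystem TP ;.U/mP Nr !E0is stable and tempered. Then the Proposition can be shown by using Theorem 4.1.4 and a standard argument using Lemma 4.2.6;" […]; Lemma 4.4.4's proof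
p0046:L25-26 "Proof. By [28, Theorem 7.4.1], std .Nr/is potentially diagonalizably automorphic in the sense of [3]." […] p0046:L29-30 "Again by applying [28, Theorem 7.4.1] (also see [6, Theorem 2.9.3]), this proves the existence ofsuch that" […] (« [28, Theorem 7.4.1] » = row A4's typed theorem ↦ `Consumers.GeeTaibi`; « [6, Theorem 2.9.3] » = row C9
Boxer – Calegari – Gee – Pilloni's restatement of the GSp4 classification from [28] — named with A4, as in tranche 82; [3] = BLGGT: Arthur-free); Corollary 4.4.7's
proof p0048:L9-10 "By Lemmas 4.4.4, 4.1.7, and [52, Theorem B], there exists an automorphic representation ofG.AF/such that" […]; Lemma 4.4.14's proof p0051:L5-6 "Axiom (PM4) follows also from Proposition 4.2.7 (iii) similar to [11, proof of Lemma 4.17]." […] p0051:L8-9 "Finally, (PM6) follows from Corol- lary 4.4.7."; and the main theorem p0051:L36-38 "We can now prove the main result. Theorem 4.5.1. Let.F;Nr;/ be suitable of weight .a3;a2;a1;a0/withDp-crisas in Sec- tion4.4, andGbe as in Section 4.1. Letwbe a place of Fdividingp." […] p0051:L42 "Proof. This follows from Lemmas 4.4.14 and 4.4.15 and Theorem 3.3.8."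  Lemma 4.1.7's own
proof rests on Lemma 4.1.6 (for the inner form) and on « [6, Theorem 2.9.3] » / « Arthur's classification (see item (a)–(f) at the end of [1]) » ([1] = Arthur
2004 ↦ the book ∧ A4, the register's standing resolution, tranches 29 / 127 / 129 / 130), with Piatetski-Shapiro – Soudry [48, 53], Shin [51], Gan – Takeda [25]
Arthur-free: p0039:L39-44 "Proof. IfGDG, then we can apply Lemma 4.1.6 to replace by a regular cuspidal automorphic representation of GSp4.AF/to whichNris attached. Since being stable and tempered is characterized by components at almost all finite places, it suffices to prove the claim forGDGSp4, andNr'Nr;p; in this case. By [6, Theorem 2.9.3], the irreducibility ofNrimplies thatis of general type, which implies that is stable and tempered by Arthur’s classification (see item (a)–(f) at the end of [1])."  Typed: `E_ELstableTemperedVoR` ⇐ `ELjlTransfer` ∧ book ∧ A4 (A3 enters through Lemma 4.1.6 only) and `E_ELmainVoR` ⇐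
`ELstableTempered` ∧ `ELgalois` ∧ A4 — second supply edges for tranche 82's fields, next to its `E_ELstableTempered` (⇐ book ∧ A4 ∧ A3, the §1 sentence) and
`E_ELmain` (⇐ `ELstableTempered`).  Corollary 4.1.1 (multiplicity one) is not invoked by number anywhere later in the VoR (the patching of §4.2 allows
multiplicities, p0036:L46-49); it stays inside tranche 82's field.  Census bookkeeping (cell `DOWNSTREAM5.md`): C126's venue column becomes « = C209 (Doc. Math.
29 (2024)) »; one paper, grade G-iii as C209.

(2) ROW C139 (census `[g5c]`, G-i: « the main double-descent identities do not rest on the classification »).  D. Ginzburg – D. Soudry construct, for a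
self-dual cuspidal τ on GL_n(𝔸) with trivial central character, ALL cuspidal σ on the classical group H^{(ε)}_m(𝔸) lifting weakly to τ, by a double descent
(a Fourier coefficient of a residue of an Eisenstein series on a larger group H, restricted to H^{(ε)}_m × H^{(ε)}_m); the four cases p0012:L16 "Let us write in detail the groups $H^{(\epsilon)}_m$ according to $\tau$."
p0012:L18 "Assume that $L(\tau,\wedge^2,s)$ has a pole at $s=1$. Then $n=2(m'-1)$ is even, $m=2m'-1=n+1$, $H_m^{(\epsilon)}=H_m=\SO_{2m'-1}$, and $H=\SO_{4(m'-1)(2m'-1)}$." / p0012:L20 "Assume that $L(\tau,\wedge^2,s)$ has a pole at $s=1$, and $L(\tau,\frac{1}{2})\neq 0$. Then $n=2m'$ is even, $m=2m'=n$, $H_m^{(\epsilon)}=H^{(2)}_m=\Sp^{(2)}_{2m'}$, and $H=\Sp^{(2)}_{8(m')^2}$." / p0012:L22 "Assume that $L(\tau, \vee^2,s)$ has a pole at $s=1$, and $n=2m'$ is even. Then $m=2m'=n$, $H_m^{(\epsilon)}=H_m=\SO_{2m'}$, and $H=\SO_{8(m')^2}$." / p0012:L24 "Assume that $L(\tau,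 \vee^2,s)$ has a pole at $s=1$, and $n=2m'-1$ is odd. Then $m=2m'-2=n-1$, $H_m^{(\epsilon)}=H_m=\Sp_{2m'-2}$, and $H=\Sp_{4(m'-1)(2m'-1)}$." (case two is
METAPLECTIC, H^{(2)}_m = Sp^{(2)}_{2m'}: outside the book's groups).  THE BOOK IS INVOKED THREE TIMES, never inside a proof: (i) §1, BY NUMBER, framing the goal —
p0003:L3 "Our main goal in this paper is to construct explicitly all irreducible, automorphic, cuspidal representations $\sigma$ of $G(\BA)$, which lift (weakly) to $\tau$. More precisely, for each isomorphism class of such a $\sigma$, we will construct a certain unique representative. Thanks to Arthur (Theorem 1.5.2 in [A13]), we know that when $G$ is symplectic, or odd orthogonal these multiplicities are 1, and for $G$ even orthogonal, these multiplicities are 1, or 2." (Theorem 1.5.2 = the book's decomposition of L²_disc with its multiplicity statement; premise the book at all ranks) ↦ `GSmultiplicities`;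
(ii) §2, with a PARALLEL ARTHUR-FREE ATTRIBUTION — p0012:L52 "We remark that thanks to the work of Arthur [A13], and independently, the work [CFK18], we now know that the cuspidal representation $\sigma$ lifts weakly to an irreducible automorphic representation of $\GL_n(\BA)$, and then it follows that $\sigma$ lifts to $\tau$ if and only if $L^S_{\epsilon,\psi}(\sigma \times \tau,s)$ has a pole at $s=1$." ([CFK18] = Y. Cai – S. Friedberg – E. Kaplan, arXiv:1802.02637 = census row E5, the doubling construction the
cell's AGIKMS input itself names as « unconditional … because it avoids the trace formula »; under the register's minimal reading a statement with a printed
Arthur-free supplier inherits nothing — recorded, no field); (iii) §3, after the main theorem, BY NAME — p0013:L4 "We remark that with the knowledge of Arthur's multiplicity formulas, we know that except the case $H^{(\epsilon)}_m=\SO_{2m'}$, $J$ in the theorem consists exactly of all irreducible, automorphic, cuspidal representations of $H^{(\epsilon)}_m(\BA)$, which lift weakly to $\tau$." ↦ `GSexactJ` ⇐ the book at all ranks (« Arthur's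
multiplicity formulas ») ∧ Theorem 3.4 (`GSdoubleDescent`, the paper's own theorem, Arthur-free: Eisenstein series, the descent of [GRS11], the doubling integrals of
[CFK18] / [GS18], the tower of Fourier coefficients of §§4–13).  The excepted case SO_{2m'} is the book's even orthogonal case (multiplicity 1 or 2, Theorem 1.5.2);
for the metaplectic case the multiplicity formula is not the book's (the register's metaplectic rows, W. T. Gan – A. Ichino, are NOT named by this text at this
place — no premise is added for it: the edge records the supplier the text prints).  A DISCLOSURE, §4: p0014:L3 "In [JLZ13], the possible poles of the normalized Eisenstein series $E^*(f_{\Delta(\tau,m)\gamma^{(\epsilon)}_\psi,s})$ in $Re(s)\geq 0$ (1.12) are determined. As remarked in [CFK18], the proof in [JLZ13] uses Arthur's results. We now recall the list of possible poles from [JLZ13]. We include the case of metaplectic groups which does not appear in [JLZ13], but can be obtained similarly. We will address the existence of these poles in a forthcoming work of ours. For the moment, we consider the above list merely as a list of points." ([JLZ13] = p0078:L72 "D. Jiang, B. Liu, and L. Zhang. Poles of certain residual Eisenstein series of classical groups. Pacific J. Math., 264(1) (2013), 83–123." — not a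
census row; its list enters « merely as a list of points », so nothing is inherited through it and no premise is typed).  Bibliography: p0078:L3-4 "[A13] J. Arthur. The endoscopic classification of representations: orthogonal and symplectic groups. AMS Colloquium Publications 61, (2013)." / p0078:L9-10 "[CFK18] Y. Cai, S. Friedberg, and E. Kaplan. Doubling constructions: local and global theory, with an application to global functoriality for non-generic cuspidal representations.arXiv:1802.02637.".

(3) ROW C131 (census `[g5c]`, G-i, definition level).  For G_n quasi-split U_{n,n}, U_{n+1,n}, SO_{2n+1}, SO_{2n} over a number field and cuspidal π on G_n(𝔸),
the introduction takes from the book (orthogonal G_n) and from Mok's memoir (unitary G_n) the transfer π_ψ to the general linear group and with it the identity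
of partial L-functions and, for generic global parameters, the DEFINITION of the complete tensor-product L-function: p0003:L52-54 "According to the recent work of Arthur ( [Ar12]) and also of C.-P. Mok ( [Mk12]), any irreducible cuspidal automorphic representation $\pi$ of $G_n(\BA)$ has the Arthur-Langlands transfer $\pi_\psi$ from $G_n$ to the corresponding general linear group, which is compatible with the corresponding local Langlands functorial transfers at all unramified local places of $\pi$." p0003:L55 "Hence we have an identity for partial $L$-functions" [L^S(s, π × τ) =
L^S(s, π_ψ × τ)] p0003:L61-64 "When $\pi$ has a generic global Arthur parameter, the Arthur-Langlands transfer from $G_n$ to general linear groups is compatible with the corresponding local Langlands functorial transfer at all local places. Hence one may define the complete tensor product $L$-function by" [L(s, π × τ) := L(s, π_ψ × τ)] p0003:L70 "just as in ( [Ar12] and [Mk12])." — [Ar12] = p0029:L10-13 "[Ar12] Arthur, James The endoscopic classification of representations: Orthogonal and Symplectic groups. Online 2012 (http://www.claymath.org/cw/arthur/)." (the book, cited from its 2012 Clay-hosted text) ↦ `∀ N,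
ν.Everything N`; [Mk12] = p0029:L120-123 "[Mk12] Mok, Chung Pang Endoscopic classification of representations of quasi-split unitary groups. submitted (2012)." (Mok's memoir, Mem. Amer. Math. Soc. 235 (2015) = the cell's `Mok2015` module) ↦ `∀ N, μ.Everything N`.  Typed: `JZtransferL` ⇐ book ∧
Mok.  The paper's theorems — the eulerian factorisation of the global zeta integrals built on Bessel periods and the unramified computation, main Theorem 4.12
p0026:L124-129 "Theorem 4.12 (Main). Assume that $j=\ell+1$. Let $E(\phi_{\tau\otimes\sig},s)$ be the Eisenstein series on $G_n(\BA)$ as in (es) and let $\pi$ be an irreducible cuspidal automorphic representation of $H_{n-\ell}(\BA)$. Assume that the real part of $s$, $\Re(s)$, is large, and that $\pi$ and $\sig$ have a non-zero spherical Bessel period. Then the global zeta integral $\CZ(s,\phi_{\tau\otimes\sig},\varphi_{\pi},\psi_{\ell,w_{0}})$ is eulerian," […] — are Arthur-free (Langlands' constant terms, [GPSR97], [GRS11], [JPSS83]); the non-generic caveat of the same introduction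
(the sentences following p0003:L70, which this register's lint keeps to the comment lines) is the authors' own and motivates the integrals; no field.

THE POINT FOR THE REGISTER (kernel, below).  C126 ≡ C209: the VoR's by-number chain closes Theorem 4.5.1 from EXACTLY tranche 82's three premises — the book
at all ranks, A4, A3 — because row C191 is itself supplied by the book ∧ A4 (tranche 28's edge): `c209_vor_route_of_t82_rows`; from the book's inputs both routes
give `ELmain` (`elMain_of_leaves_VoR`, and tranche 82's `elMain_of_inputs`), and the two tranches' edges compose (`elMain_mixed_routes`); conditional form
`el_vor_conditional_form`.  C139: `GSmultiplicities` from the book's inputs outright; `GSexactJ` from the book's inputs GIVEN Theorem 3.4, which inherits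
nothing (`gs_conditional_form`).  C131: `JZtransferL` from the book's AND Mok's inputs (`jz_conditional_form`: both monographs' 2024–2026 preprint layers and
both pairs of weighted fundamental lemmas; KMSW plays no role).  Exact supports are owed to the support-section backlog (store frozen, B18-3): by construction
the book's 24 leaves for `ELjlTransfer`, `ELgalois`, the VoR route to `ELmain`, `GSmultiplicities` and (given Theorem 3.4) `GSexactJ`; the book's 24 ∪ Mok's 29
for `JZtransferL`; ∅ for `GSdoubleDescent`. -/

/-- Rows C126 (≡ C209, refinement), C139 and C131 of the census, as an arbitrary assignment of truth values: what the register records is which typed input each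
TEXT invokes (the `E_…` hypotheses below), never the truth of a field. [cite: Arthur2013, downstream register of the cell, hundred-and-thirty-second tranche (structure only)] -/
structure Consumers132 where
  /-- C126 ≡ C209, LEMMA 4.1.6 AS PRINTED (J. Enns – H. Lee, *Mod p local-global compatibility for GSp4(ℚ_p) in the ordinary case*, Doc. Math. 29 (2024) 863–919, doi:10.4171/dm/960; `vor-C126/` under `HOME/pub-arthur-down-g56/primaries/`; G the inner form of GSp4 over the totally real F of §4.1, compact mod centre at infinity and split at all finite places; « attached » as defined at p0038:L20-23; the extraction drops π′, π, r̄): p0038:L24-29 "Lemma 4.1.6. Let0be a regular algebraic cuspidal automorphic representation of G.AF/. Suppose that there exists a continuous semisimple representation NrWGF! GSp4.F/attached to0. Then there exists a regular algebraic cuspidal automorphic rep- resentationofGSp4.AF/which is a weak Jacquet–Langlands transfer of 0. In other words, we have v'0 vfor almost all finite places vofF." [cite: EnnsLee2024ModpLGCGSp4, Lemma 4.1.6 (VoR p0038:L24-29; proof p0038:L30 – p0039:L35)] -/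
  ELjlTransfer : Prop
  /-- C126 ≡ C209, THEOREM 4.1.4 AS PRINTED (`vor-C126/`; χ a Hecke character satisfying (4.1.2), A_{χ,σ} the σ-isotypic automorphic forms on G(𝔸_F) of central character χ, p0036:L43-49; the extraction drops χ, π, σ, ι): p0037:L24-29 "Theorem 4.1.4. Assume thatsatisfies (4.1.2) , and letbe a stable and tempered auto- morphic representation of Gthat contributes to A;. For any prime `and choice of isomorphism WxQ` !Cthere exists a (unique up to isomorphism) continuous semisim- ple representation r;`;WGF!GSp4.xQ`/ satisfying:" [(i) de Rham at ℓ, (ii) local-global compatibility with rec^{GT} at every finite place and the stated Hodge – Tate weights, (iii) the similitude character, p0037:L30-37] — and the convention following it: p0038:L6-9 "Fora regular cuspidal automorphic representation of GSp4.AF/with central char- acter, we also write r;`;for a continuous semisimple representation r;`;WGF!GSp4.xQ`/ satisfying items (i)–(iii) above constructed by [44, Theorem 3.5]." [cite: EnnsLee2024ModpLGCGSp4, Thm 4.1.4 (VoR p0037:L24-37; proof p0038:L2-5), convention (p0038:L6-9)] -/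
  ELgalois : Prop
  /-- C139, THE INTRODUCTION's BY-NUMBER RECALL OF THE BOOK's THEOREM 1.5.2 (D. Ginzburg – D. Soudry, *Double descent in classical groups*, J. Number Theory 235 (2022) 1–156, doi:10.1016/j.jnt.2021.08.012; `paper-arxiv-2008.02462/` = arXiv v1, the JNT version of record not compared; τ an irreducible self-dual cuspidal automorphic representation of GL_n(𝔸) with trivial central character, G the symplectic or split special orthogonal group of which τ is the functorial lift, p0003:L3): the multiplicities with which the irreducible cuspidal σ of G(𝔸) lifting weakly to τ occur — p0003:L3 "Thanks to Arthur (Theorem 1.5.2 in [A13]), we know that when $G$ is symplectic, or odd orthogonal these multiplicities are 1, and for $G$ even orthogonal, these multiplicities are 1, or 2." [cite: GinzburgSoudry2022DoubleDescent, §1 (arXiv v1 chunk p0003:L3); Arthur2013, Thm 1.5.2 (as cited)] -/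
  GSmultiplicities : Prop
  /-- C139, THEOREM 3.4 AS PRINTED (the main theorem; `paper-arxiv-2008.02462/`; τ, H^{(ε)}_m, H and m as in the four cases p0012:L18-24, the double descent 𝒟𝒟_ψ(τ) of p0012:L31-32, ι the outer conjugation of (1.10.1)): p0012:L54-57 "The main theorem of this paper is  Theorem 3.4. Let $\tau$ and $H^{(\epsilon)}_m$ be as in Theorem (thm 2.2). The (nontrivial) representation $\mathcal{D}\mathcal{D}_\psi(\tau)$ of $H^{(\epsilon)}_m(\BA)\times H^{(\epsilon)}_m(\BA)$ is cuspidal. It decomposes into a multiplicity free direct sum of the form" [𝒟𝒟_ψ(τ) = ⊕_σ (σ ⊗ σ̄^ι), (3.3)] p0013:L1 "where $\sigma$ varies over a set $J$ of irreducible, automorphic, cuspidal representations of $H^{(\epsilon)}_m(\BA)$, which lift weakly to $\tau$. Each irreducible, automorphic, cuspidal representation of $H^{(\epsilon)}_m(\BA)$, which lifts weakly to $\tau$ is isomorphic to a (unique) representation in $J$." — the paper's own theorem, proved in §§3–13 WITHOUT the classification (no supplier edge: a premise of the next field only). [cite: GinzburgSoudry2022DoubleDescent, Thm 3.4 (arXiv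 v1 chunk p0012:L54 – p0013:L1)] -/
  GSdoubleDescent : Prop
  /-- C139, THE §3 REMARK AS PRINTED (the consequence drawn from the multiplicity formula right after Theorem 3.4; `paper-arxiv-2008.02462/`): p0013:L4 "We remark that with the knowledge of Arthur's multiplicity formulas, we know that except the case $H^{(\epsilon)}_m=\SO_{2m'}$, $J$ in the theorem consists exactly of all irreducible, automorphic, cuspidal representations of $H^{(\epsilon)}_m(\BA)$, which lift weakly to $\tau$." [cite: GinzburgSoudry2022DoubleDescent, §3, remark after Thm 3.4 (arXiv v1 chunk p0013:L4)] -/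
  GSexactJ : Prop
  /-- C131, THE INTRODUCTION's TRANSFER STATEMENT WITH ITS TWO CONSEQUENCES AS PRINTED (D. Jiang – L. Zhang, *A product of tensor product L-functions of quasi-split classical groups of Hermitian type*, Geom. Funct. Anal. 24 (2014) 552–609, doi:10.1007/s00039-014-0266-7; `paper-arxiv-1212.6580/` = arXiv v2, the GAFA version of record not compared; G_n quasi-split U_{n,n}, U_{n+1,n}, SO_{2n+1} or SO_{2n} over the number field F, p0003:L3-5; τ isobaric as in (1.1), π irreducible cuspidal on G_n(𝔸)): p0003:L52-54 "According to the recent work of Arthur ( [Ar12]) and also of C.-P. Mok ( [Mk12]), any irreducible cuspidal automorphic representation $\pi$ of $G_n(\BA)$ has the Arthur-Langlands transfer $\pi_\psi$ from $G_n$ to the corresponding general linear group, which is compatible with the corresponding local Langlands functorial transfers at all unramified local places of $\pi$." p0003:L55 "Hence we have an identity for partial $L$-functions" [L^S(s, π × τ) = L^S(s, π_ψ × τ)]; p0003:L61-64 "When $\pi$ has a generic global Arthur parameter, the Arthur-Langlands transfer from $G_n$ to general linear groups is compatible with the corresponding local Langlands functorial transfer at all local places. Hence one may define the complete tensor product $L$-function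 by" [L(s, π × τ) := L(s, π_ψ × τ),] p0003:L70 "just as in ( [Ar12] and [Mk12])." [cite: JiangZhang2014HermitianType, §1 (arXiv v2 chunk p0003:L52-70); Arthur2013 and Mok2012 (as cited, « [Ar12] », « [Mk12] »)] -/
  JZtransferL : Prop

-- Verbatim lines kept out of the docstrings by the register's lint (sentences naming a conj. or an « open problem ») and bibliography entries.
-- C126 ≡ C209, `vor-C126/`: Lemma 4.1.7's temperedness half p0039:L51-56 "To show that is tempered, note that the transfer …ofto GL4is cuspidal. By Ramanujan conjecture (proven in [51] in this case), …vis tempered for all places v. This implies that the L-parameter attached to …vhas a bounded image. By [25, Main Theo- rem (vii)], the L-packet containing vhas a unique generic tempered element. Then for any finite place vat whichis unramified, vis generic tempered because the L-packet containing it is a singleton."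
--   Remark 4.1.5 (no premise of anything; [59] = row C82, [58] = A. Weiss's thesis) p0038:L10-12 "Remark 4.1.5. (i) One expects r;`;to always be irreducible if is of general type. This is known forFDQand`5[59, Theorem 1.1] and Ftotally real and sufficiently large `[58, Theorem A]."
--   bibliography p0054:L3-5 "[1] J. Arthur, Automorphic representations of GSp .4/. InContributions to automorphic forms, geometry, and number theory , pp. 65–81, Johns Hopkins University Press, Baltimore, MD, 2004 Zbl 1080.11037 MR 2058604" / p0054:L6-8 "[2] J. Arthur, The endoscopic classification of representations. Orthogonal and symplectic groups . Amer. Math. Soc. Colloq. Publ. 61, American Mathematical Society, Providence, RI, 2013 Zbl 1297.22023 MR 3135650" / p0054:L11-13 "[4] J. Bellaïche and G. Chenevier, The sign of Galois representations attached to automorphic forms for unitary groups. Compos. Math. 147(2011), no. 5, 1337–1352 Zbl 1259.11058 MR 2834723"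
--   / p0054:L16-18 "[6] G. Boxer, F. Calegari, T. Gee, and V . Pilloni, Abelian surfaces over totally real fields are poten- tially modular. Publ. Math. Inst. Hautes Études Sci. 134(2021), 153–501 Zbl 1522.11045 MR 4349242" / p0055:L22-23 "[28] T. Gee and O. Taïbi, Arthur’s multiplicity formula for GSp4and restriction to Sp4.J. Éc. polytech. Math. 6(2019), 469–535 Zbl 1468.11115 MR 3991897"
--   / p0056:L10-11 "[44] C. P. Mok, Galois representations attached to automorphic forms on GL 2over CM fields. Compos. Math. 150(2014), no. 4, 523–567 Zbl 1296.11146 MR 3200667" / p0056:L14-15 "[46] S. Patrikis, Variations on a theorem of Tate. Mem. Amer. Math. Soc. 258(2019), no. 1238, viii+156 Zbl 1455.11003 MR 3915584" / p0056:L20-22 "[49] D. Ramakrishnan, Irreducibility and cuspidality. In Representation theory and automorphic forms , pp. 1–27, Progr. Math. 255, Birkhäuser, Boston, MA, 2008 Zbl 1302.11034 MR 2369494"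
--   / p0056:L28-29 "[52] C. M. Sorensen, Potential level-lowering for GSp .4/.J. Inst. Math. Jussieu 8(2009), no. 3, 595–622 Zbl 1257.11044 MR 2516307" / p0056:L32-34 "[54] O. Taïbi, Arthur’s multiplicity formula for certain inner forms of special orthogonal and sym- plectic groups. J. Eur. Math. Soc. (JEMS) 21(2019), no. 3, 839–871 Zbl 1430.11074 MR 3908767"
-- C139, `paper-arxiv-2008.02462/`: p0013:L3 "We will call the set-up of Theorem (thm 2.2), (as well as Theorem (thm 2.4))," [« the case of functoriality »]; bibliography p0078:L56-59 "[GRS11] D. Ginzburg, S. Rallis, and D. Soudry.The descent map from automorphic representation of $\GL(n)$ to classical groups. World Scientific (2011)" / p0078:L61-62 "[GS18] D. Ginzburg and D. Soudry.Two identities relating Eisenstein series on classical groups. arXiv: 1804.05295"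
-- C131, `paper-arxiv-1212.6580/`: the caveat p0003:L72-79 "However, when the global Arthur parameter $\psi$ is not generic, there exists irreducible cuspidal automorphic representation $\pi$ with Arthur parameter $\psi$, but there exists a ramified local place $\nu$ such that $\pi_\nu$ and $(\pi_\psi)_\nu$ are not related by the local Langlands functorial transfer at $\nu$. Hence it is impossible to define the local tensor product $L$-factors (and also $\gamma$-factors and $\epsilon$-factors) of the pair $(\pi_\nu,\tau_\nu)$ in terms of those of the pair $((\pi_\psi)_\nu,\tau_\nu)$. Therefore, it is still an open problem to define the local ramified $L$-factors (and also $\gamma$-factors and $\epsilon$-factors) for an irreducible cuspidal automorphic representation $\pi$ of $G_n(\BA)$ when $\pi$ has a non-generic global Arthur parameter. At this point, it seems that the integral representation of Rankin-Selberg type for automorphic $L$-functions is the only available method to attack this open problem."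
--   and p0003:L47-50 "In general, the meromorphic continuation to the whole complex plane of the product of the tensor product (partial) $L$-functions is known from the work of R. Langlands on the explicit calculation of the constant terms of Eisenstein series ( [L71]). However, when $\pi$ is not generic, i.e. has no nonzero Whittaker-Fourier coefficients, the Langlands conjecture on the standard functional equation and the finite number of poles for $\Re(s)\geq\frac{1}{2}$ is still not known ( [Sh10])."; §4 after the main theorem p0027:L18-21 "There is a standard method to prove from this global identity that the partial $L$-functions $L^S(s+\frac{1}{2},\pi \times\tau )$ has meromorphic continuation to the whole complex plane. It is more important to develop the local theory which extends the partial $L$-function to the complete $L$-function in this setting and hence to prove the functional equation and other analytic properties of the complete $L$-functions of this type. This is our on-going project and will be reported in our future work."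
-- C191's own flag (`paper-arxiv-1109.5392/`, the sentence tranche 28 quoted): p0005:L15 "On the use of Arthur's results" p0005:L17 "In this paper we crucially rely on Arthur's works on endoscopic classification of automorphic representations for the group $\GSp_4$ [A1,A2]."

/-- C126's LEMMA 4.1.6 ⇐ THE BOOK BY NUMBER ∧ ROW A3 (`vor-C126/`, proof p0038:L30-40, p0039:L2-35, quoted in the tranche docstring): « [2, Theorem 1.4.1] » and « (these L-parameters are constructed in [2]) » — [2] = p0054:L6-7 "[2] J. Arthur, The endoscopic classification of representations. Orthogonal and symplectic groups ." ↦ `∀ N, ν.Everything N` (the book at all ranks, the register's convention for a by-number use); « [54, Theorem 4.0.1] » — [54] = O. Taïbi, J. Eur. Math. Soc. 21 (2019) = row A3 ↦ `Consumers.TaibiInner`; « [28, Theorem 5.1.2] » = Gee – Taïbi's statement of a theorem of Hiraga – Saito (conduit for an Arthur-free published theorem, not a premise); [49], [14], [57], [46], [24]: Arthur-free, absorbed.  Premises: the book at all ranks, A3. [cite: EnnsLee2024ModpLGCGSp4, Lemma 4.1.6 and its proof (VoR p0038:L24 – p0039:L35); Arthur2013, Thm 1.4.1 (as cited); Taibi2018,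 Thm 4.0.1 (as typed in `Consumers.TaibiInner`)] -/
def E_ELjlTransfer (ν : Nodes) (c : Consumers) (c₁₃₂ : Consumers132) : Prop :=
  (∀ N, ν.Everything N) → c.TaibiInner → c₁₃₂.ELjlTransfer

/-- C126's THEOREM 4.1.4 ⇐ ROW C191 (`vor-C126/`, proof p0038:L2-5, quoted in the tranche docstring): « [44, Theorem 3.5] » / « [44, Remark 3.3 (3)] » — [44] = p0056:L10-11 "[44] C. P. Mok, Galois representations attached to automorphic forms on GL 2over CM fields. Compos. Math. 150(2014), no. 4, 523–567 Zbl 1296.11146 MR 3200667" = census row C191 ↦ `Consumers28.MokGSp4` (tranche 28: the conduit field typed from the held arXiv text of the same paper, whose §3 summary theorem is the cited Theorem 3.5); « [52, Theorem B] » (C. M. Sorensen, J. Inst. Math. Jussieu 8 (2009)) and « [4, Corollary 1.3] » (J. Bellaïche – G. Chenevier, Compos. Math. 147 (2011)): Arthur-free published inputs, absorbed.  Premise: row C191. [cite: EnnsLee2024ModpLGCGSp4, Thm 4.1.4 and its proof (VoR p0037:L24 – p0038:L9); Mok2014Compositio, Thm 3.5 / Thm 3.1 (as typed in `Consumers28.MokGSp4`)]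 -/
def E_ELgalois (c₂₈ : Consumers28) (c₁₃₂ : Consumers132) : Prop :=
  c₂₈.MokGSp4 → c₁₃₂.ELgalois

/-- A SECOND SUPPLY EDGE FOR TRANCHE 82's `Consumers82.ELstableTempered` (= Corollary 4.1.1 ∧ Lemma 4.1.7 of the same paper), from the §4.1 PROOFS as the version of record prints them (`vor-C126/`): Lemma 4.1.7 ⇐ Lemma 4.1.6 (`ELjlTransfer`, for G the inner form) ∧ « [6, Theorem 2.9.3] » ∧ « Arthur's classification (see item (a)–(f) at the end of [1]) » (p0039:L39-44) — [6] = row C9's restatement of the GSp4 classification from [28], [1] = Arthur 2004: both ↦ the book at all ranks ∧ row A4 (`Consumers.GeeTaibi`), the register's standing resolution of [Art04] (tranches 29, 127, 129, 130) —, with [48, 53], [51], [25] Arthur-free; Corollary 4.1.1 ⇐ « Arthur's multiplicity theorem (cf. [28] or [6, Theorem 2.9.3]) » ∧ « Arthur's classification » (p0037:L10-16) ↦ the same two premises, with « [52, Theorem B] » absorbed.  Next to tranche 82's `E_ELstableTempered` (⇐ book ∧ A4 ∧ A3, the §1 sentence « [2, 28, 54] »): here A3 enters only through Lemma 4.1.6.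  Premises: `ELjlTransfer`, the book at all ranks, A4. [cite: EnnsLee2024ModpLGCGSp4, Cor. 4.1.1 with proof (VoR p0037:L8-16), Lemma 4.1.7 with proof (p0039:L36-56); GeeTaibi2019, Thm 7.4.1 (as typed in `Consumers.GeeTaibi`)] -/
def E_ELstableTemperedVoR (ν : Nodes) (c : Consumers) (c₈₂ : Consumers82) (c₁₃₂ : Consumers132) : Prop :=
  c₁₃₂.ELjlTransfer → (∀ N, ν.Everything N) → c.GeeTaibi → c₈₂.ELstableTempered

/-- A SECOND SUPPLY EDGE FOR TRANCHE 82's `Consumers82.ELmain` (= Theorem 4.5.1), THE PRINTED CHAIN (`vor-C126/`, loci quoted in the tranche docstring): Theorem 4.5.1 ⇐ Lemmas 4.4.14, 4.4.15 ∧ Theorem 3.3.8 (p0051:L42); Lemma 4.4.14 ⇐ Proposition 4.2.7 (iii) [(PM3), (PM4)] ∧ Corollary 4.4.7 [(PM6)] (p0050:L71 – p0051:L9); Proposition 4.2.7 ⇐ Lemma 4.1.7 ∧ Theorem 4.1.4 (p0042:L20-25; Remark 4.2.4, p0041:L25-32) ↦ `ELstableTempered` ∧ `ELgalois`; Corollary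 4.4.7 ⇐ Lemmas 4.4.4, 4.1.7 ∧ [52, Theorem B] (p0048:L7-11), Lemma 4.4.4 ⇐ « [28, Theorem 7.4.1] » twice (p0046:L25-30) ↦ `Consumers.GeeTaibi` (row A4); Theorem 3.3.8, Lemmas 4.4.15, 4.3.9, 4.4.11, 4.4.13, the Taylor – Wiles patching after [11], Kisin modules, BLGGT [3], Patrikis – Tang [47], [52]: Arthur-free or internal, absorbed.  Next to tranche 82's `E_ELmain` (⇐ `ELstableTempered`).  Premises: `ELstableTempered` (tranche 82), `ELgalois`, A4. [cite: EnnsLee2024ModpLGCGSp4, Thm 4.5.1 with proof (VoR p0051:L36-42), Lemma 4.4.14 (p0050:L68 – p0051:L9), Prop. 4.2.7 (p0041:L50 – p0042:L27), Cor. 4.4.7 (p0048:L4-11), Lemma 4.4.4 (p0046:L15-30)] -/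
def E_ELmainVoR (c : Consumers) (c₈₂ : Consumers82) (c₁₃₂ : Consumers132) : Prop :=
  c₈₂.ELstableTempered → c₁₃₂.ELgalois → c.GeeTaibi → c₈₂.ELmain

/-- C139's INTRODUCTORY MULTIPLICITY STATEMENT ⇐ THE BOOK BY NUMBER (`paper-arxiv-2008.02462/` p0003:L3, in the field): « Theorem 1.5.2 in [A13] » — [A13] = p0078:L4 "J. Arthur. The endoscopic classification of representations: orthogonal and symplectic groups. AMS Colloquium Publications 61, (2013)." ↦ `∀ N, ν.Everything N`.  Premise: the book at all ranks. [cite: GinzburgSoudry2022DoubleDescent, §1 (arXiv v1 chunk p0003:L3); Arthur2013, Thm 1.5.2 (as cited)] -/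
def E_GSmultiplicities (ν : Nodes) (c₁₃₂ : Consumers132) : Prop :=
  (∀ N, ν.Everything N) → c₁₃₂.GSmultiplicities

/-- C139's §3 REMARK ⇐ THE BOOK BY NAME ∧ ITS THEOREM 3.4 (`paper-arxiv-2008.02462/` p0013:L4, in the field): « with the knowledge of Arthur's multiplicity formulas » ↦ `∀ N, ν.Everything N` (the supplier the text prints; its case two is metaplectic, for which the text names no other supplier and none is added); « J in the theorem » ↦ `GSdoubleDescent` (Theorem 3.4, Arthur-free).  Premises: the book at all ranks, Theorem 3.4. [cite: GinzburgSoudry2022DoubleDescent, §3 (arXiv v1 chunk p0013:L4), Thm 3.4 (p0012:L54 – p0013:L1)] -/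
def E_GSexactJ (ν : Nodes) (c₁₃₂ : Consumers132) : Prop :=
  (∀ N, ν.Everything N) → c₁₃₂.GSdoubleDescent → c₁₃₂.GSexactJ

/-- C131's TRANSFER STATEMENT ⇐ THE BOOK ∧ MOK's MEMOIR, BY NAME (`paper-arxiv-1212.6580/` p0003:L52-70, in the field): « the recent work of Arthur ( [Ar12]) » (orthogonal G_n) ↦ `∀ N, ν.Everything N`; « and also of C.-P. Mok ( [Mk12]) » (unitary G_n) ↦ `∀ N, μ.Everything N` (Mok at all ranks; the register's convention for a by-name use of the memoir, tranches 130 / 131); Jacquet – Piatetski-Shapiro – Shalika [JPSS83]: Arthur-free, absorbed.  Premises: the book at all ranks, Mok at all ranks. [cite: JiangZhang2014HermitianType, §1 (arXiv v2 chunk p0003:L52-70); Arthur2013 (as cited); Mok2012 (as cited)] -/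
def E_JZtransferL (ν : Nodes) (μ : Mok2015.Nodes) (c₁₃₂ : Consumers132) : Prop :=
  (∀ N, ν.Everything N) → (∀ N, μ.Everything N) → c₁₃₂.JZtransferL

/-- The hundred-and-thirty-second tranche of implications: C126's two by-number edges and the two second supply edges for tranche 82's fields; C139's two edges
over its Arthur-free theorem; C131's edge. [cite: EnnsLee2024ModpLGCGSp4, Lemma 4.1.6, Thm 4.1.4, Lemma 4.1.7, Cor. 4.1.1, Thm 4.5.1 (VoR); GinzburgSoudry2022DoubleDescent, §§1, 3; JiangZhang2014HermitianType, §1 (each edge's source in its own docstring)] -/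
structure Implications132 (ν : Nodes) (μ : Mok2015.Nodes) (c : Consumers) (c₂₈ : Consumers28) (c₈₂ : Consumers82) (c₁₃₂ : Consumers132) : Prop where
  elJL : E_ELjlTransfer ν c c₁₃₂
  elGalois : E_ELgalois c₂₈ c₁₃₂
  elStVoR : E_ELstableTemperedVoR ν c c₈₂ c₁₃₂
  elMainVoR : E_ELmainVoR c c₈₂ c₁₃₂
  gsMult : E_GSmultiplicities ν c₁₃₂
  gsExactJ : E_GSexactJ ν c₁₃₂
  jz : E_JZtransferL ν μ c₁₃₂

variable {ν : Nodes} {μ : Mok2015.Nodes} {κ : KMSW2014.Nodes} {c : Consumers} {s : Shin} {c₁₉ : Consumers19} {c₂₈ : Consumers28} {c₇₄ : Consumers74}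
  {c₈₂ : Consumers82} {c₁₃₂ : Consumers132}

/-- C126's Lemma 4.1.6 from the book's inputs (A3 through tranche 1's `taibiInner_of_leaves`). [cite: EnnsLee2024ModpLGCGSp4, Lemma 4.1.6 (bookkeeping proved here)] -/
theorem elJlTransfer_of_leaves (X : Implications132 ν μ c c₂₈ c₈₂ c₁₃₂) (I : Implications ν μ κ c) (A : BookInputs ν) : c₁₃₂.ELjlTransfer :=
  X.elJL A.everything (taibiInner_of_leaves I A)

/-- C126's Theorem 4.1.4 from the book's inputs — SECOND ORDER, through row C191 (tranche 28's `mokGSp4_of_leaves`: book ∧ A4). [cite: EnnsLee2024ModpLGCGSp4, Thm 4.1.4 (bookkeeping proved here)] -/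
theorem elGalois_of_leaves (X : Implications132 ν μ c c₂₈ c₈₂ c₁₃₂) (X₂₈ : Implications28 ν μ κ c c₁₉ c₂₈) (I : Implications ν μ κ c) (A : BookInputs ν) :
    c₁₃₂.ELgalois :=
  X.elGalois (mokGSp4_of_leaves X₂₈ I A)

/-- THE VoR ROUTE CLOSES FROM EXACTLY TRANCHE 82's THREE PREMISES — the book at all ranks, A4, A3 — because row C191 is supplied by the book ∧ A4 (tranche 28's edge
`E_MokGSp4`): Lemma 4.1.6, Theorem 4.1.4, Corollary 4.1.1 ∧ Lemma 4.1.7, Theorem 4.5.1. [cite: EnnsLee2024ModpLGCGSp4, §4.1 – §4.5 (bookkeeping proved here)] -/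
theorem c209_vor_route_of_t82_rows (X : Implications132 ν μ c c₂₈ c₈₂ c₁₃₂) (X₂₈ : Implications28 ν μ κ c c₁₉ c₂₈) (hν : ∀ N, ν.Everything N) (hGT : c.GeeTaibi)
    (hT : c.TaibiInner) : c₁₃₂.ELjlTransfer ∧ c₁₃₂.ELgalois ∧ c₈₂.ELstableTempered ∧ c₈₂.ELmain :=
  have jl := X.elJL hν hT
  have ga := X.elGalois (X₂₈.mokGSp4 hν hGT)
  have st := X.elStVoR jl hν hGT
  ⟨jl, ga, st, X.elMainVoR st ga hGT⟩

/-- Tranche 82's field `ELstableTempered` by the VoR route from the book's inputs. [cite: EnnsLee2024ModpLGCGSp4, Cor. 4.1.1, Lemma 4.1.7 (bookkeeping proved here)] -/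
theorem elStableTempered_of_leaves_VoR (X : Implications132 ν μ c c₂₈ c₈₂ c₁₃₂) (I : Implications ν μ κ c) (A : BookInputs ν) : c₈₂.ELstableTempered :=
  X.elStVoR (elJlTransfer_of_leaves X I A) A.everything (geeTaibi_of_leaves I A)

/-- Tranche 82's field `ELmain` (Theorem 4.5.1) by the VoR route from the book's inputs: every leaf of the book (through A3, A4 and C191), nothing of Mok's memoir or
KMSW — the same support tranche 82's `elMain_of_inputs` gives by its route. [cite: EnnsLee2024ModpLGCGSp4, Thm 4.5.1 (bookkeeping proved here)] -/
theorem elMain_of_leaves_VoR (X : Implications132 ν μ c c₂₈ c₈₂ c₁₃₂) (X₂₈ : Implications28 ν μ κ c c₁₉ c₂₈) (I : Implications ν μ κ c) (A : BookInputs ν) :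
    c₈₂.ELmain :=
  X.elMainVoR (elStableTempered_of_leaves_VoR X I A) (elGalois_of_leaves X X₂₈ I A) (geeTaibi_of_leaves I A)

/-- THE TWO TRANCHES' EDGES COMPOSE: tranche 82's stability edge (the §1 sentence: book ∧ A4 ∧ A3) feeding this tranche's printed chain (∧ Theorem 4.1.4 through
C191 ∧ A4) gives Theorem 4.5.1 from the book at all ranks, A4 and A3. [cite: EnnsLee2024ModpLGCGSp4, Thm 4.5.1 (bookkeeping proved here)] -/
theorem elMain_mixed_routes (X : Implications132 ν μ c c₂₈ c₈₂ c₁₃₂) (E : Implications82 ν μ c s c₇₄ c₈₂) (X₂₈ : Implications28 ν μ κ c c₁₉ c₂₈)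
    (hν : ∀ N, ν.Everything N) (hGT : c.GeeTaibi) (hT : c.TaibiInner) : c₈₂.ELmain :=
  X.elMainVoR (E.el hν hGT hT) (X.elGalois (X₂₈.mokGSp4 hν hGT)) hGT

/-- C126 ≡ C209 IN CONDITIONAL FORM BY THE VoR ROUTE, 2026, against the sentence printed in 2024 (« This classification was proven in [28], conditional on
unpublished results of Arthur, Moeglin and Waldspurger »): granting the book's internal derivations, supply edges and every PUBLISHED input, Theorem 4.1.4 and
Theorem 4.5.1 are conditional on the book's 2024–2026 preprint layer and on the general and the non-standard weighted fundamental lemmas.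
[cite: EnnsLee2024ModpLGCGSp4, §4.1 (VoR p0037:L5-7), Thms 4.1.4, 4.5.1 (bookkeeping proved here)] -/
theorem el_vor_conditional_form (X : Implications132 ν μ c c₂₈ c₈₂ c₁₃₂) (X₂₈ : Implications28 ν μ κ c c₁₉ c₂₈) (I : Implications ν μ κ c) (B : ν.BookEdges)
    (S : ν.SupplyEdges) (P : ν.PublishedLeaves) : ν.PreprintLeaves2026 → ν.WFL_general → ν.WFL_nonstandard → c₁₃₂.ELgalois ∧ c₈₂.ELmain :=
  fun hQ h6 h7 =>
    have A : BookInputs ν := ⟨B, S, P, hQ, ⟨h6, h7⟩⟩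
    ⟨elGalois_of_leaves X X₂₈ I A, elMain_of_leaves_VoR X X₂₈ I A⟩

/-- C139's introductory multiplicity statement from the book's inputs. [cite: GinzburgSoudry2022DoubleDescent, §1 (bookkeeping proved here)] -/
theorem gsMultiplicities_of_leaves (X : Implications132 ν μ c c₂₈ c₈₂ c₁₃₂) (A : BookInputs ν) : c₁₃₂.GSmultiplicities :=
  X.gsMult A.everything

/-- C139 AS PRINTED: granting the book at all ranks and the paper's own Theorem 3.4, the introduction's statement and the §3 remark follow.
[cite: GinzburgSoudry2022DoubleDescent, §§1, 3 (bookkeeping proved here)] -/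
theorem gs_as_printed (X : Implications132 ν μ c c₂₈ c₈₂ c₁₃₂) (hν : ∀ N, ν.Everything N) (h34 : c₁₃₂.GSdoubleDescent) :
    c₁₃₂.GSmultiplicities ∧ c₁₃₂.GSexactJ :=
  ⟨X.gsMult hν, X.gsExactJ hν h34⟩

/-- C139's §3 remark from the book's inputs GIVEN Theorem 3.4 (which inherits nothing). [cite: GinzburgSoudry2022DoubleDescent, §3 (bookkeeping proved here)] -/
theorem gsExactJ_of_leaves_and_thm34 (X : Implications132 ν μ c c₂₈ c₈₂ c₁₃₂) (A : BookInputs ν) (h34 : c₁₃₂.GSdoubleDescent) : c₁₃₂.GSexactJ :=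
  X.gsExactJ A.everything h34

/-- C139 IN CONDITIONAL FORM, 2026 (no status sentence in the text): granting the book's internal derivations, supply edges, every PUBLISHED input and the
paper's Arthur-free Theorem 3.4, the two statements that invoke the book are conditional on its 2024–2026 preprint layer and on the general and the non-standard
weighted fundamental lemmas; the main theorem itself is not. [cite: GinzburgSoudry2022DoubleDescent, §§1, 3 (bookkeeping proved here)] -/
theorem gs_conditional_form (X : Implications132 ν μ c c₂₈ c₈₂ c₁₃₂) (B : ν.BookEdges) (S : ν.SupplyEdges) (P : ν.PublishedLeaves) (h34 : c₁₃₂.GSdoubleDescent) :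
    ν.PreprintLeaves2026 → ν.WFL_general → ν.WFL_nonstandard → c₁₃₂.GSmultiplicities ∧ c₁₃₂.GSexactJ :=
  fun hQ h6 h7 =>
    have A : BookInputs ν := ⟨B, S, P, hQ, ⟨h6, h7⟩⟩
    ⟨gsMultiplicities_of_leaves X A, gsExactJ_of_leaves_and_thm34 X A h34⟩

/-- C131's transfer statement from the book's and Mok's inputs (every bundle of both; nothing of KMSW). [cite: JiangZhang2014HermitianType, §1 (bookkeeping proved here)] -/
theorem jzTransferL_of_inputs (X : Implications132 ν μ c c₂₈ c₈₂ c₁₃₂) (A : BookInputs ν) (M : MokInputs μ) : c₁₃₂.JZtransferL :=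
  X.jz A.everything M.everything

/-- C131 IN CONDITIONAL FORM, 2026 (no status sentence; [Ar12] cited from the 2012 Clay-hosted text, [Mk12] as « submitted (2012) »): granting both monographs'
internal derivations, supply edges and every PUBLISHED input, the transfer statement with its L-function identities is conditional on the book's AND Mok's
2024–2026 preprint layers and on the general and the non-standard weighted fundamental lemmas of both. [cite: JiangZhang2014HermitianType, §1 (bookkeeping proved here)] -/
theorem jz_conditional_form (X : Implications132 ν μ c c₂₈ c₈₂ c₁₃₂) (B : ν.BookEdges) (S : ν.SupplyEdges) (P : ν.PublishedLeaves) (MB : μ.SectionEdges)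
    (MS : μ.SupplyEdges) (MP : μ.PublishedLeaves) :
    ν.PreprintLeaves2026 → ν.WFL_general → ν.WFL_nonstandard → μ.PreprintLeaves2026 → μ.WFL_general → μ.WFL_nonstandard → c₁₃₂.JZtransferL :=
  fun hQ h6 h7 hMQ m6 m7 => jzTransferL_of_inputs X ⟨B, S, P, hQ, ⟨h6, h7⟩⟩ ⟨MB, MS, MP, hMQ, ⟨m6, m7⟩⟩

/-- THE WHOLE HUNDRED-AND-THIRTY-SECOND TRANCHE FROM THE INPUTS OF THE BOOK AND OF MOK's MEMOIR and the earlier tranches' edges (1, 28, 82): C126's two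
by-number statements and, by the VoR route, tranche 82's two fields; C139's introductory statement outright and its §3 remark given Theorem 3.4; C131's transfer
statement.  KMSW plays no role. [cite: EnnsLee2024ModpLGCGSp4, §4; GinzburgSoudry2022DoubleDescent, §§1, 3; JiangZhang2014HermitianType, §1 (bookkeeping proved here)] -/
theorem hundredthirtysecond_of_inputs (X : Implications132 ν μ c c₂₈ c₈₂ c₁₃₂) (X₂₈ : Implications28 ν μ κ c c₁₉ c₂₈) (I : Implications ν μ κ c)
    (A : BookInputs ν) (M : MokInputs μ) :
    c₁₃₂.ELjlTransfer ∧ c₁₃₂.ELgalois ∧ c₈₂.ELstableTempered ∧ c₈₂.ELmain ∧ c₁₃₂.GSmultiplicities ∧ (c₁₃₂.GSdoubleDescent → c₁₃₂.GSexactJ) ∧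
      c₁₃₂.JZtransferL :=
  ⟨elJlTransfer_of_leaves X I A, elGalois_of_leaves X X₂₈ I A, elStableTempered_of_leaves_VoR X I A, elMain_of_leaves_VoR X X₂₈ I A,
    gsMultiplicities_of_leaves X A, fun h34 => gsExactJ_of_leaves_and_thm34 X A h34, jzTransferL_of_inputs X A M⟩

/-! ## Hundred-and-thirty-third tranche (v2, unit `pub-arthur-down-g57`): THE FIELD-COVERAGE AUDIT's DESK LIST, CONTINUED — THE TWO EXPERIMENTAL CONGRUENCE PAPERS
THAT REACH THE BOOK THROUGH ROW C3: row C78 (`BDMexamples` — J. Bergström – N. Dummigan – T. Mégarbané, with an appendix by T. Ibukiyama – H. Katsurada, Exp. Math. 27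
(2018) 230–250) and row C149 (`BDFKexamples` — J. Bergström – N. Dummigan – D. Farmer – S. Koutsoliotas, J. Théor. Nombres Bordeaux 31 (2020) 751–775, PUBLISHED —
the census had « venue not in metadata »)

WHY.  Of the audit's list (cell `GAPS.md` G-DN-529 (e)) four graded rows remain after tranche 132: C78, C142, C149, C152 (and B16, which needs a PDF text).  C78 and
C149 are the two numerical congruence papers of the Bergström – Dummigan programme; neither proves a theorem that rests on the book — what they take from the
classification is the IDENTIFICATION of the automorphic representations whose Hecke eigenvalues enter the tested congruences: the level-one lists of Chenevier –
Renard ([CR] = row C3, Mem. Amer. Math. Soc. 1121 (2015)), Arthur's multiplicity formula and « Arthur's symplectic-orthogonal alternative », all cited THROUGH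
[CR] (where these statements carry one star — resting on the book — or two — resting on the book and on the memoir's expected statements 3.26 / 3.30 for the
definite inner forms, since supplied by rows A3 and B1: tranche 1's `E_ChenevierRenardStar` / `E_ChenevierRenardStarStar`), and T. Mégarbané's eigenvalue
determinations ([Me] = row C97, J. Théor. Nombres Bordeaux 30 (2018), tranche 32's `Consumers32.MegarbaneSO` ⇐ book ∧ C3 ∧ A3 ∧ B1).  C78 prints, in 2016, a
STATUS CLAIM of type G-i for these inputs (« conditional at the time of writing of [CR], but are now all proved »); the kernel states what that claim leaves
open in 2026 (`bdm_conditional_form`).  C142 (Cai – Fan) stays on the desk: its one sentence names « Matringe [Mat11] and Mok [Mok] » jointly for the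
Flicker – Rallis statement, and whether the two are parallel or complementary suppliers is not decidable from C142's text (cell `GAPS.md` G-DN-536).

TEXTS (the held corpus TeX, copied byte-identically into `HOME/pub-arthur-down-g57/primaries/` from `lit read`, `KEYS.tsv` / `SHA256SUMS` there; pNNNN = CHUNK
of the store text, Ln = line, TeX verbatim): `paper-arxiv-1605.00819/` (C78 = arXiv:1605.00819, 28 chunks; title p0001:L1 "Eisenstein congruences for SO(4,3), SO(4,4), spinor and triple product L-values"; bib `BergstromDummiganMegarbane2018Eisenstein`;
the Exp. Math. version of record, doi:10.1080/10586458.2016.1251861, was NOT compared), `paper-arxiv-1910.14128/` (C149 = arXiv:1910.14128, 18 chunks; title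
p0001:L1 "$\mathrm{GL}_2\times\mathrm{GSp}_2$ $L$-values and Hecke eigenvalue congruences"; bib `BergstromDummiganFarmerKoutsoliotas2020`; the JTNB version of record, doi:10.5802/jtnb.1108, was NOT compared).

(1) ROW C78 (census `[g3]`, G-i-type).  Abstract (in the comment lines: it names a conj.).  §6 (SO(7) = the special orthogonal group of the E₇ lattice, a
definite form of SO(4,3)): the space M(V_μ, K) of level-one algebraic modular forms and its decomposition — p0011:L13 "Note that $M(V_{\mu},K)$ is isomorphic to the direct sum of $1$-dimensional $K$-fixed parts $\pi_f^K$, where $\pi=\pi_{\infty}\times\pi_f$ runs through all the automorphic representations of $\SO(7)(\A)$ such that $\pi_{\infty}\simeq V_{\mu}$, which all appear with multiplicity $1$ according to Arthur's multiplicity formula. (See [CR], and note that $V_{\mu}$ is self-dual.)"; the deduction —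
p0011:L14 "By Arthur's endoscopic classification [CR] and multiplicity formula [CR], we can sometimes then deduce the eigenvalue of $T(p)$ on some automorphic representation $\pi$ of $\SO(7)(\A)$ with stable, tempered Arthur parameter (in the sense of [CR]). This Arthur parameter is in this case the functorial lift of $\pi$ to $\GL_6$ via the standard representation of the $L$-group $\Sp_3(\CC)$, and by Arthur's symplectic-orthogonal alternative [CR], this comes also from a discrete automorphic representation of $\SO(4,3)$, whose Hecke eigenvalue for $T(p)$ is the same. Its infinitesimal character looks the same as $\mu+\rho$, except that $e_i$ now means again what it did in 2 above. This automorphic representation of $\SO(4,3)$ is cuspidal, not just discrete, by [Wa]."; and the status claim — p0011:L14 "Note that we have used several results which were conditional at the time of writing of [CR], but are now all proved, by work of many people, cited in the proof of [Me]. See also the footnote below [CL], and [T2]." ([Me] = p0027:L80 "[Me] T. Mégarbané, Traces des opérators de Hecke sur les espaces de formes automorphes de $\SO_7$, $\SO_8$ ou $\SO_9$ en niveau $1$ et poids arbitraire, preprint, April 2016, <http://arxiv.org/abs/1604.01914v1>." = row C97's text; [CL] = Chenevier – Lannes = row C5;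
[T2] = p0027:L98 "[T2] O. Taïbi, Arthur's multiplicity formula for certain inner forms of symplectic and special orthogonal groups, preprint, 2015, <http://arxiv.org/abs/1510.08395>." = row A3).  Example 1: p0011:L16 "Example 1: $\mathbf{\Delta_{25,17,11}}$. The Arthur parameters of the cuspidal automorphic representations of $\SO(7)$ of level $1$ and infinitesimal character $(25/2)e_1+(17/2)e_2+(11/2)e_3$ are $\Delta_{25,17,11}$ and $\Delta_{25,11}\oplus\Delta_{17}$. These are taken from [CR], where they were conditional on assumptions including announced results of Arthur [A], so the correctness of this list was double-starred in the sense of [CR]; see the paragraph preceding [CR]. But it is now known unconditionally." ([A] = p0027:L5 "[A] J. Arthur, The endoscopic classification of representations. Orthogonal and symplectic groups. American Mathematical Society Colloquium Publications, 61. American Mathematical Society, Providence, RI, 2013. xviii+590 pp.").  §8 (SO(8) = SO of the E₈ lattice, for SO(4,4)):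
p0022:L4 "According to [CR], there is a single stable, tempered Arthur parameter $\Delta_{30,20,10,8}$ for the relevant infinitesimal character $15e_1+10e_2+5e_3+4e_4$, and a table at [CRtab] shows that $\dim(V_{\mu}^{\SO(8)(\ZZ)})=1$ (for $\mu=12e_1+8e_2+4e_3+4e_4$), so we obtain $T(p)(\Delta_{30,20,10,8})$ as the trace of $T(p)$ on $V_{\mu}^{\SO(8)(\ZZ)}$."  Typed: `BDMexamples` ⇐ `Consumers.ChenevierRenardStar` (Arthur's classification, multiplicity formula and symplectic-orthogonal alternative as restated
in [CR] = p0027:L23 "[CR] G. Chenevier, D. Renard, Level one algebraic cusp forms of classical groups of small ranks, Mem. Amer. Math. Soc. 1121, vol. 237, 128 pp., 2015.") ∧ `Consumers.ChenevierRenardStarStar` (the double-starred lists); Mégarbané's TRACES ([Me], [Me2]) are numerical data, Wallach [Wa], Faber –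
van der Geer, Weissauer, Shahidi [Sh]: Arthur-free, absorbed.  The 2016 status sentence is of census type G-i (« now all proved »): true for [CR]'s two expected
statements (rows A3, B1 — published), silent on the book's own unpublished references.

(2) ROW C149 (census `[g5c]`, G-i; PUBLISHED — J. Théor. Nombres Bordeaux 31 (2020) no. 3, 751–775, Crossref).  p0002:L3-4 "We find experimental examples of congruences of Hecke eigenvalues between automorphic representations of groups such as $\GSp_2(\A)$, $\SO(4,3)(\A)$ and $\SO(5,4)(\A)$, where the prime modulus should, for various reasons, appear in the algebraic part of a critical “tensor-product” $L$-value associated to cuspidal automorphic representations of $\GL_2(\A)$ and $\GSp_2(\A)$." […]  The inputs, §1: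
p0003:L5 "Mégarbané's large-scale computation of traces of Hecke operators on spaces of level-one algebraic modular forms, for $\SO(7),\,\SO(8)$ and $\SO(9)$ [Me], following the endoscopic classification of the associated automorphic representations by Chenevier and Renard [CR]."  §7 (the mod 71 congruence for (j, k) = (4, 12), ℓ = 16): p0013:L12 "A self-dual, cuspidal automorphic representation of $\PGL_6(\A)$ discovered by Chenevier and Renard, denoted $\Delta_{25,15,5}$ in [CR], has the correct infinitesimal character. By Arthur's symplectic-orthogonal alternative [CR], it is the functorial lift of a discrete automorphic representation of $\SO(4,3)(\A)$." p0013:L22-23 "If we let $\mu=10e_1+6e_2+2e_3$, so that $\mu+\rho=(1/2)(25e_1+15e_2+5e_3)$, then $M(V_{\mu},K)$ is $2$-dimensional, spanned by $K$-fixed vectors of automorphic representations of $\SO(7)(\A)$ whose Arthur parameters are $\Delta_{25,15,5}$ and an endoscopic lift denoted $\Delta_{25,5}\oplus\Delta_{15}$ in [CR]. Note that $(25,5)=(j+2k-3,j+1)$ and $15=\ell-1$, with $(j,k)=(4,12)$ and $\ell=16$. Mégarbané has calculated the traces of certain Hecke operators $T(p)$ (for $p\leq 53$) on spaces including this one [Me3].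 The contribution $p^5a_p(f)+\lambda_F(p)$ from $\Delta_{25,5}\oplus\Delta_{15}$ is easily subtracted off (as below) to find the eigenvalue denoted $T(p)(\Delta_{25,15,5})$, in fact Mégarbané has recorded the results in [Me]." […]
§§8–9 (SO(9), for SO(5,4)): p0015:L11 "This time a self-dual, cuspidal, automorphic representation of $\PGL_8(\A)$ discovered by Chenevier and Renard [CR], denoted $\Delta_{25,19,11,5}$ in their notation, has the correct infinitesimal character. By Arthur's symplectic-orthogonal alternative [CR], it is the functorial lift of a discrete automorphic representation of $\SO(5,4)(\A)$. Again, there is an associated $\tilde{\rho}:\Gal(\Qbar/\QQ)\rightarrow \GL_8(\QQ_q)$ (see [Sh]). The relevant space of algebraic modular forms for $\SO(9)$ is $3$-dimensional, spanned by Hecke eigenforms that are vectors in automorphic representations of $\SO(9)(\A)$ with Arthur parameters $\Delta_{25,19,11,5}$ and $\Delta^2_{25,19,5}\oplus\Delta_{11}$, [Me]." […] / p0016:L4 "Now consider a self-dual, cuspidal, automorphic representation of $\PGL_8(\A)$ discovered by Chenevier and Renard [CR], denoted $\Delta_{25,21,15,9}$ in their notation. By Arthur's symplectic-orthogonal alternative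 [CR], it is the functorial lift of a discrete automorphic representation of $\SO(5,4)(\A)$. There is an associated $\tilde{\rho}:\Gal(\Qbar/\QQ)\rightarrow \GL_8(\QQ_q)$ (see [Sh]). The relevant space of algebraic modular forms for $\SO(9)$ is $3$-dimensional, spanned by Hecke eigenforms that are vectors in automorphic representations of $\SO(9)(\A)$ with Arthur parameters $\Delta_{25,21,15,9}$, $\Delta_{25}\oplus\Delta_{15}\oplus\Delta_{21,9}$ and $\Delta_{21,9}\oplus\Delta_{25,15}$ [Me]." […]  And a congruence of §7 PROVED meanwhile by row C113's method: p0014:L45-46 "In fact, Mégarbané has very recently proved this congruence unconditionally for all $p$ [Me1]. He uses scalar-valued algebraic modular forms for $\mathrm{SO}(25)$, in the manner of Chenevier and Lannes's proof of Harder's mod $41$ congruence using $\mathrm{O}(24)$ [CL]. He found that the modulus of the congruence is in fact $5856=2^5.3.61$."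
([Me1] = p0017:L64 "[Me1] T. Mégarbané, “Calcul des opérateurs de Hecke sur les classes d'isomorphisme de réseaux pairs de déterminant $2$ en dimension $23$ et $25$”, J. Number Theory 186 (2018), p. 370-416." = row C113, tranche 32's `Consumers32.MegarbaneLattices`; [CL] = row C5).  Typed: `BDFKexamples` ⇐ `ChenevierRenardStar` (the alternative « [CR] ») ∧
`ChenevierRenardStarStar` (the representations « discovered by Chenevier and Renard [CR] » and the Arthur parameters of the level-one spaces) ∧ `Consumers32.MegarbaneSO`
([Me] = p0017:L66 "[Me] T. Mégarbané, “Traces des opérators de Hecke sur les espaces de formes automorphes de $\SO_7$, $\SO_8$ ou $\SO_9$ en niveau $1$ et poids arbitraire”, J. Théor. Nombres Bordeaux 30 (2018), p. 239-306." = row C97: the recorded eigenvalues and parameters).  [BDM] = p0017:L10 "[BDM] J. Bergström, N. Dummigan, T. Mégarbané, T. Ibukiyama, H. Katsurada, “Eisenstein congruences for $\SO(4,3)$, $\SO(4,4)$, spinor and triple product $L$-values”, Experimental Mathematics 27 (2018), p. 230-250." = row C78 (the companion; not a premise of the typed examples).  No status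
sentence (G-i unchanged).

THE POINT FOR THE REGISTER (kernel, below).  Both rows reach the book only through rows C3 / C97, hence (tranche 1's `chenevierRenardStar_of_leaves` /
`chenevierRenardStarStar_of_leaves`, tranche 32's `megarbaneSO_of_leaves`) through the book's inputs alone: `bdm_of_leaves`, `bdfk_of_leaves`; against C78's
2016 « now all proved », `bdm_conditional_form` lists what the identifications still rest on in 2026 — the book's 2024–2026 preprint layer and the general and the
non-standard weighted fundamental lemmas.  Expected exact supports (store-thaw backlog): the book's 24 leaves for both fields. -/

/-- Rows C78 and C149 of the census, as an arbitrary assignment of truth values (structure only). [cite: Arthur2013, downstream register of the cell, hundred-and-thirty-third tranche (structure only)] -/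
structure Consumers133 where
  /-- C78, THE IDENTIFICATIONS BEHIND THE WORKED EXAMPLES OF §§6–8 AS PRINTED (J. Bergström – N. Dummigan – T. Mégarbané, appendix by T. Ibukiyama – H. Katsurada, *Eisenstein congruences for SO(4,3), SO(4,4), spinor and triple product L-values*, Exp. Math. 27 (2018) no. 2, 230–250, doi:10.1080/10586458.2016.1251861; `paper-arxiv-1605.00819/` under `HOME/pub-arthur-down-g57/primaries/`, VoR not compared): that the eigenvalues T(p)(Δ_{25,17,11}), T(p)(Δ_{30,20,10,8}), T(p)(Δ_{26,24,14,4}), … extracted from the traces on the level-one spaces M(V_μ, K) of SO(7) / SO(8) are the Hecke eigenvalues of cuspidal automorphic representations of SO(4,3)(𝔸) / SO(4,4)(𝔸) with the stated stable tempered Arthur parameters — Example 1: p0011:L16 "Example 1: $\mathbf{\Delta_{25,17,11}}$. The Arthur parameters of the cuspidal automorphic representations of $\SO(7)$ of level $1$ and infinitesimal character $(25/2)e_1+(17/2)e_2+(11/2)e_3$ are $\Delta_{25,17,11}$ and $\Delta_{25,11}\oplus\Delta_{17}$." […]; §8: p0022:L4 "According to [CR], there is a single stable, tempered Arthur parameter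 $\Delta_{30,20,10,8}$ for the relevant infinitesimal character $15e_1+10e_2+5e_3+4e_4$, and a table at [CRtab] shows that $\dim(V_{\mu}^{\SO(8)(\ZZ)})=1$ (for $\mu=12e_1+8e_2+4e_3+4e_4$), so we obtain $T(p)(\Delta_{30,20,10,8})$ as the trace of $T(p)$ on $V_{\mu}^{\SO(8)(\ZZ)}$." [cite: BergstromDummiganMegarbane2018Eisenstein, §6 (arXiv chunk p0011:L13-16), §8 (p0022:L4, L23)] -/
  BDMexamples : Prop
  /-- C149, THE IDENTIFICATIONS BEHIND THE EXAMPLES OF §§7–9 AS PRINTED (J. Bergström – N. Dummigan – D. Farmer – S. Koutsoliotas, *GL₂ × GSp₂ L-values and Hecke eigenvalue congruences*, J. Théor. Nombres Bordeaux 31 (2020) no. 3, 751–775, doi:10.5802/jtnb.1108; `paper-arxiv-1910.14128/`, VoR not compared): p0013:L12 "A self-dual, cuspidal automorphic representation of $\PGL_6(\A)$ discovered by Chenevier and Renard, denoted $\Delta_{25,15,5}$ in [CR], has the correct infinitesimal character. By Arthur's symplectic-orthogonal alternative [CR], it is the functorial lift of a discrete automorphic representation of $\SO(4,3)(\A)$."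 — likewise Δ_{25,19,11,5} and Δ_{25,21,15,9} on PGL₈ as lifts from SO(5,4)(𝔸) (p0015:L11, p0016:L4), with the Arthur parameters of the level-one spaces for SO(7) / SO(9) and the eigenvalues T(p)(Δ_{25,15,5}), … « recorded … in [Me] » (p0013:L22-23). [cite: BergstromDummiganFarmerKoutsoliotas2020, §7 (arXiv chunk p0013:L12, L22-23), §§8–9 (p0015:L11, p0016:L4)] -/
  BDFKexamples : Prop

-- Verbatim lines kept out of the docstrings by the register's lint, and bibliography.  C78, `paper-arxiv-1605.00819/`: abstract p0002:L3 "We work out instances of a general conjecture on congruences between Hecke eigenvalues of induced and cuspidal automorphic representations of a reductive group, modulo divisors of certain critical $L$-values, in the case that the group is a split orthogonal group. We provide some numerical evidence in the case that the group is $\SO(4,3)$ and the $L$-function is the spinor $L$-function of a genus $2$, vector-valued, Siegel cusp form. We also consider the case that the group is $\SO(4,4)$ and the $L$-function is a triple product $L$-function."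
--   p0014:L45 "This instance of Harder's conjecture has actually been proved by Chenevier and Lannes [CL]. We are grateful to G. Chenevier for explaining that this theorem is now unconditional, thanks to recent work of Moeglin, Waldspurger, Shelstad and Mezo. (See the paragraph following [CL].)"
--   bibliography p0027:L21 "[CL] G. Chenevier, J. Lannes, Formes automorphes et voisins de Kneser des réseaux de Niemeier, preprint, June 2015, <http://arxiv.org/abs/1409.7616v2>." / p0027:L82 "[Me2] T. Mégarbané, Calcul des traces d'opérators de Hecke sur les espaces de formes automorphes, website, <http://megarban.perso.math.cnrs.fr/>"
-- C149, `paper-arxiv-1910.14128/`: p0003:L11 "Conjecture 4.2 of [BD] is a very wide generalisation of Ramanujan's mod $691$ congruence, to “Eisenstein” congruences between Hecke eigenvalues of automorphic representations of $G(\A)$, where $\A$ is the adele ring and $G/\Q$ is any connected, split reductive group. On one side of the congruence is a cuspidal automorphic representation $\tilde{\Pi}$. On the other is one induced from a cuspidal automorphic representation $\Pi$ of the Levi subgroup $M$ of a maximal parabolic subgroup $P$."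
--   bibliography p0017:L22 "[CR] G. Chenevier, D. Renard, “Level one algebraic cusp forms of classical groups of small rank”, Mem. Amer. Math. Soc. 1121, vol. 237, 2015." / p0017:L68 "[Me3] T. Mégarbané, “Calcul des traces d'opérators de Hecke sur les espaces de formes automorphes”, website, <http://megarban.perso.math.cnrs.fr/>"

/-- C78's IDENTIFICATIONS ⇐ ROW C3's STARRED AND DOUBLE-STARRED STATEMENTS (`paper-arxiv-1605.00819/` §6, p0011:L13-16, quoted in the tranche docstring): « Arthur's multiplicity formula. (See [CR], …) », « By Arthur's endoscopic classification [CR] and multiplicity formula [CR] », « by Arthur's symplectic-orthogonal alternative [CR] » ↦ `Consumers.ChenevierRenardStar` (the memoir's statements resting on the book); « These are taken from [CR], where they were conditional on assumptions including announced results of Arthur [A], so the correctness of this list was double-starred in the sense of [CR] » ↦ `Consumers.ChenevierRenardStarStar`; [Me]'s traces, [Wa], [Sh], [W1], Faber – van der Geer: Arthur-free or data, absorbed.  PDF TEXT STATE (v6, tranche 136 below, `arxiv-pdf-1605.00819v1/`): the printed sentences carry the locators the corpus TeX drops — « endoscopic classification [CR, Theorem* 3.19] » and « symplectic-orthogonal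 alternative [CR, Theorem* 3.9] » (single star) ↦ `ChenevierRenardStar`; « multiplicity formula [CR, Conj. 3.30] » (the memoir's assumption 3.30; word spelled out in print) and « taken from [CR, Table 13] » / « [CR, Table 9] » ↦ `ChenevierRenardStarStar`; the status sentence points to [Me1, Théorème 7.3.4] (row C97), [CL, VIII, Théorème 1.2] (row C5) and [T] (row A3) — premises unchanged, attribution refined there.  Premises: C3 (★), C3 (★★). [cite: BergstromDummiganMegarbane2018Eisenstein, §6 (arXiv chunk p0011:L13-16), §8 (p0022:L4); ChenevierRenard2015, starred / double-starred statements (as typed in `Consumers.ChenevierRenardStar` / `…StarStar`)] -/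
def E_BDMexamples (c : Consumers) (c₁₃₃ : Consumers133) : Prop :=
  c.ChenevierRenardStar → c.ChenevierRenardStarStar → c₁₃₃.BDMexamples

/-- C149's IDENTIFICATIONS ⇐ ROW C3 (★ / ★★) ∧ ROW C97 (`paper-arxiv-1910.14128/` §1, §§7–9, quoted in the tranche docstring and the field): « By Arthur's symplectic-orthogonal alternative [CR] » ↦ `Consumers.ChenevierRenardStar`; « discovered by Chenevier and Renard [CR], denoted Δ… in their notation » and the Arthur parameters of the level-one spaces « in [CR] » ↦ `Consumers.ChenevierRenardStarStar`; « Mégarbané has recorded the results in [Me] » / « with Arthur parameters … [Me] » — [Me] = T. Mégarbané, J. Théor. Nombres Bordeaux 30 (2018) = row C97 ↦ `Consumers32.MegarbaneSO`; [Sh], Faber – van der Geer, the L-value computations: Arthur-free, absorbed.  PDF / VoR TEXT STATE (v6, tranche 136 below, `arxiv-pdf-1910.14128v1/`, `vor-C149/`): the printed sentences read « [CR, Theorem* 3.9] » ↦ `ChenevierRenardStar` and « [CR, Corollary**6.5, Table 8] », « [CR, Table 13] » ↦ `ChenevierRenardStarStar` (VoR: [11, …]) — the three premises confirmed by number and star.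  Premises: C3 (★), C3 (★★), C97. [cite: BergstromDummiganFarmerKoutsoliotas2020, §1 (arXiv chunk p0003:L5), §7 (p0013:L12, L22-23), §§8–9 (p0015:L11, p0016:L4); ChenevierRenard2015 (as typed); Megarbane2018JTNB, Thms 1.0.3–1.0.6 (as typed in `Consumers32.MegarbaneSO`)] -/
def E_BDFKexamples (c : Consumers) (c₃₂ : Consumers32) (c₁₃₃ : Consumers133) : Prop :=
  c.ChenevierRenardStar → c.ChenevierRenardStarStar → c₃₂.MegarbaneSO → c₁₃₃.BDFKexamples

/-- The hundred-and-thirty-third tranche of implications: C78's and C149's edges. [cite: BergstromDummiganMegarbane2018Eisenstein, §§6, 8; BergstromDummiganFarmerKoutsoliotas2020, §§7–9 (each edge's source in its own docstring)] -/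
structure Implications133 (c : Consumers) (c₃₂ : Consumers32) (c₁₃₃ : Consumers133) : Prop where
  bdm : E_BDMexamples c c₁₃₃
  bdfk : E_BDFKexamples c c₃₂ c₁₃₃

variable {c₂₄ : Consumers24} {c₃₂ : Consumers32} {c₁₃₃ : Consumers133}

/-- C78's identifications given row C3's starred and double-starred statements. [cite: BergstromDummiganMegarbane2018Eisenstein, §6 (bookkeeping proved here)] -/
theorem bdm_of_rows (X : Implications133 c c₃₂ c₁₃₃) (h₁ : c.ChenevierRenardStar) (h₂ : c.ChenevierRenardStarStar) : c₁₃₃.BDMexamples :=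
  X.bdm h₁ h₂

/-- C78's IDENTIFICATIONS FROM THE BOOK's INPUTS — second order, through row C3 (tranche 1's `chenevierRenardStar_of_leaves` / `chenevierRenardStarStar_of_leaves`, the latter
through rows A3 and B1): every leaf of the book, nothing of Mok's memoir or KMSW. [cite: BergstromDummiganMegarbane2018Eisenstein, §§6, 8 (bookkeeping proved here)] -/
theorem bdm_of_leaves (X : Implications133 c c₃₂ c₁₃₃) (I : Implications ν μ κ c) (A : BookInputs ν) : c₁₃₃.BDMexamples :=
  X.bdm (chenevierRenardStar_of_leaves I A) (chenevierRenardStarStar_of_leaves I A)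

/-- C78 IN CONDITIONAL FORM, 2026, against its 2016 sentence « we have used several results which were conditional at the time of writing of [CR], but are now all
proved »: granting the book's internal derivations, supply edges and every PUBLISHED input (rows A3 and B1 among them — the part of the sentence that holds), the
identifications are conditional on the book's 2024–2026 preprint layer and on the general and the non-standard weighted fundamental lemmas.
[cite: BergstromDummiganMegarbane2018Eisenstein, §6 (arXiv chunk p0011:L14) (bookkeeping proved here)] -/
theorem bdm_conditional_form (X : Implications133 c c₃₂ c₁₃₃) (I : Implications ν μ κ c) (B : ν.BookEdges) (S : ν.SupplyEdges) (P : ν.PublishedLeaves) :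
    ν.PreprintLeaves2026 → ν.WFL_general → ν.WFL_nonstandard → c₁₃₃.BDMexamples :=
  fun hQ h6 h7 => bdm_of_leaves X I ⟨B, S, P, hQ, ⟨h6, h7⟩⟩

/-- C149's IDENTIFICATIONS FROM THE BOOK's INPUTS — second order, through rows C3 and C97 (tranche 32's `megarbaneSO_of_leaves`): every leaf of the book, nothing else.
[cite: BergstromDummiganFarmerKoutsoliotas2020, §§7–9 (bookkeeping proved here)] -/
theorem bdfk_of_leaves (X : Implications133 c c₃₂ c₁₃₃) (X₃₂ : Implications32 ν μ c c₂₄ c₃₂) (I : Implications ν μ κ c) (A : BookInputs ν) : c₁₃₃.BDFKexamples :=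
  X.bdfk (chenevierRenardStar_of_leaves I A) (chenevierRenardStarStar_of_leaves I A) (megarbaneSO_of_leaves X₃₂ I A)

/-- C149 IN CONDITIONAL FORM, 2026 (no status sentence in the text). [cite: BergstromDummiganFarmerKoutsoliotas2020, §§7–9 (bookkeeping proved here)] -/
theorem bdfk_conditional_form (X : Implications133 c c₃₂ c₁₃₃) (X₃₂ : Implications32 ν μ c c₂₄ c₃₂) (I : Implications ν μ κ c) (B : ν.BookEdges) (S : ν.SupplyEdges)
    (P : ν.PublishedLeaves) : ν.PreprintLeaves2026 → ν.WFL_general → ν.WFL_nonstandard → c₁₃₃.BDFKexamples :=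
  fun hQ h6 h7 => bdfk_of_leaves X X₃₂ I ⟨B, S, P, hQ, ⟨h6, h7⟩⟩

/-- THE WHOLE HUNDRED-AND-THIRTY-THIRD TRANCHE FROM THE BOOK's INPUTS and the earlier tranches' edges (1, 32). [cite: BergstromDummiganMegarbane2018Eisenstein, §§6, 8; BergstromDummiganFarmerKoutsoliotas2020, §§7–9 (bookkeeping proved here)] -/
theorem hundredthirtythird_of_inputs (X : Implications133 c c₃₂ c₁₃₃) (X₃₂ : Implications32 ν μ c c₂₄ c₃₂) (I : Implications ν μ κ c) (A : BookInputs ν) :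
    c₁₃₃.BDMexamples ∧ c₁₃₃.BDFKexamples :=
  ⟨bdm_of_leaves X I A, bdfk_of_leaves X X₃₂ I A⟩

/-! ## Hundred-and-thirty-fourth tranche (v3, unit `pub-arthur-down-g57`): THE FIELD-COVERAGE AUDIT's DESK LIST, CONCLUDED — row C142 (`CFrelSC` — L. Cai – Y. Fan, Adv. Math.
410 (2022) 108744) and row C152 in its LATEST TEXT STATE (node `MatLCTassume`, `MatLCTclassical` — N. Matringe, arXiv:2409.20240, v6 of 2025-10-28; PREPRINT)

WHY.  After tranches 132 / 133 the audit's list of graded-but-untyped consumers (cell `GAPS.md` G-DN-529 (e)) is down to C142, C152 and B16 (B16 needs a PDF text: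
its corpus TeX leaks an authors' source comment, G-DN-533 (C2)).  C142's single sentence names « Matringe [Mat11] and Mok [Mok] » for the Flicker – Rallis
statement it uses; read in its context (the base-change map BC_n : Rep(U_n) → Rep(G) is itself part of the statement), the two citations are joint suppliers, not a
printed Arthur-free alternative — the edge is ⇐ Mok's memoir, with [Mat11] (IMRN 2011) absorbed as published and Arthur-free, and ⇐ row C25 (R. Beuzart-Plessis,
Invent. Math. 225 (2021), tranche 34's `Consumers34.BPPlancherel`) for the half of Theorem 1.1 the authors attribute to it.  C152 was censused (`[g5c]`, G-vii)
from an earlier arXiv version whose closing remark cited [Atobe] and said the coincidence « might be known »; unit `pub-arthur-down-g56` found the text stale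
(v6 rewrites the remark: « true at least … [AHKO23, Theorem B.2 and Remark B.3] », « [JaLiu, Theorem 6.20] », « [Vgen] ») and staged the v6 e-print source; the
remark is typed here from that source in the register's two-text-states manner (the earlier state stays in the census prose; no earlier field exists).

TEXTS (`HOME/pub-arthur-down-g57/primaries/`, `KEYS.tsv` / `SHA256SUMS`): `paper-arxiv-2108.05591/` (C142: the held corpus TeX of arXiv:2108.05591, 17 chunks, pNNNN =
CHUNK, Ln = line; title there p0001:L1 "Higher Ext-groups and Relatively Supercuspidal Spectra" — PUBLISHED under the title *Top degree Ext-groups and relatively supercuspidal spectra*, Adv. Math. 410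
(2022) 108744, doi:10.1016/j.aim.2022.108744 (Crossref); the version of record was NOT compared; bib `CaiFan2022TopExt`), `src-2409.20240v6/` (C152: the arXiv
e-print SOURCE of v6, fetched read-only by down-g56 on 2026-08-24 — `eprint_2409.20240v6`, sha256 7fcfdea989fc3e3d…, unpacked `Local_converse_theorems_4.tex`
(589 lines) staged as `p0001.txt` and its `.bbl` (259 lines) as `p0002.txt`, so pNNNN:Ln = SOURCE LINE; TeX verbatim; bib `Matringe2024LocalConverse`; no journal
record (Crossref title query by down-g56, 2026-08-24)).

(1) ROW C142 (census `[g5c]`, G-i « minor »).  The Galois case of §1.1 (E/F quadratic, G = 𝔾_m\Res_{E/F} GL_n so that G(F) = E^×\GL_n(E), H(F) = F^×\GL_n(F)):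
p0003:L106-113 "Denote by $\RU_n$ the quasi-split unitary group of rank $n$ with respect to $E/F$. Denote by $\mathrm{Rep}(\RU_n)$ (resp. $\mathrm{Rep}(G)$) the set of irreducible smooth admissible representations of $\RU_n(F)$ (resp. $G(F)$). Denote by  \[\mathrm{BC}_n: \mathrm{Rep}(\RU_n) \lra \mathrm{Rep}(G)\]  the stable (resp. unstable) base-change lifting if $n$ is odd (resp. even). For a generic representation $\pi$ of $G(F)$, there are the following important results." p0003:L115 "$\pi$ is distinguished if and only if $\pi$ is in the image of $\mathrm{BC}_n$." […] p0003:L116-117 "which is proved by Matringe [Mat11] and Mok [Mok]." (the sentence's name for the statement is in the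
comment lines) and p0004:L1-3 "* $\pi$ is relatively square-integrable if and only if $\pi$ is in the image of square-integrable representations under $\mathrm{BC}_n$. This is proved by Beuzart-Plessis as a part of his work on the Plancherel formula of $L^2(H(F) \bs G(F))$ [BP18P]." — then THEOREM 1.1 (field) with p0004:L12-13 "This result seems well-known to experts. The “if” part is obtained by Kato-Takano [KT20] and Smith [Smith] by studying Jacquet modules. The “only if” part is essentially due to the above work of Beuzart-Plessis."  Typed: `CFrelSC` ⇐ Mok's memoir at all ranks ([Mok] = p0017:L50-51 "[Mok] C. Mok, Endoscopic classification of representations of quasi-split unitary groups, Mem. Amer. Math. Soc. 235 (2015), no. 1108, vi+248."; the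
base-change map BC_n and, with [Mat11] = p0017:L46-48 "[Mat11] N. Matringe, Distinguished generic representations of $\GL(n)$ over $p$-adic fields, Int. Math. Res. Not. IMRN (2011), no. 1, 74–95. MR 2755483." — published, Arthur-free, absorbed —, the Flicker – Rallis characterisation) ∧ row C25 ([BP18P], bibliography entry in the comment lines — its title names two conj.s —
↦ `Consumers34.BPPlancherel`, whose own edge is ⇐ Mok ∧ KMSW's proved scope ∧ tranche 34's two C25-internal fields); Kato – Takano [KT20], Smith [Smith], the
authors' homological proof of the « if » direction: Arthur-free, absorbed.  The theta case of §1.2 does not touch the classifications.  No status sentence.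

(2) ROW C152, TEXT STATE v6 (census `[g5c]` G-vii from the earlier version).  The paper's theorems (Theorem thm-main, the local converse statement for generic
parameters of F-split G with acceptable dual group; Theorem thm-variant = p0001:L559-560 "Statement \ref{st} is true for the following list of $G$, $K$ and $r$." for the list GL_n / U_n, G₂, Sp_{2n}, SO_{2n+1}, SO_{2n+2} split and
quasi-split, with p0001:L554 "Let $G=\mathrm{G}(F)$ be a quasi-split group. Then there exists $K/F$ a finite extension and $r:{}^L\mathrm G(K)\to \GL(V)$ a faithful representation of dimension $N$, such that if $\phi_i:\WD_F\to {}^LG$ is a generic homomorphism for $i=1,2$, and \[\gamma(s,r\circ {\phi_1}_{|\WD_K} \otimes \phi,\psi)=\gamma(s,r\circ {\phi_2}_{|\WD_K} \otimes \phi,\psi)\] for all irreducible representation $\phi$ of $\WD_K$ of dimension at most $\lfloor N/2 \rfloor$, then $r\circ \phi_2$ and $r\circ \phi_2$ are conjugate by the normalizer of $r({}^L\mathrm{G}(K))$ inside $\GL(V)$.") are Galois-side statements proved WITHOUT the classifications.  The book and Mok's memoir enter only the CLOSING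
OBSERVATION (source l.582; its first sentence, which names a conj. among the assumptions, is in the comment lines): the assumption p0001:L582 "and that the generic local Langlands correspondence $i$ of \cite{JaLiu} coincides with that obtained by endoscopic transfer in \cite{Art} and \cite{Mok}. This latter fact is true at least in the setting of generic supercuspidal representations of symplectic and split orthogonal groups, and we refer to \cite[Theorem B.2 and Remark B.3]{AHKO23}." and the
conclusion p0001:L582 "Then using \cite[Theorem 6.20]{JaLiu} and thanks to the uniqueness of generic representations inside L-packets with respect to a prescribed non degenerate character proved in \cite{Vgen}, Theorem \ref{thm variant} coincides with the local converse theorems mentioned in the introduction, using Langlands-Shahidi gamma factors." — [Art] = the book (`p0002.txt` = the .bbl, l.21-26), [Mok] = Mok's memoir (l.187-191), [JaLiu] = p0002:L153-156 "\bibitem[JL3]{JaLiu} C.~Jantzen and B.~Liu. \newblock The generic dual of p-adic groups and applications. \newblock {\em preprint, arXiv:2404.07111}, 2024." = census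
row B105 (tranche 26's `Consumers26.JantzenLiu` ⇐ Mok, typed from arXiv v1 of that preprint — whether its « Theorem 6.20 » is among the §6 statements the field
quotes was not checked: the row's one field is the premise), [AHKO23] = p0002:L10-14 "\bibitem[AHKO]{AHKO23} M.~Adrian, G.~Henniart, E.~Kaplan, and M.~Oi. \newblock Simple supercuspidal l-packets of split special orthogonal groups over dyadic fields. \newblock {\em preprint, https://arxiv.org/abs/2305.09076}, 2023." = census row B58 (J. Lond. Math. Soc. 112 (2025); tranche 3's `Consumers3.AHKO` ⇐
book) — a PARTIAL supplier of the assumed coincidence (generic supercuspidal representations of symplectic and split orthogonal groups only), recorded, not an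
edge (it does not discharge the node); [Vgen] = S. Varma, *On descent and the generic packet conj.*, Forum Math. 29 (2017) 111–155 (`p0002.txt` l.222-225; title word abbreviated) = census row B83 (a SECOND-HAND row of `DOWNSTREAM.md` `[g13c]`, graded provisionally from its zbMATH review, text
wanted acq-08103; no typed field — so no premise: absorbed here as published; cell `GAPS.md` G-DN-536 / 538).  Typed: node `MatLCTassume` (the observation's two assumptions as printed) and `MatLCTclassical` (its conclusion) with
`E_MatLCTclassical` ⇐ node ∧ book ∧ Mok (the endoscopic correspondences the assumption refers to) ∧ B105.  Census: grade G-vii unchanged (explicit assumptions);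
wording state v6 recorded; PREPRINT.

THE POINT FOR THE REGISTER (kernel, below).  C142's Theorem 1.1 rests on Mok's inputs and, through C25, on KMSW's proved scope and C25's own hypothesis node of
tranche 6 (`Consumers6.BPhyp`) — `cf_of_inputs` composes tranche 34's `bpPlancherel_of_leaves`; nothing of the book.  C152's remark, given its node, rests on the
book's and Mok's inputs (B105 through tranche 26's `jantzenLiu_of_leaves`: Mok only) — `mat_conditional_form`.  Expected exact supports (store-thaw backlog): Mok's
29 leaves ∪ support(`BPPlancherel`) for `CFrelSC`; the book's 24 ∪ Mok's 29 for `MatLCTclassical` given the node.  With this tranche every graded consumer row of the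
audit's list (e) except B16 has a typed field or a recorded identification. -/

/-- Rows C142 and C152 (text state v6) of the census, as an arbitrary assignment of truth values (structure only). [cite: Arthur2013, downstream register of the cell, hundred-and-thirty-fourth tranche (structure only)] -/
structure Consumers134 where
  /-- C142, THEOREM 1.1 AS PRINTED (L. Cai – Y. Fan, *Top degree Ext-groups and relatively supercuspidal spectra*, Adv. Math. 410 (2022) 108744, doi:10.1016/j.aim.2022.108744 = arXiv:2108.05591, there titled *Higher Ext-groups and relatively supercuspidal spectra*; `paper-arxiv-2108.05591/` under `HOME/pub-arthur-down-g57/primaries/`, VoR not compared; the Galois pair (G, H) of §1.1, BC_n the stable / unstable base-change lifting Rep(U_n) → Rep(G) of p0003:L110-112, « relatively supercuspidal » as defined in §1): p0004:L7-10 "Theorem 1.1. Let $\pi$ be a $H$-distinguished irreducible admissible representation of $G(F)$. Then $\pi$ is relatively supercuspidal if and only if $\pi$ is in the image of supercuspidal representations under $\mathrm{BC}_n$." [cite: CaiFan2022TopExt, Thm 1.1 (arXiv chunk p0004:L7-10; context p0003:L106-117, p0004:L1-13)] -/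
  CFrelSC : Prop
  /-- HYPOTHESIS NODE (row C152, text state v6; `src-2409.20240v6/`, SOURCE LINES): THE TWO ASSUMPTIONS OF THE CLOSING OBSERVATION for classical groups over F of characteristic zero — (a) the validity of the Gross – Prasad – Rallis statement on local factors the text names first (its sentence, which calls it a conj., is in the `--` lines below), and (b) p0001:L582 "that the generic local Langlands correspondence $i$ of \cite{JaLiu} coincides with that obtained by endoscopic transfer in \cite{Art} and \cite{Mok}." — with the text's partial supplier for (b): p0001:L582 "This latter fact is true at least in the setting of generic supercuspidal representations of symplectic and split orthogonal groups, and we refer to \cite[Theorem B.2 and Remark B.3]{AHKO23}." ([AHKO23] = census row B58, `Consumers3.AHKO`; generic supercuspidal representations of symplectic and split orthogonal groups only — not an edge). [cite: Matringe2024LocalConverse, closing observation (arXiv v6 source l.582)] -/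
  MatLCTassume : Prop
  /-- C152 (text state v6), THE CLOSING OBSERVATION's CONCLUSION AS PRINTED (N. Matringe, *Local converse theorems and Langlands parameters*, arXiv:2409.20240v6, 2025-10-28; PREPRINT; `src-2409.20240v6/`): under the node's assumptions, p0001:L582 "Then using \cite[Theorem 6.20]{JaLiu} and thanks to the uniqueness of generic representations inside L-packets with respect to a prescribed non degenerate character proved in \cite{Vgen}, Theorem \ref{thm variant} coincides with the local converse theorems mentioned in the introduction, using Langlands-Shahidi gamma factors." — where Theorem thm-variant is p0001:L559-560 "Statement \ref{st} is true for the following list of $G$, $K$ and $r$." [(1) GL_n(F) and U_n(E/F), (2) G₂(F), (3) Sp_{2n}(F), (4) SO_{2n+1}(F), (5) SO_{2n+2}(F) split, (6) SO_{2n+2}(E/F) quasi-split, l.561-567] for the Statement p0001:L554 "Let $G=\mathrm{G}(F)$ be a quasi-split group. Then there exists $K/F$ a finite extension and $r:{}^L\mathrm G(K)\to \GL(V)$ a faithful representation of dimension $N$, such that if $\phi_i:\WD_F\to {}^LG$ is a generic homomorphism for $i=1,2$, and \[\gamma(s,r\circ {\phi_1}_{|\WD_K} \otimes \phi,\psi)=\gamma(s,r\circ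 {\phi_2}_{|\WD_K} \otimes \phi,\psi)\] for all irreducible representation $\phi$ of $\WD_K$ of dimension at most $\lfloor N/2 \rfloor$, then $r\circ \phi_2$ and $r\circ \phi_2$ are conjugate by the normalizer of $r({}^L\mathrm{G}(K))$ inside $\GL(V)$." [cite: Matringe2024LocalConverse, closing observation (arXiv v6 source l.582), Thm thm-variant (l.559-568), Statement (l.554)] -/
  MatLCTclassical : Prop

-- Verbatim lines kept out of the docstrings by the register's lint.  C142, `paper-arxiv-2108.05591/`: p0003:L115-117 "* $\pi$ is distinguished if and only if $\pi$ is in the image of $\mathrm{BC}_n$. This is the so-called Flicker-Rallis conjecture which is proved by Matringe [Mat11] and Mok [Mok]."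
--   bibliography p0017:L10 "[BP18P] R. Beuzart-Plessis, Plancherel formula for $\mathrm \GL_n(F)\backslash\mathrm \GL_n(E)$ and applications to the Ichino-Ikeda and formal degree conjectures for unitary groups. Invent. Math. (2021)."
-- C152 v6 bibliography (`src-2409.20240v6/` p0002 = .bbl): p0002:L222-225 "\bibitem[Var]{Vgen} Sandeep Varma. \newblock On descent and the generic packet conjecture. \newblock {\em Forum Math.}, 29(1):111--155, 2017."
-- C152 v6, `src-2409.20240v6/` (source lines): the observation in full p0001:L582 "To conclude this paper, we make the following observation for classical groups when $F$ has characteristic zero. Assume the validity of the Gross-Prasad and Rallis conjecture and that the generic local Langlands correspondence $i$ of \cite{JaLiu} coincides with that obtained by endoscopic transfer in \cite{Art} and \cite{Mok}. This latter fact is true at least in the setting of generic supercuspidal representations of symplectic and split orthogonal groups, and we refer to \cite[Theorem B.2 and Remark B.3]{AHKO23}. Then using \cite[Theorem 6.20]{JaLiu} and thanks to the uniqueness of generic representations inside L-packets with respect to a prescribed non degenerate character proved in \cite{Vgen}, Theorem \ref{thm variant} coincides with the local converse theorems mentioned in the introduction, using Langlands-Shahidi gamma factors."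
--   abstract, last sentence p0001:L264 "When $F$ has characteristic zero and assuming the validity of the Gross-Prasad and Rallis conjecture, this latter variant translates via the generic local Langlands correspondence of Jantzen and Liu, into the usual local converse theorems for classical groups expressed in terms of Shahidi's gamma factors."
--   §1 p0001:L285 "Finally using ideas similar to those of our main theorem, we prove the variant which coincides with the known local converse theorems via the generic local Langlands correspondence in Theorem \ref{thm variant}."

/-- C142's THEOREM 1.1 ⇐ MOK's MEMOIR ∧ ROW C25 (`paper-arxiv-2108.05591/` §1.1, p0003:L106-117 and p0004:L1-13, quoted in the tranche docstring and the comment lines): the base-change lifting BC_n from the quasi-split unitary group and the Flicker – Rallis characterisation « proved by Matringe [Mat11] and Mok [Mok] » ↦ `∀ N, μ.Everything N` ([Mok] = the memoir; [Mat11] = N. Matringe, Int. Math. Res. Not. IMRN 2011, 74–95 — published, Arthur-free, absorbed; the two are cited jointly for one statement, not as alternatives); « The “only if” part is essentially due to the above work of Beuzart-Plessis » ([BP18P] = R. Beuzart-Plessis, Invent. Math. 225 (2021) = census row C25) ↦ `Consumers34.BPPlancherel`; « The “if” part is obtained by Kato-Takano [KT20] and Smith [Smith] » and the authors' Ext-computation: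 Arthur-free, absorbed.  Premises: Mok at all ranks, C25. [cite: CaiFan2022TopExt, §1.1 and Thm 1.1 (arXiv chunk p0003:L106 – p0004:L13); Mok2012 (as cited); BeuzartPlessis2021Plancherel, Thm 1 (as typed in `Consumers34.BPPlancherel`)] -/
def E_CFrelSC (μ : Mok2015.Nodes) (c₃₄ : Consumers34) (c₁₃₄ : Consumers134) : Prop :=
  (∀ N, μ.Everything N) → c₃₄.BPPlancherel → c₁₃₄.CFrelSC

/-- C152's CLOSING OBSERVATION ⇐ ITS NODE ∧ THE BOOK ∧ MOK's MEMOIR ∧ ROW B105 (`src-2409.20240v6/` source l.582, quoted in the fields and the comment lines): the assumed coincidence refers to the correspondences « obtained by endoscopic transfer in \cite{Art} and \cite{Mok} » — [Art] = the book (`p0002.txt` l.21-26) ↦ `∀ N, ν.Everything N`, [Mok] = the memoir (l.187-191) ↦ `∀ N, μ.Everything N`; « using \cite[Theorem 6.20]{JaLiu} » — [JaLiu] = C. Jantzen – B. Liu, arXiv:2404.07111 = census row B105 ↦ `Consumers26.JantzenLiu` (tranche 26, ⇐ Mok); « proved in \cite{Vgen} » — S. Varma, Forum Math. 29 (2017)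 111–155 = census row B83 (second-hand, no typed field, text wanted acq-08103): absorbed as published (cell `GAPS.md` G-DN-536 / 538); the Gross – Prasad – Rallis assumption and the coincidence itself ↦ the node `MatLCTassume`.  Premises: the node, the book at all ranks, Mok at all ranks, B105. [cite: Matringe2024LocalConverse, closing observation (arXiv v6 source l.582); JantzenLiu2024, §6 (as typed in `Consumers26.JantzenLiu`); Arthur2013 and Mok2012 (as cited)] -/
def E_MatLCTclassical (ν : Nodes) (μ : Mok2015.Nodes) (c₂₆ : Consumers26) (c₁₃₄ : Consumers134) : Prop :=
  c₁₃₄.MatLCTassume → (∀ N, ν.Everything N) → (∀ N, μ.Everything N) → c₂₆.JantzenLiu → c₁₃₄.MatLCTclassical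

/-- The hundred-and-thirty-fourth tranche of implications: C142's edge; C152's edge over its node. [cite: CaiFan2022TopExt, Thm 1.1; Matringe2024LocalConverse, closing observation (each edge's source in its own docstring)] -/
structure Implications134 (ν : Nodes) (μ : Mok2015.Nodes) (c₂₆ : Consumers26) (c₃₄ : Consumers34) (c₁₃₄ : Consumers134) : Prop where
  cf : E_CFrelSC μ c₃₄ c₁₃₄
  mat : E_MatLCTclassical ν μ c₂₆ c₁₃₄

variable {c₂ : Consumers2} {c₅ : Consumers5} {c₆ : Consumers6} {c₁₁ : Consumers11} {c₂₆ : Consumers26} {c₃₃ : Consumers33} {c₃₄ : Consumers34} {c₁₃₄ : Consumers134}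

/-- C142's Theorem 1.1 given Mok's memoir at all ranks and row C25's theorem. [cite: CaiFan2022TopExt, Thm 1.1 (bookkeeping proved here)] -/
theorem cf_of_rows (X : Implications134 ν μ c₂₆ c₃₄ c₁₃₄) (hμ : ∀ N, μ.Everything N) (h₂₅ : c₃₄.BPPlancherel) : c₁₃₄.CFrelSC :=
  X.cf hμ h₂₅

/-- C142's THEOREM 1.1 FROM THE INPUTS OF MOK's AND KMSW's DAGs (KMSW in its proved scope) and row C25's own hypothesis node of tranche 6 (`Consumers6.BPhyp`), through tranche
34's `bpPlancherel_of_leaves` — nothing of the book's leaves enters except through the joint Mok / KMSW bundles that theorem consumes.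
[cite: CaiFan2022TopExt, Thm 1.1 (bookkeeping proved here)] [claim: KalethaMinguezShinWhite2014, under-review] -/
theorem cf_of_inputs (X : Implications134 ν μ c₂₆ c₃₄ c₁₃₄) (T : Implications34 μ κ c₃₃ c₃₄) (T₃₃ : Implications33 ν μ κ c c₂ c₅ c₆ c₃₃) (Y₆ : Implications6 ν c c₆)
    (M : MokInputs μ) (K : KMSWInputs μ κ) (hB : c₆.BPhyp) : c₁₃₄.CFrelSC :=
  X.cf M.everything (bpPlancherel_of_leaves T T₃₃ Y₆ M K hB)

/-- C152's closing observation given its node, the book and Mok's memoir at all ranks, and row B105. [cite: Matringe2024LocalConverse, closing observation (bookkeeping proved here)] -/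
theorem mat_of_rows (X : Implications134 ν μ c₂₆ c₃₄ c₁₃₄) (hN : c₁₃₄.MatLCTassume) (hν : ∀ N, ν.Everything N) (hμ : ∀ N, μ.Everything N) (h₁₀₅ : c₂₆.JantzenLiu) :
    c₁₃₄.MatLCTclassical :=
  X.mat hN hν hμ h₁₀₅

/-- C152's CLOSING OBSERVATION FROM THE BOOK's AND MOK's INPUTS, GIVEN ITS NODE (B105 through tranche 26's `jantzenLiu_of_leaves`: Mok's inputs only).
[cite: Matringe2024LocalConverse, closing observation (bookkeeping proved here)] -/
theorem mat_of_inputs_and_node (X : Implications134 ν μ c₂₆ c₃₄ c₁₃₄) (Y : Implications26 ν μ c c₅ c₁₁ c₂₆) (A : BookInputs ν) (M : MokInputs μ) (hN : c₁₃₄.MatLCTassume) :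
    c₁₃₄.MatLCTclassical :=
  X.mat hN A.everything M.everything (jantzenLiu_of_leaves Y M)

/-- C152 (v6) IN CONDITIONAL FORM, 2026 (a preprint's closing remark, stated under explicit assumptions — census G-vii): granting both monographs' internal derivations,
supply edges and every PUBLISHED input, and the node, the observation is conditional on the book's AND Mok's 2024–2026 preprint layers and on the general and the
non-standard weighted fundamental lemmas of both. [cite: Matringe2024LocalConverse, closing observation (bookkeeping proved here)] -/
theorem mat_conditional_form (X : Implications134 ν μ c₂₆ c₃₄ c₁₃₄) (Y : Implications26 ν μ c c₅ c₁₁ c₂₆) (B : ν.BookEdges) (S : ν.SupplyEdges) (P : ν.PublishedLeaves)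
    (MB : μ.SectionEdges) (MS : μ.SupplyEdges) (MP : μ.PublishedLeaves) (hN : c₁₃₄.MatLCTassume) :
    ν.PreprintLeaves2026 → ν.WFL_general → ν.WFL_nonstandard → μ.PreprintLeaves2026 → μ.WFL_general → μ.WFL_nonstandard → c₁₃₄.MatLCTclassical :=
  fun hQ h6 h7 hMQ m6 m7 => mat_of_inputs_and_node X Y ⟨B, S, P, hQ, ⟨h6, h7⟩⟩ ⟨MB, MS, MP, hMQ, ⟨m6, m7⟩⟩ hN

/-- THE WHOLE HUNDRED-AND-THIRTY-FOURTH TRANCHE FROM THE INPUTS OF THE THREE DAGs (KMSW in its proved scope), the earlier tranches' edges (6, 26, 33, 34) and the two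
hypothesis nodes involved (C25's `BPhyp`, C152's `MatLCTassume`). [cite: CaiFan2022TopExt, Thm 1.1; Matringe2024LocalConverse, closing observation (bookkeeping proved here)] [claim: KalethaMinguezShinWhite2014, under-review] -/
theorem hundredthirtyfourth_of_inputs (X : Implications134 ν μ c₂₆ c₃₄ c₁₃₄) (T : Implications34 μ κ c₃₃ c₃₄) (T₃₃ : Implications33 ν μ κ c c₂ c₅ c₆ c₃₃)
    (Y₆ : Implications6 ν c c₆) (Y : Implications26 ν μ c c₅ c₁₁ c₂₆) (A : BookInputs ν) (M : MokInputs μ) (K : KMSWInputs μ κ) (hB : c₆.BPhyp) :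
    c₁₃₄.CFrelSC ∧ (c₁₃₄.MatLCTassume → c₁₃₄.MatLCTclassical) :=
  ⟨cf_of_inputs X T T₃₃ Y₆ M K hB, fun hN => mat_of_inputs_and_node X Y A M hN⟩

/-! ## Hundred-and-thirty-fifth tranche (v4, unit `pub-arthur-down-g57`): THE FIELD-COVERAGE AUDIT's DESK LIST, LAST ROW — B16 (node `CFMMXvoganLLC`, `CFMMXpurePackets`,
`CFMMXexamples` — C. Cunningham – A. Fiori – A. Moussaoui – J. Mracek – B. Xu, *Arthur packets for p-adic groups by way of microlocal vanishing cycles of perverse sheaves,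
with examples*, Mem. Amer. Math. Soc. 276 (2022) no. 1353, doi:10.1090/memo/1353), READ FROM THE arXiv v5 PDF TEXT

WHY.  B16 was the last graded row of the audit's list (cell `GAPS.md` G-DN-529 (e), D-DN-g57-13).  It could not be typed from the held corpus TeX: that conversion
leaks an authors' source comment at the sentence about [Art13]'s Chapter 9 (G-DN-533 (C2)).  This unit fetched the arXiv PDF of v5 (2021-02-08, the last arXiv
version; read-only GET) and extracted a per-page text — where the same sentence is PRINTED as « Endoscopy theory [Art13, Conj. 9.4.2] gives a map (3) » (p0011:L8,
full line in the comment lines: the authors resolved their own question by citing the Conj.).  The memoir proposes ABV-packets (microlocal vanishing cycles on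
Vogan varieties) and PROPOSES (as its main Conj.) that they recover Arthur's packets for quasi-split symplectic / special orthogonal p-adic groups and their pure rational forms;
its theorems on the functor NEvs (Theorem 7.10.1, Corollary 7.0.1) are geometric and inherit nothing.  What reaches the book: (a) the STANDING ASSUMPTION —
Vogan's local Langlands correspondence for the pure rational forms of G — typed as a node, with the text's own derivation of it for symplectic / special
orthogonal G from [Art13, Theorem 9.4.1]'s statements (§3.11) as supplier edge ⇐ the book ∧ the register's Chapter-9 leaf (`Consumers8.InnerTwists`, tranche 8:
the theorems STATED in Chapter 9, proofs deferred to [A28]), next to the §1.3 sentence of 2021 that this « has not been done yet »; (b) §3.11's PURE ARTHUR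
PACKETS with their canonical maps, assembled from [Art13, Theorem 1.5.1] (quasi-split), [Art13, Conj. 9.4.2 / Theorem 9.4.1] (inner twists) and Mœglin's
multiplicity one [Mœg11] (row B75) — the objects the main Conj. compares with ABV-packets; (c) Part 2's VERIFICATION of the memoir's Conj.s 1 and 2 in the
worked examples (SL(2), PGL(4), SO(3), SO(5), SO(7) and pure rational forms), which computes Arthur's packets and coefficients « in [Art13, Theorem 1.5.1] » by number.

TEXT (`HOME/pub-arthur-down-g57/primaries/arxiv-pdf-1705.01885v5/`, `KEYS.tsv` / `SHA256SUMS`): the arXiv PDF of 1705.01885v5 (`work/b16/1705.01885v5.pdf`, 202 pp.,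
sha256 in `index.json`), pypdf 4.3.1 text (`work/pdf2pages57.py`; the wheel vendored read-only from files.pythonhosted.org into the seat folder), pNNNN = PDF page,
Ln = line; dropped spaces of the extraction (« forp-adic », « quasi-spl it ») verbatim; masthead p0001:L1-8 "arXiv:1705.01885v5  [math.RT]  8 Feb 2021Arthur packets for p-adic groups by way of microlocal vanishing cycles of perverse sheaves, with examples Clifton Cunningham Andrew Fiori Ahmed Moussaoui James Mracek Bin Xu"; bib `CunninghamEtAl2022ABV` — the AMS version of
record was NOT compared.

THE PLACES.  §1.2: p0009:L46-48 "When Gis symplectic or special orthogonal, Arthur assigns to any ψa multiset Πψ(G(F))overΠ(G(F)), known as the Arthur packet for Gassociated with ψ[Art13 , Theorem 1.5.1]." […] p0010:L2 "result of Moeglin that Πψ(G(F))is actually a subset of Π(G(F))[Mœg11 ]."  §1.3, THE STANDING ASSUMPTION AND ITS 2021 STATUS SENTENCE: p0012:L2-13 "1.3. Main results. In this article we propose a geometric and categorical approach to calculating a generalization of ( 5), and therefore of ( 6) and ( 7) also, which applies to all quasisplit connected reductive algebr aic groupsGoverp-adic ﬁelds, assuming the local Langlands correspondence for its pure rational forms,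 as articulated by Vogan in [ Vog93 ]. The local Langlands correspondence is known for split symplectic and orthogonal groups by the work of Art hur and others. In [Art13 , Chapter 9] Arthur sets the foundation for adapting his work to inner forms of these groups, which can be seen as a step toward the version proposed by Vogan in [Vog93 ]. Building on Arthur’s work, Vogan’s version of the local La nglands correspondence is known for unitary groups by work of [ Mok15 ] and [KMSW14 ]; it is expected that similar arguments should yield the resul t for symplectic and orthogonal groups, but that has not been done yet."  §3.10 / §3.11
(inner twists; the sentences naming [Art13]'s Conj. 9.4.2 are in the comment lines): p0026:L28-36 "When the Langlands parameter φψis a tempered Langlands parameter, Arthur states all these results as a theorem [ Art13 , Theorem 9.4.1]. In particular, he claims that in this case ( 24) gives a bijection (25) Πφ(Gσ(F))→Π(Sφ,sc,˜ζσ). By the Langlands classiﬁcation of Π(Gσ(F)), which is in terms of tempered rep- resentations, this bijection extends to all relevant Langl ands parameters of Gσ. Moreover, it follows from [ Art13 , Theorem 9.4.1] that there is a bijection be- tweenΠ(Gσ(F))andˆG-conjugacy classes of pairs (φ,ǫ)forφ∈Prel(LGσ)and ǫ∈Π(Sφ,sc,˜ζσ)." and, after Proposition 3.11.1 (a canonical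 bijection Rep(A_ψ, χ) →
Rep(S_{ψ,sc}, ζ̃), group theory) and the canonical map (27): p0027:L38-53 "Letψbe an Arthur parameter of G. For pure rational form δsuch thatψis not relevant, we will deﬁne Πψ(Gδ(F),δ)to be empty. Then we can deﬁne the pure Arthur packet associated with ψto be (28) Πpure ψ(G/F) =⨆ [δ]∈H1(F,G)Πψ(Gδ(F),δ) as a subset of Πpure(G/F). It is equipped with a canonical map (29) Πpure ψ(G/F)→Rep(Aψ). Whenφψis a tempered Langlands parameter, this induces a bijection Πpure φψ(G/F)→Π(Aφψ). This bijection also extends to all Langlands parameters φofG, according to the discussion in the end of Section 3.10. Combined with the local Langlands corre- spondence for each pure rational form of G, we can conclude the local Langlands correspondence for pure rational forms of Gappearing in Section 3.8."  PART 2, §9 Overview: p0080:L3-8 "However, our real goal in Part 2is to show how to use results from Part 1to calculate the stable distributions in Arthur’s local result [ Art13 , Theorem 1.5.1] and also how to calculate the coeﬃcients that appear when these stable dist ributions are transferred to certain endoscopic groups. As a consequence, we give comp lete examples of [Art13 , Theorem 1.5.1] and explain how to use geometry to make the ca lculations." p0080:L11-25 "After ﬁxing a connected reductive group Gover ap-adic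 ﬁeldFand an inﬁn- itesimal parameter λ:WF→LG, we enumerate all admissible representations π of all pure rational forms of Gwith inﬁnitesimal parameter λ. We partition these admissible representations into L-packets and show how Aub ert duality operates on the representations. Then, for each L-packet of Arthur ty pe, we ﬁnd the Arthur packet that contains it. We calculate a twisting character w hich measures the diﬀer- ence between Arthur’s parametrization of representations in an Arthur packet with Mœglin’s parametrization. We ﬁnd the coeﬃcients in the inva riant distributions (116) ΘG ψ,s=∑ π∈Πψ(G(F))⟨ssψ,π⟩ψΘπ that arise from stable distributions attached to Arthur pac kets for endoscopic groups forG(F)in [Art13 , Theorem 1.5.1]. We also calculate the virtual representat ions ηψ,susing Arthur’s work. See Section 10.1for more detail on this part of the examples." […] p0080:L39-47 "To begin, we ﬁnd Vogan’s bijection between: admissible repr esentations of split p-adic groups and their pure rational forms with ﬁxed inﬁnite simal parameter λ:WF→LG, as recalled in Section 10.1; and simple equivariant perverse sheaves onVλ, as recalled in Section 10.2. With this bijection in hand, and the calculation ofEvfrom Section 10.2, we easily ﬁnd the ABV-packets ΠABV pure,φand associated virtual representations ηNEv φ,s. By referring back to Section 10.1, we easily see (118)" […]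
p0081:L2-7 "for all Arthur parameters ψwith inﬁnitesimal parameter λ, thus conﬁrming Con- jecture 1in the examples. This implies ( 12) and also implies (119) Πpure ψ= ΠABV φψ for every Arthur parameter with inﬁnitesimal parameter λ."  Bibliography: p0195:L17-19 "[Art13] ,The endoscopic classiﬁcation of representations , American Mathematical So- ciety Colloquium Publications, vol. 61, American Mathemat ical Society, Providence, RI, 2013, Orthogonal and symplectic groups. MR 3135650" / p0196:L44-46 "[Mœg11] C. Mœglin, Multiplicité 1 dans les paquets d’Arthur aux places p-adiques , On certain L-functions, Clay Math. Proc., vol. 13, Amer. Math. Soc., Pro vidence, RI, 2011, pp. 333–374. MR 2767522" / p0196:L47-48 "[Mok15] Chung Pang Mok, Endoscopic classiﬁcation of representations of quasi-spl it unitary groups , Mem. Amer. Math. Soc. 235(2015), no. 1108, vi+248. MR 3338302" / p0196:L17-19 "[KMSW14] Tasho Kaletha, Alberto Minguez, Sug Woo Shin, and P aul-James White, Endoscopic classiﬁcation of representations: Inner forms of unitary groups , https://arxiv.org/abs/1409.3731, 2014.".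

THE POINT FOR THE REGISTER (kernel, below).  Everything B16 takes from the classification runs through the book at all ranks AND the Chapter-9 leaf (and, for the
packets, row B75 under its own standing hypothesis `Consumers45.MoeglinDSHyp`): `cfmmx_of_inputs_and_leaves`; in conditional form (`cfmmx_conditional_form`) the
examples' verification is conditional, in 2026, on the book's 2024–2026 preprint layer, the general and the non-standard weighted fundamental lemmas, the
Chapter-9 statements ([A28], unwritten) and B75's hypothesis — the memoir's own 2021 sentence names the Chapter-9 part (« has not been done yet »).  Census: B16's
grade « context » is refined to G-iii-type for the standing assumption (an unwritten reference of the book named as not done) — recorded in `DOWNSTREAM5.md`, the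
kernel does not grade.  Expected exact supports (store-thaw backlog): book 24 ∪ {InnerTwists} for the node; ∪ support(B75) for the packets and the examples. -/

/-- Row B16 of the census with its hypothesis node, as an arbitrary assignment of truth values (structure only). [cite: Arthur2013, downstream register of the cell, hundred-and-thirty-fifth tranche (structure only)] -/
structure Consumers135 where
  /-- HYPOTHESIS NODE (row B16; `arxiv-pdf-1705.01885v5/` under `HOME/pub-arthur-down-g57/primaries/`): THE MEMOIR's STANDING ASSUMPTION — the local Langlands correspondence for the pure rational forms of the quasi-split connected reductive p-adic group G in Vogan's formulation (the bijection (9) between Π^pure_λ(G/F) and the simple equivariant perverse sheaves on V_λ): p0012:L2-6 "In this article we propose a geometric and categorical approach to calculating a generalization of ( 5), and therefore of ( 6) and ( 7) also, which applies to all quasisplit connected reductive algebr aic groupsGoverp-adic ﬁelds, assuming the local Langlands correspondence for its pure rational forms, as articulated by Vogan in [ Vog93 ]." — with the authors' 2021 status sentence p0012:L6-13 "The local Langlands correspondence is known for split symplectic and orthogonal groups by the work of Art hur and others. In [Art13 , Chapter 9] Arthur sets the foundation for adapting his work to inner forms of these groups, which can be seen as a step toward the version proposed by Vogan in [Vog93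 ]. Building on Arthur’s work, Vogan’s version of the local La nglands correspondence is known for unitary groups by work of [ Mok15 ] and [KMSW14 ]; it is expected that similar arguments should yield the resul t for symplectic and orthogonal groups, but that has not been done yet." [cite: CunninghamEtAl2022ABV, §1.3 (arXiv v5 PDF p0012:L2-13)] -/
  CFMMXvoganLLC : Prop
  /-- B16, THE PURE ARTHUR PACKETS OF §3.11 AS PRINTED (for G quasi-split symplectic or special orthogonal over the p-adic field F, §3.9): the multisets Π_ψ(G_δ(F), δ) over the pure rational forms δ with the canonical maps (27) Π_ψ(G_δ(F), δ) → Rep(A_ψ, χ_δ), assembled into p0027:L38-46 "Then we can deﬁne the pure Arthur packet associated with ψto be (28) Πpure ψ(G/F) =⨆ [δ]∈H1(F,G)Πψ(Gδ(F),δ) as a subset of Πpure(G/F). It is equipped with a canonical map (29) Πpure ψ(G/F)→Rep(Aψ)." [cite: CunninghamEtAl2022ABV, §3.11 (arXiv v5 PDF p0027:L27-53), §3.10 (p0026:L20-36)] -/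
  CFMMXpurePackets : Prop
  /-- B16, PART 2's VERIFICATIONS AS PRINTED (C. Cunningham – A. Fiori – A. Moussaoui – J. Mracek – B. Xu, Mem. Amer. Math. Soc. 276 (2022) no. 1353, doi:10.1090/memo/1353 = arXiv:1705.01885v5; the examples of §§11–16: SL(2) and its inner form, PGL(4), split SO(3), SO(5), SO(7) and their pure rational forms, for the infinitesimal parameters fixed there): p0080:L39-47 "With this bijection in hand, and the calculation ofEvfrom Section 10.2, we easily ﬁnd the ABV-packets ΠABV pure,φand associated virtual representations ηNEv φ,s. By referring back to Section 10.1, we easily see (118)" [η_{ψ,s} = η^{NEv}_{φ_ψ,s}] p0081:L2-7 "for all Arthur parameters ψwith inﬁnitesimal parameter λ, thus conﬁrming Con- jecture 1in the examples. This implies ( 12) and also implies (119) Πpure ψ= ΠABV φψ for every Arthur parameter with inﬁnitesimal parameter λ." [cite: CunninghamEtAl2022ABV, Part 2, §9 Overview (arXiv v5 PDF p0080:L2-48, p0081:L2-9), §§11–16] -/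
  CFMMXexamples : Prop

-- Verbatim lines kept out of the docstrings by the register's lint (sentences naming a conj.), and bibliography.  `arxiv-pdf-1705.01885v5/`:
--   §1.2 p0011:L8-9 "ofSψ,sc. Endoscopy theory [ Art13 , Conjecture 9.4.2] gives a map (3) Πψ(Gδ(F))→Rep(Sψ,sc,˜ζGδ);"
--   §1.3 p0012:L14-19 "Our approach is based on ideas developed for real groups in [ ABV92 ] and on results from [ Vog93 ] forp-adic groups. We conjecture that this geometric approach produces a map that coincides with ( 6) from Arthur, after specializing to the case of quasisplit symplectic and special orthogonal p-adic groups. The generalization of (6) that we propose leads quickly to what should be a generaliza tion of Arthur packets."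
--   §3.10 p0024:L40-49 "3.10. Arthur packets for inner rational forms. A conjectural description of Arthur packets for inner twists of Gis presented in [ Art13 , Chapter 9], though the story is far from complete. Let σbe an inner rational forms of G. An Arthur parameter ψofGσis said to be relevant if any Levi subgroup ofLGσthatψ factors through is the L-group of a Levi subgroup of Gσ. We denote the subset of relevant Arthur parameter by Qrel(Gσ). In [Art13 , Conjecture 9.4.2], Arthur assigns toψ∈Qrel(Gσ)a multiset Πψ(Gσ(F))overΠ(Gσ(F)), which is called the Arthur packet for Gσassociated with ψ. This time Moeglin’s results [ Mœg11 ] only show Πψ(Gσ(F))is a subset of Π(Gσ(F))in the case when σcomes from a pure rational form; see also [ Art13 , Conjecture 9.4.2, Remark 2]. For the purpose"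
--   §3.10 p0026:L20-27 "set of isomorphism classes of ˜ζσ-equivariant representations of Sψ,sc. In [Art13 , Conjecture 9.4.2], Arthur conjectures a map (24) Πψ(Gσ(F))→Rep(Sψ,sc,˜ζσ) and writes⟨·,π⟩ψ,scfor the character of the associated representation of Sψ,sc. Because of our deﬁnition of Πψ(Gσ(F))at the beginning of this section, one can not replace Rep(Sψ,sc,˜ζσ)by the subset Π(Sψ,sc,˜ζσ)of˜ζσ-equivariant irreducible characters ofSψ,scas in Arthur’s original formulation. The map ( 24) is far from being canonical for it depends on ( 15) and various other choices implicitly."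
--   §9 p0080:L2-3 "In Part 2of this article we consider various Gandλ:WF→LG, and then verify the conjectures from Section 8by brute force calculation. However, our" / §10 p0081:L7-9 "We also verify the Kazhdan-Lusztig conjecture in each example, which allows u s to verify Conjecture 2 in our examples."
--   bibliography p0197:L8-10 "[Vog93] David A. Vogan, Jr., The local Langlands conjecture , Representation theory of groups and algebras, Contemp. Math., vol. 145, Amer. Math. Soc., Pr ovidence, RI, 1993, pp. 305–379. MR 1216197" / p0195:L2 "[ABV92] Jeﬀrey Adams, Dan Barbasch, and David A. Vogan, Jr., The Langlands classiﬁcation"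

/-- THE NODE's PRINTED DERIVATION FOR SYMPLECTIC / SPECIAL ORTHOGONAL G ⇐ THE BOOK ∧ THE CHAPTER-9 LEAF (`arxiv-pdf-1705.01885v5/` §3.10 – §3.11): from « [Art13, Theorem 9.4.1] » the text draws the bijections (25) and « between Π(G_σ(F)) and Ĝ-conjugacy classes of pairs (φ, ǫ) » (p0026:L28-36), then p0027:L50-53 "This bijection also extends to all Langlands parameters φofG, according to the discussion in the end of Section 3.10. Combined with the local Langlands corre- spondence for each pure rational form of G, we can conclude the local Langlands correspondence for pure rational forms of Gappearing in Section 3.8." — [Art13] Chapter 9's stated theorems ↦ `Consumers8.InnerTwists` (tranche 8's leaf: proofs deferred to [A28]); the quasi-split case (15) / « [Art13, Theorem 1.5.1] » and the LLC of the quasi-split form ↦ `∀ N, ν.Everything N`.  Next to it, §1.3 (2021): « it is expected that similar arguments should yield the result for symplectic and orthogonal groups, but that has not been done yet » — the unitary case being « known … by work of [Mok15] and [KMSW14] » (not the groups of the memoir's Conj.; no edge).  Premises: the book at all ranks, the Chapter-9 leaf. [cite: CunninghamEtAl2022ABV, §3.10–3.11 (arXiv v5 PDF p0026:L28-36, p0027:L47-53),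 §1.3 (p0012:L6-13); Arthur2013, Thm 9.4.1 (as cited; the register's leaf `Consumers8.InnerTwists`)] -/
def E_CFMMXvoganLLC (ν : Nodes) (c₈ : Consumers8) (c₁₃₅ : Consumers135) : Prop :=
  (∀ N, ν.Everything N) → c₈.InnerTwists → c₁₃₅.CFMMXvoganLLC

/-- B16's PURE ARTHUR PACKETS ⇐ THE BOOK BY NUMBER ∧ THE CHAPTER-9 LEAF ∧ ROW B75 (`arxiv-pdf-1705.01885v5/`): the quasi-split packet and its map (1) / (15) — « [Art13, Theorem 1.5.1] » (p0009:L46-48) ↦ `∀ N, ν.Everything N`; the inner-twist packets and the map (24) — [Art13] Conj. 9.4.2 and « Arthur states all these results as a theorem [Art13, Theorem 9.4.1] » (p0026:L20-31, the Conj. sentences in the comment lines) ↦ `Consumers8.InnerTwists`; « result of Moeglin that Π_ψ(G(F)) is actually a subset of Π(G(F)) [Mœg11] » (p0010:L2) and « Moeglin’s results [Mœg11] only show Π_ψ(G_σ(F)) is a subset of Π(G_σ(F)) in the case when σ comes from a pure rational form » (p0024:L47-49) — [Mœg11] = C. Mœglin, Clay Math. Proc. 13 (2011) 333–374 = census row B75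 ↦ `Consumers45.MoeglinMult1`; Proposition 3.11.1 and the Kottwitz isomorphism: group theory, absorbed.  Premises: the book at all ranks, the Chapter-9 leaf, B75. [cite: CunninghamEtAl2022ABV, §1.2 (p0009:L46 – p0010:L6), §3.10–3.11 (p0024:L40 – p0027:L53); Moeglin2011Mult1 (as typed in `Consumers45.MoeglinMult1`)] -/
def E_CFMMXpurePackets (ν : Nodes) (c₈ : Consumers8) (c₄₅ : Consumers45) (c₁₃₅ : Consumers135) : Prop :=
  (∀ N, ν.Everything N) → c₈.InnerTwists → c₄₅.MoeglinMult1 → c₁₃₅.CFMMXpurePackets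

/-- B16's PART-2 VERIFICATIONS ⇐ THE BOOK BY NUMBER ∧ THE PURE PACKETS ∧ THE NODE (`arxiv-pdf-1705.01885v5/` §9): the first part of each example computes L-packets, Arthur packets, Mœglin's parametrisation and the coefficients ⟨s s_ψ, π⟩_ψ « in [Art13, Theorem 1.5.1] » and « the virtual representations η_{ψ,s} using Arthur’s work » (p0080:L11-25) ↦ `∀ N, ν.Everything N` ∧ `CFMMXpurePackets` (the pure-form side); the third part uses « Vogan’s bijection between: admissible representations of split p-adic groups and their pure rational forms … and simple equivariant perverse sheaves » (p0080:L39-42) ↦ the node `CFMMXvoganLLC`; the geometric side (V_λ, the functor NEv / Ev, Theorem 7.10.1, the Kazhdan – Lusztig computations): Arthur-free, absorbed.  Premises: the book at all ranks, `CFMMXpurePackets`, the node. [cite: CunninghamEtAl2022ABV, §9 (arXiv v5 PDF p0080:L2-48, p0081:L2-9)] -/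
def E_CFMMXexamples (ν : Nodes) (c₁₃₅ : Consumers135) : Prop :=
  (∀ N, ν.Everything N) → c₁₃₅.CFMMXpurePackets → c₁₃₅.CFMMXvoganLLC → c₁₃₅.CFMMXexamples

/-- The hundred-and-thirty-fifth tranche of implications: B16's node supplier and two edges. [cite: CunninghamEtAl2022ABV, §§1.3, 3.10–3.11, 9 (each edge's source in its own docstring)] -/
structure Implications135 (ν : Nodes) (c₈ : Consumers8) (c₄₅ : Consumers45) (c₁₃₅ : Consumers135) : Prop where
  node : E_CFMMXvoganLLC ν c₈ c₁₃₅
  pure : E_CFMMXpurePackets ν c₈ c₄₅ c₁₃₅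
  ex : E_CFMMXexamples ν c₁₃₅

variable {c₈ : Consumers8} {c₁₃ : Consumers13} {c₁₄ : Consumers14} {c₄₃ : Consumers43} {c₄₄ : Consumers44} {c₄₅ : Consumers45} {c₁₃₅ : Consumers135}

/-- B16's node from the book at all ranks and the Chapter-9 leaf, as the text derives it for symplectic / special orthogonal G. [cite: CunninghamEtAl2022ABV, §3.11 (bookkeeping proved here)] -/
theorem cfmmxNode_of_book_and_leaf (X : Implications135 ν c₈ c₄₅ c₁₃₅) (hν : ∀ N, ν.Everything N) (h9 : c₈.InnerTwists) : c₁₃₅.CFMMXvoganLLC :=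
  X.node hν h9

/-- ALL OF B16's TYPED STATEMENTS GIVEN THE BOOK AT ALL RANKS, THE CHAPTER-9 LEAF AND ROW B75. [cite: CunninghamEtAl2022ABV, §§3.11, 9 (bookkeeping proved here)] -/
theorem cfmmx_of_rows (X : Implications135 ν c₈ c₄₅ c₁₃₅) (hν : ∀ N, ν.Everything N) (h9 : c₈.InnerTwists) (h₇₅ : c₄₅.MoeglinMult1) :
    c₁₃₅.CFMMXvoganLLC ∧ c₁₃₅.CFMMXpurePackets ∧ c₁₃₅.CFMMXexamples :=
  have n := X.node hν h9
  have p := X.pure hν h9 h₇₅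
  ⟨n, p, X.ex hν p n⟩

/-- ALL OF B16 FROM THE BOOK's INPUTS, THE CHAPTER-9 LEAF AND ROW B75's STANDING HYPOTHESIS (B75 through tranche 45's `moeglinMult1_of_node`): every leaf of the book,
the leaf `InnerTwists` ([A28]) and B75's `MoeglinDSHyp`; nothing of Mok's memoir or KMSW. [cite: CunninghamEtAl2022ABV, §§3.11, 9 (bookkeeping proved here)] -/
theorem cfmmx_of_inputs_and_leaves (X : Implications135 ν c₈ c₄₅ c₁₃₅) (V : Implications45 ν μ κ c₁₃ c₁₄ c₄₃ c₄₄ c₄₅) (A : BookInputs ν) (h9 : c₈.InnerTwists)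
    (hDS : c₄₅.MoeglinDSHyp) : c₁₃₅.CFMMXvoganLLC ∧ c₁₃₅.CFMMXpurePackets ∧ c₁₃₅.CFMMXexamples :=
  cfmmx_of_rows X A.everything h9 (moeglinMult1_of_node V hDS).1

/-- B16 IN CONDITIONAL FORM, 2026, against its own 2021 sentence (« it is expected that similar arguments should yield the result for symplectic and orthogonal groups,
but that has not been done yet »): granting the book's internal derivations, supply edges, every PUBLISHED input and row B75's standing hypothesis, the Part-2
verifications rest on the book's 2024–2026 preprint layer, on the general and the non-standard weighted fundamental lemmas, AND on the Chapter-9 statements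
(`Consumers8.InnerTwists`: [A28], unwritten). [cite: CunninghamEtAl2022ABV, §1.3 (arXiv v5 PDF p0012:L10-13), §9 (bookkeeping proved here)] -/
theorem cfmmx_conditional_form (X : Implications135 ν c₈ c₄₅ c₁₃₅) (V : Implications45 ν μ κ c₁₃ c₁₄ c₄₃ c₄₄ c₄₅) (B : ν.BookEdges) (S : ν.SupplyEdges)
    (P : ν.PublishedLeaves) (hDS : c₄₅.MoeglinDSHyp) :
    ν.PreprintLeaves2026 → ν.WFL_general → ν.WFL_nonstandard → c₈.InnerTwists → c₁₃₅.CFMMXexamples :=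
  fun hQ h6 h7 h9 => (cfmmx_of_inputs_and_leaves X V ⟨B, S, P, hQ, ⟨h6, h7⟩⟩ h9 hDS).2.2

/-- THE WHOLE HUNDRED-AND-THIRTY-FIFTH TRANCHE FROM THE BOOK's INPUTS, tranche 45's edges, the Chapter-9 leaf and B75's hypothesis. [cite: CunninghamEtAl2022ABV, §§1.3, 3.11, 9 (bookkeeping proved here)] -/
theorem hundredthirtyfifth_of_inputs (X : Implications135 ν c₈ c₄₅ c₁₃₅) (V : Implications45 ν μ κ c₁₃ c₁₄ c₄₃ c₄₄ c₄₅) (A : BookInputs ν) (h9 : c₈.InnerTwists)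
    (hDS : c₄₅.MoeglinDSHyp) : c₁₃₅.CFMMXvoganLLC ∧ c₁₃₅.CFMMXpurePackets ∧ c₁₃₅.CFMMXexamples :=
  cfmmx_of_inputs_and_leaves X V A h9 hDS

/-! ## Hundred-and-thirty-sixth tranche (v6, unit `pub-arthur-down-g57`): PDF TEXT STATES — THE `\cite` LOCATORS THE CORPUS TeX CONVERSION DROPS, RESTORED FOR ROWS
C78 AND C149 (BY-NUMBER, STAR-MARKED USES OF CHENEVIER – RENARD); ROW C142's REWRITTEN arXiv v2 (THE PUBLISHED TITLE) TYPED (`CFv2part3`, `CFrelSCv2`)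

WHY.  Checking tranche 133's row C149 against its version of record (J. Théor. Nombres Bordeaux 31 (2020) no. 3, 751–775, open access; pypdf page text `vor-C149/`
under `HOME/pub-arthur-down-g57/primaries/`, pNNNN = PDF page) showed that the PRINTED text cites Chenevier – Renard's memoir (row C3) BY NUMBER AND WITH THAT
MEMOIR's STAR MARKERS — p0019:L25 "symplectic-orthogonal alternative [11, Theorem* 3.9],", p0022:L20 "discovered by Chenevier and Renard [11, Corollary** 6.5, Table 8]," — where the held corpus TeX of the same
paper (`paper:arxiv-1910.14128`, source `corpus-tex`, quoted in tranche 133) reads « [CR] ».  The arXiv PDFs print the same locators (v1 of 2019-10-30,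
`arxiv-pdf-1910.14128v1/`: p0014:L39-40 "By Arthur ’s symplectic- orthogonal alternative [CR, Theorem* 3.9],"; v2 of 2020-03-19, `arxiv-pdf-1910.14128v2/`, with numeric labels): the loss is in the corpus
conversion — the optional argument of `\cite[…]{…}` is dropped — not a revision.  The same holds for row C78 (arXiv:1605.00819 has one version, 2016-05-03;
`arxiv-pdf-1605.00819v1/`): its §6 prints « [CR, Proposition 3.6] », « [CR, Theorem* 3.19] », « [CR, Conj. 3.30] » (the word spelled out), « [CR, 3.20] »,
« [CR, Theorem* 3.9] », « [CR, Table 13] », « [A, §9] », « [Me1, Théorème 7.3.4] », « [CL, VIII, Théorème 1.2] », « [T] », and §§7–8 « [CR, Table 9] »,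
« [CR, Proposition* 4.15] » — rendered « [CR] », « [A] », « [Me] », « [CL] », « [T2] » without locators in the corpus text (`paper:arxiv-1605.00819`, the
accepted-manuscript TeX with other labels).  Row C131's corpus quotations (tranche 132) were compared with its arXiv v2 PDF (`arxiv-pdf-1212.6580v2-check/`
p0003:L10-11, L25): identical wording, nothing to restore.  Row C142's latest arXiv text, fetched for the same comparison, is instead a REWRITE: v2
(`arxiv-pdf-2108.05591v2/`; p0001:L1 "arXiv:2108.05591v2  [math.NT]  1 Mar 2025TOP DEGREE EXT-GROUPS AND RELATIVELY SUPERCUSPIDAL SPECTR A" — 2025-03-01, the published title, Adv. Math. 410 (2022) 108744) replaces v1's Theorem 1.1 (tranche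
134's `Consumers134.CFrelSC`, typed from the corpus TeX = v1 of 2021) by a Theorem 1.2 of another shape, proved in three parts of which the text attributes
part (3) to Mok's memoir and to row C25 by name and number.  Cell `GAPS.md` G-DN-540 hands the corpus-TeX locator loss to the successor line as a census-wide
screening pass; this tranche repairs the rows of THIS file it affects (docstrings of `E_BDMexamples` / `E_BDFKexamples` now point here) and types C142's v2.

C78 BY NUMBER (J. Bergström – N. Dummigan – T. Mégarbané, Exp. Math. 27 (2018) 230–250; `arxiv-pdf-1605.00819v1/`).  §6, the SO(7) set-up: p0010:L49-51 "multiplicity 1 according to Arthur’s multiplicity formula. (See [CR, Prop osition 3.6], and note that Vµis self-dual.)"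
— Arthur's multiplicity formula by name with an UNSTARRED statement of the memoir as reference (no further premise); p0010:L53-57 "By Arthur’s endoscopic classiﬁcation [CR, Theorem* 3.19] and multiplicity formula [CR, Conjec ture 3.30], we can sometimes then deduce the eigenvalue of T(p) on some automorphic repre- sentation πof SO(7)( A) with stable, tempered Arthur parameter (in the sense of [CR, 3.20])." —
« Theorem* 3.19 » (single star: resting on the book as stated) ↦ `Consumers.ChenevierRenardStar`, « Conj. 3.30 » = the memoir's own assumption 3.30 (the
multiplicity formula for the definite orthogonal groups, announced in the book's Chapter 9) = exactly the matter of `Consumers.ChenevierRenardStarStar`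
(tranche 1's docstring: the double star = the book « as well as … the assumptions 3.26 and 3.30 ») ↦ that field; p0010:L58-60 "by Arthur’s symplectic- orthogonal alternative [CR, Theorem* 3.9], this comes also from a dis crete auto- morphic representation of SO(4 ,3), whose Hecke eigenvalue for T(p) is the same." ↦ ★.
The 2016 status sentence, now with its pointers: p0011:L3-5 "Note that we have used several results which were conditional at the time of writing of [CR], but are now all pro ved, by work of many people, cited in the proof of" [Me1, Théorème 7.3.4] — [Me1] = T. Mégarbané, arXiv:1604.01914
= J. Théor. Nombres Bordeaux 30 (2018) = row C97 (`Consumers32.MegarbaneSO`) — then « See also the footnote below » [CL, VIII, Théorème 1.2] ([CL] = G. Chenevier –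
J. Lannes = row C5) « and [T] » ([T] = O. Taïbi, *Arthur's multiplicity formula for certain inner forms …* = row A3, `Consumers.TaibiInner`) (p0011:L5-6, whose
pypdf rendering of the accented theorem words is kept to the comment lines).  So the text's OWN named discharger of the double star is A3 — the premise tranche
1's supply edge `E_ChenevierRenardStarStar` (★★ ⇐ book ∧ `TaibiInner` ∧ `AMR`) already carries; no new edge.  Example 1: p0011:L9-11 "Thesearetakenfrom[CR, Table 13], where theywereconditionalonassumptionsincluding announcedresultso fArthur [A, §9], so the correctness of this list was double-starred in the sense of [C R]"
(then « see the paragraph preceding » [CR, Théorème 1.5**] « But it is now known unconditionally », p0011:L11-12, comment lines) ↦ ★★; the SO(8) examples likewise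
« taken from [CR, Table 13] » (p0014:L39), « According to [CR, Table 9], there is a single stable, tempered Arthur parameter » (p0023:L6, p0024:L17, L46) ↦ ★★,
and §7's p0021:L7 "[CR, Proposition* 4.15]," ↦ ★ / ★★ as marked.  Example 4 (p0016:L2-9) remarks that one instance of Harder's congruence « has actually been
proved by Chenevier and Lannes » [CL, X, Théorème* 4.4(1)], « now unconditional, thanks to recent work of Moeglin, Waldspurger, Shelstad and Mezo » — a status
remark on row C5's starred theorem, not an input of C78's computations (no field).  NET EFFECT ON TRANCHE 133: the premises of `E_BDMexamples` (C3 ★ ∧ C3 ★★)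
are CONFIRMED by number; the attribution inside its docstring is refined (the multiplicity formula the text invokes is [CR]'s assumption 3.30, i.e. ★★ matter,
not ★); C97 is a printed pointer (« for details of this work … see [Me1] », p0010:L44-45; « cited in the proof of [Me1, Théorème 7.3.4] ») but, Mégarbané being
a co-author presenting the computation as the paper's own, it is not made a premise here (contrast C149 below, whose text takes the eigenvalues FROM [Me]).

C149 BY NUMBER (J. Bergström – N. Dummigan – D. Farmer – S. Koutsoliotas, J. Théor. Nombres Bordeaux 31 (2020) 751–775).  arXiv v1 `arxiv-pdf-1910.14128v1/`:
p0014:L37-41 "Aself-dual, cuspidalautomorphic representation of PGL 6(A) discovered by Chenevier and Renard, denoted ∆ 25,15,5 in [CR, Table 13], has the correct inﬁnitesimal character. By Arthur ’s symplectic- orthogonal alternative [CR, Theorem* 3.9], it is the functorial lift of a discrete automorphic representation of SO(4 ,3)(A)."; p0017:L4-8 "This time a self-dual, cuspidal, automorphic representation of PGL 8(A) discov- ered by Chenevier and Renard [CR, Corollary**6.5, Table 8], denote d ∆25,19,11,5 in their notation, has the correct inﬁnitesimal character. By Arth ur’s symplectic- orthogonalalternative[CR, Theorem*3.9], it is the functorial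 lift of a discreteauto- morphicrepresentationofSO(5 ,4)(A)."; p0017:L48-52 "Example 6. Now consider a self-dual, cuspidal, automorphic representation of PGL 8(A) discovered by Chenevier and Renard [CR, Corollary**6.5, Table 8], denoted∆ 25,21,15,9in theirnotation. By Arthur’ssymplectic-orthogonalalternative [CR, Theorem* 3.9], it is the functorial lift of a discrete automorphic r epresentation of SO(5,4)(A).".
VoR `vor-C149/` (p0002:L36 "Manuscrit reçu le 6 mars 2019, révisé le 10 septembre 2019, accepté le 25 octobre 2019."): p0019:L22-26 "A self-dual, cuspidal automorphic representation of PGL 6(A)discovered by Chenevier and Renard, denoted ∆25,15,5in[11,Table13],hasthecorrectinﬁnitesimalcharacter.ByArthur’s symplectic-orthogonal alternative [11, Theorem* 3.9], it is the functorial lift of a discrete automorphic representation of SO(4,3)(A)." — identical sentences with the numeric label [11] = [CR]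
(p0022:L19-23, p0023:L19-23 likewise).  « Theorem* 3.9 » ↦ `Consumers.ChenevierRenardStar`; « Corollary** 6.5, Table 8 » and « Table 13 » ↦ `…StarStar`; [Me] =
row C97 as in tranche 133.  NET EFFECT ON TRANCHE 133: the three premises of `E_BDFKexamples` (C3 ★, C3 ★★, C97) are CONFIRMED by number and star; the census's
wording column « CR's ★ convention not carried over » (read from the corpus text) is WRONG for the printed paper — the stars ARE carried over, by number.

C142, TEXT STATE arXiv v2 (L. Cai – Y. Fan, *Top degree Ext-groups and relatively supercuspidal spectra*, Adv. Math. 410 (2022) 108744 = arXiv:2108.05591v2 of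
2025-03-01; `arxiv-pdf-2108.05591v2/`; the VoR itself not compared).  §1.1 now states p0003:L27-31 "The following is our main result for the Flicker-Rallis case , which answers (Q1). Theorem 1.2. Letπ∈Rep(G(F))be an irreducible representation. Then πis RSC if and only if π= IG(F) P(F)σfor some parabolic subgroup P=MN⊂Gand someH∩M-distinguished regular supercuspidal M(F)-representation σ." (RSC = relatively
supercuspidal, §1) and p0003:L61 "The proof of Theorem 1.2contains three parts:" (1) the « if » part, (2) the square-integrable case, and p0004:L1-5 "(3) An irreducible π∈Rep(G(F),ω)is a relatively discrete series (RDS) representation, i.e. π is a subrepresentation of the L2-completion L2(ZGH(F)\G(F),ω)ofiG(F) ZGH(F)ωif and only if π=IG(F) P(F)σforH∩M-distinguished regular square-integrable σ∈Rep(M(F)).".  Then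
p0004:L6-8 "For the “only if” part of Theorem 1.2, note that if πis RSC, then πis RDS. By (3), π=IG(F) P(F)σwithσ distinguished regular and square-integrable. By (2), σmust be supercuspidal." and p0004:L9-10 "Part (3) follows from the work of Mok [ 21] on the local base change lifting from unitary groups to general linear groups and the work of Beuzart-Plessis [ 4]" [on the Plancherel formula for L²(H(F)\G(F)); sentence completed in
the comment lines] — [21] = p0015:L9-10 "[21] C. Mok, Endoscopic classiﬁcation of representations of quasi-spl it unitary groups , Mem. Amer. Math. Soc. 235 (2015), no. 1108, vi+248." = Mok's memoir ↦ `∀ N, μ.Everything N`; [4] = R. Beuzart-Plessis, Invent. Math. (2021) (p0014:L51-52, comment lines) =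
row C25 ↦ `Consumers34.BPPlancherel`.  The text then spells the two inputs out: p0004:L13-16 "The local Langlands correspondence forUnestablished by Mok [ 21] gives a ﬁnite-to-one map from Temp(U n)to the set of tempered L- parameters for Unsatisfying certain properties, whose ﬁbres are the so-call ed tempered L-packets of Un(F)."; the base change lifting BC_n (p0004:L20-24);
the Flicker – Rallis statement for generic π « proved by Matringe [ 18, Theorem 5.2] » ([18] = IMRN 2011, Arthur-free; its sentence, which calls the statement
a conj., is in the comment lines) and p0004:L26-28 "In particular, by the above work of Mok, for any π∈Temp(G)(so thatπis generic), πisH-distinguished if and only if πis in the image of BCn."; p0004:L29 "There is an isomorphism of unitary representations [ 4, Theorem 1]" [the L² decomposition over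
Temp(U_n)/stab]; p0004:L34-37 "By [21],π∈Temp(G)lies in the image of square-integrable L-packets under BCnif and only if π=IG(F) P(F)σfor some parabolic subgroup P=MN⊂Gand someH∩M-distinguished regular square- integrableM(F)-representation σ.".  Parts (1) and (2): p0004:L41-43 "By studying Jacquet modules, (1) is obtained by Kato-Takano [16, Section 2.4] and Smith [ 28, Corollay 6.7]. The new point here is that we use homological m ethods to prove both (1) and (2). (We will not say anything about (3).)" — Kato – Takano, Smith and the
authors' Ext-computations: Arthur-free, absorbed.  Typed: `CFv2part3` = statement (3) as printed, with `E_CFv2part3` ⇐ Mok at all ranks ∧ C25 (the printed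
attribution); `CFrelSCv2` = Theorem 1.2 as printed, with `E_CFrelSCv2` ⇐ `CFv2part3` (parts (1), (2) absorbed).  Relation to tranche 134: v1's Theorem 1.1
(`Consumers134.CFrelSC`: RSC ⟺ in the image of supercuspidal representations under BC_n) and v2's Theorem 1.2 (RSC ⟺ parabolically induced from a regular
distinguished supercuspidal σ) are different printed statements about the same objects; the register types both, each from its own text, with the SAME two
census premises — `cf_v1_v2_same_premises` below; no edge between the two statements is typed (none is printed).

THE POINT FOR THE REGISTER (kernel, below).  C142 v2: `CFrelSCv2` follows from Mok's inputs, KMSW's inputs (proved scope) and C25's node `Consumers6.BPhyp` through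
tranche 34's `bpPlancherel_of_leaves`, exactly like tranche 134's `cf_of_inputs` (`cf2_of_inputs`); both text states together (`cf_v1_v2_same_premises`).  C78 /
C149: no kernel change (premises confirmed; tranche 133's `bdm_of_leaves`, `bdfk_of_leaves`, `bdm_conditional_form`, `bdfk_conditional_form` stand).  Exact
supports (store-thaw backlog): Mok's 29 ∪ KMSW's proved-scope leaves ∪ {`BPhyp`} for `CFrelSCv2`, as for `CFrelSC`. -/

/-- Row C142 in its arXiv-v2 text state, as an arbitrary assignment of truth values (structure only; the typed inputs are the `E_…` hypotheses below).
[cite: Arthur2013, downstream register of the cell, hundred-and-thirty-sixth tranche (structure only)] -/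
structure Consumers136 where
  /-- C142 (text state arXiv v2, 2025-03-01 = the published title; `arxiv-pdf-2108.05591v2/` under `HOME/pub-arthur-down-g57/primaries/`), STATEMENT (3) OF THE PROOF OF THEOREM 1.2 AS PRINTED (G = Res_{E/F} GL_n, H = GL_n, E/F quadratic, §1.1): p0004:L1-5 "(3) An irreducible π∈Rep(G(F),ω)is a relatively discrete series (RDS) representation, i.e. π is a subrepresentation of the L2-completion L2(ZGH(F)\G(F),ω)ofiG(F) ZGH(F)ωif and only if π=IG(F) P(F)σforH∩M-distinguished regular square-integrable σ∈Rep(M(F))." [cite: CaiFan2022TopExt, §1.1, statement (3) (arXiv v2 PDF p0004:L1-5)] -/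
  CFv2part3 : Prop
  /-- C142 (text state arXiv v2), THEOREM 1.2 AS PRINTED (L. Cai – Y. Fan, *Top degree Ext-groups and relatively supercuspidal spectra*, Adv. Math. 410 (2022) 108744, doi:10.1016/j.aim.2022.108744 = arXiv:2108.05591v2; RSC = relatively supercuspidal as defined in §1; `arxiv-pdf-2108.05591v2/`, VoR not compared): p0003:L28-31 "Theorem 1.2. Letπ∈Rep(G(F))be an irreducible representation. Then πis RSC if and only if π= IG(F) P(F)σfor some parabolic subgroup P=MN⊂Gand someH∩M-distinguished regular supercuspidal M(F)-representation σ." — with p0003:L32 "Here an irreducible representation σ=⊠iσi∈Rep(M(F))is called regular ifσiare mutually distinct." [cite: CaiFan2022TopExt, Thm 1.2 (arXiv v2 PDF p0003:L28-32)] -/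
  CFrelSCv2 : Prop

-- Verbatim lines kept out of the docstrings by the register's lint or by their pypdf rendering.  C142 v2, `arxiv-pdf-2108.05591v2/`: p0004:L9-11 "Part (3) follows from the work of Mok [ 21] on the local base change lifting from unitary groups to general linear groups and the work of Beuzart-Plessis [ 4] on the conjectured Plancherel formula for L2(H(F)\G(F)). We brieﬂy review these two results here using notations fro m [4, Section 2.10]."
--   p0004:L25-26 "It is conjectured by Flicker-Rallis (See [ 1, Section 3]) and proved by Matringe [ 18, Theorem 5.2] that forπ∈Rep(G(F))generic,πisH-distinguished if and only if its L-paramater is in the image of BCn."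
--   bibliography p0014:L51-52 "[4] R. Beuzart-Plessis, Plancherel formula for GLn(F)\GLn(E)and applications to the Ichino-Ikeda and formal degree conjectures for unitary groups . Invent. Math. (2021)."; p0015:L3-4 "[18] N. Matringe, Distinguished generic representations of GL(n)overp-adic ﬁelds , Int. Math. Res. Not. IMRN (2011), no. 1, 74–95."
-- C78, `arxiv-pdf-1605.00819v1/`: p0011:L5-6 "work of many people, cited in the proof of [Me1, Th´ eor` eme 7.3.4]. Se e also the footnote below [CL, VIII, Th´ eor` eme 1.2], and [T]."; p0011:L11-12 "so the correctness of this list was double-starred in the sense of [C R]; see the para- graph preceding [CR, Th´ eor` eme 1.5**]. But it is now known uncondit ionally."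
--   p0016:L5-9 "This instance of Harder’s conjecture has actually been proved by C henevier and Lannes [CL, X, Th´ eor` eme* 4.4(1)]. We are grateful to G. Chenev ier for explaining that this theorem is now unconditional, thanks to recent work of Mo eglin, Wald- spurger, Shelstad and Mezo. (See the paragraph following [CL, VII I, Th´ eor` eme* 1.1].)"
--   bibliography p0034:L21-23 "[Me1] T. M´ egarban´ e, Traces des op´ erators de Hecke sur les espaces de formes automor- phes de SO 7, SO8ou SO 9en niveau 1 et poids arbitraire, preprint, April 2016, http://arxiv.org/abs/1604.01914v1 ."; p0034:L36 "[T] O. Ta¨ ıbi, Arthur’s multiplicity formula for certain in ner forms of symplectic and special"; p0033:L27 "[CL] G. Chenevier, J. Lannes, Formes automorphes et voisins de Kneser des r´ eseaux de Niemeier,"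

/-- C142 v2's STATEMENT (3) ⇐ MOK's MEMOIR ∧ ROW C25 (`arxiv-pdf-2108.05591v2/` p0004:L9-11, quoted in the comment lines; the two inputs spelled out at p0004:L13-37, quoted in the tranche docstring): « the work of Mok [ 21] on the local base change lifting from unitary groups to general linear groups » — [21] = the memoir ↦ `∀ N, μ.Everything N` (the LLC for U_n, the base change lifting BC_n, and « By [21], π ∈ Temp(G) lies in the image of square-integrable L-packets under BC_n if and only if … »); « the work of Beuzart-Plessis [ 4] » and « [ 4, Theorem 1] » — [4] = R. Beuzart-Plessis, Invent. Math. 225 (2021) = census row C25 ↦ `Consumers34.BPPlancherel`; Matringe [18, Theorem 5.2] (IMRN 2011): published, Arthur-free, absorbed.  Premises: Mok at all ranks, C25. [cite: CaiFan2022TopExt, §1.1 (arXiv v2 PDF p0004:L1-37); Mok2012 (as cited); BeuzartPlessis2021Plancherel, Thm 1 (as typed in `Consumers34.BPPlancherel`)] -/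
def E_CFv2part3 (μ : Mok2015.Nodes) (c₃₄ : Consumers34) (c₁₃₆ : Consumers136) : Prop :=
  (∀ N, μ.Everything N) → c₃₄.BPPlancherel → c₁₃₆.CFv2part3

/-- C142 v2's THEOREM 1.2 ⇐ ITS STATEMENT (3) (`arxiv-pdf-2108.05591v2/` p0003:L61 – p0004:L8 and p0004:L41-43, quoted in the tranche docstring): of the proof's three parts, (1) is « obtained by Kato-Takano [16, Section 2.4] and Smith [ 28, Corollay 6.7] » and reproved homologically with (2) by the authors — Arthur-free, absorbed; (3) ↦ `CFv2part3`; « For the “only if” part of Theorem 1.2, note that if π is RSC, then π is RDS. By (3), … By (2), σ must be supercuspidal. »  Premise: `CFv2part3`. [cite: CaiFan2022TopExt, Thm 1.2 and §1.1 (arXiv v2 PDF p0003:L61-68, p0004:L1-8, L41-43)] -/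
def E_CFrelSCv2 (c₁₃₆ : Consumers136) : Prop :=
  c₁₃₆.CFv2part3 → c₁₃₆.CFrelSCv2

/-- The hundred-and-thirty-sixth tranche of implications: C142 v2's two edges. [cite: CaiFan2022TopExt, Thm 1.2 (each edge's source in its own docstring)] -/
structure Implications136 (μ : Mok2015.Nodes) (c₃₄ : Consumers34) (c₁₃₆ : Consumers136) : Prop where
  cfPart3 : E_CFv2part3 μ c₃₄ c₁₃₆
  cf2 : E_CFrelSCv2 c₁₃₆

variable {c₁₃₆ : Consumers136}

/-- C142 v2's statement (3) and Theorem 1.2 given Mok's memoir at all ranks and row C25's theorem. [cite: CaiFan2022TopExt, Thm 1.2 (bookkeeping proved here)] -/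
theorem cf2_of_rows (X : Implications136 μ c₃₄ c₁₃₆) (hμ : ∀ N, μ.Everything N) (h₂₅ : c₃₄.BPPlancherel) : c₁₃₆.CFv2part3 ∧ c₁₃₆.CFrelSCv2 :=
  ⟨X.cfPart3 hμ h₂₅, X.cf2 (X.cfPart3 hμ h₂₅)⟩

/-- C142 v2's THEOREM 1.2 FROM THE INPUTS OF MOK's AND KMSW's DAGs (KMSW in its proved scope) and row C25's hypothesis node of tranche 6 (`Consumers6.BPhyp`), through
tranche 34's `bpPlancherel_of_leaves` — the same road as tranche 134's `cf_of_inputs` for v1's Theorem 1.1; nothing of the book's leaves enters except through the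
joint Mok / KMSW bundles that theorem consumes. [cite: CaiFan2022TopExt, Thm 1.2 (bookkeeping proved here)] [claim: KalethaMinguezShinWhite2014, under-review] -/
theorem cf2_of_inputs (X : Implications136 μ c₃₄ c₁₃₆) (T : Implications34 μ κ c₃₃ c₃₄) (T₃₃ : Implications33 ν μ κ c c₂ c₅ c₆ c₃₃) (Y₆ : Implications6 ν c c₆)
    (M : MokInputs μ) (K : KMSWInputs μ κ) (hB : c₆.BPhyp) : c₁₃₆.CFrelSCv2 :=
  (cf2_of_rows X M.everything (bpPlancherel_of_leaves T T₃₃ Y₆ M K hB)).2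

/-- BOTH TEXT STATES OF ROW C142 FROM THE SAME TWO CENSUS PREMISES: v1's Theorem 1.1 (tranche 134, `Consumers134.CFrelSC`) and v2's Theorem 1.2 (`CFrelSCv2`), given
Mok's memoir at all ranks and row C25 — the register's record that the rewrite changed the printed statement, not its suppliers.
[cite: CaiFan2022TopExt, Thm 1.1 (arXiv v1) and Thm 1.2 (arXiv v2) (bookkeeping proved here)] -/
theorem cf_v1_v2_same_premises (X₁₃₄ : Implications134 ν μ c₂₆ c₃₄ c₁₃₄) (X : Implications136 μ c₃₄ c₁₃₆) (hμ : ∀ N, μ.Everything N) (h₂₅ : c₃₄.BPPlancherel) :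
    c₁₃₄.CFrelSC ∧ c₁₃₆.CFrelSCv2 :=
  ⟨cf_of_rows X₁₃₄ hμ h₂₅, (cf2_of_rows X hμ h₂₅).2⟩

/-- C142 v2 IN CONDITIONAL FORM, 2026: granting Mok's internal derivations, supply edges and every PUBLISHED input, KMSW's inputs in their proved scope and C25's node,
Theorem 1.2 is conditional on Mok's 2024–2026 preprint layer and on the general and the non-standard weighted fundamental lemmas (the book's own layer enters only
through what `bpPlancherel_of_leaves` consumes, i.e. not at all beyond the Mok / KMSW bundles). [cite: CaiFan2022TopExt, Thm 1.2 (bookkeeping proved here)] [claim: KalethaMinguezShinWhite2014, under-review] -/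
theorem cf2_conditional_form (X : Implications136 μ c₃₄ c₁₃₆) (T : Implications34 μ κ c₃₃ c₃₄) (T₃₃ : Implications33 ν μ κ c c₂ c₅ c₆ c₃₃) (Y₆ : Implications6 ν c c₆)
    (MB : μ.SectionEdges) (MS : μ.SupplyEdges) (MP : μ.PublishedLeaves) (K : KMSWInputs μ κ) (hB : c₆.BPhyp) :
    μ.PreprintLeaves2026 → μ.WFL_general → μ.WFL_nonstandard → c₁₃₆.CFrelSCv2 :=
  fun hMQ m6 m7 => cf2_of_inputs X T T₃₃ Y₆ ⟨MB, MS, MP, hMQ, ⟨m6, m7⟩⟩ K hB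

/-- THE WHOLE HUNDRED-AND-THIRTY-SIXTH TRANCHE FROM THE INPUTS OF MOK's AND KMSW's DAGs (KMSW in its proved scope), the earlier tranches' edges (6, 33, 34) and C25's
hypothesis node. [cite: CaiFan2022TopExt, Thm 1.2 (bookkeeping proved here)] [claim: KalethaMinguezShinWhite2014, under-review] -/
theorem hundredthirtysixth_of_inputs (X : Implications136 μ c₃₄ c₁₃₆) (T : Implications34 μ κ c₃₃ c₃₄) (T₃₃ : Implications33 ν μ κ c c₂ c₅ c₆ c₃₃)
    (Y₆ : Implications6 ν c c₆) (M : MokInputs μ) (K : KMSWInputs μ κ) (hB : c₆.BPhyp) : c₁₃₆.CFv2part3 ∧ c₁₃₆.CFrelSCv2 :=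
  cf2_of_rows X M.everything (bpPlancherel_of_leaves T T₃₃ Y₆ M K hB)


/-! ## Hundred-and-thirty-seventh tranche (v7, unit `pub-arthur-down-g58`): THE 2026-08-25 arXiv MAILING — row C251 H. T. Dang, arXiv:2608.14145 **v2** (`DangTypeVa` =
the NEW §5 Theorem 5.2 with Corollary 5.3, premise-free as printed)

Context (`DOWNSTREAM5.md` §0ej + Block B¹⁴⁴ `[g58]`; GAPS G-DN-544 / 545; DIVERGENCE3 D-DN-g58-5; CITED-FACTS5 DN-1188 … 1192).  THE MAILING.  The arXiv announcement of
2026-08-25 (Monday's 14:00 ET cut-off) was read through the export API (the `/list/math.NT/new` page still showed « Monday, 24 August 2026 » at 02:31Z; the API served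
ids up to 2608.23559): the 39-needle sweep of unit `pub-arthur-down-g55`'s kit returned 56 « NEW? » lines, all 56 inside unit `pub-arthur-down-g50`'s Monday baseline — NO
new consumer; an `id_list` scan of the 1,417 arXiv ids named in the census found exactly ONE record updated on or after 2026-08-24: arXiv:2608.14145 v1 → v2 (updated
2026-08-24T03:17:45Z), census row C251 — H. T. Dang, *A structural trace identity and certified spectra for the Richelot–Brandt graph* (PREPRINT), typed in tranche
100 (`Downstream30.lean`, unit `pub-arthur-down-g39`) as `Consumers100.DangRB` = Theorem 2.4 with Proposition 4.4 ⇐ the book ∧ row C90 `Consumers28.VanHoften` ∧ row C244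
`Consumers98.DPRTjl` ∧ row C180 `Consumers19.SchmidtParamodular` (`E_DangRB`).  THE v2 TEXT (36 pp.; PDF fetched read-only 2026-08-25, pypdf text staged by this unit as
`arxiv-pdf-2608.14145v2/` under `HOME/pub-arthur-down-g58/primaries/`, sha256 in `KEYS.tsv` / `SHA256SUMS`; pNNNN = PDF page, Ln = line; words run together as
extracted): the v1 quotations of tranche 100 re-located one by one (substring test modulo extraction spacing; `HOME/pub-arthur-down-g58/work/repl/c251_v1_v2_concordance.txt`):
the TYPED STATEMENT is unchanged — Theorem 2.4 (v1 p0005:L27-35 = v2 p0006:L16-24), Proposition 4.4 (v1 p0012:L6-11 = v2 p0012:L43-48) and its proof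
sentence (v1 p0012:L20-21 = v2 p0013:L10-11), §4.2's transfer sentence (v1 p0011:L49-50 = v2 p0012:L37-38) and the table line « Theorem 2.4 p≥11 Derived from
published transfer and classification results » (v2 p0007:L6-7) carry the same words; the EDGE's SUPPLIERS are unchanged but RENUMBERED — v2 inserts new
bibliography entries, so v1's « [36, 39, 14, 37] » (§1.4) / « consequences of [36, 39, 14], organized by Arthur type as in [37] » (§4.2) read in v2 p0003:L43-44 /
p0012:L40-42 "multiplicity statements used here are consequences of [36, 44, 14], organized by Arthur type as in [42]." with v2 [44] = van Hoften = v1 [39] (row C90),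
v2 [42] = Schmidt = v1 [37] (row C180), [36] = Rösner – Weissauer and [14] = Dummigan – Pacetti – Rama – Tornaría (row C244's text) in both, while v2's [39] is
Gan – Tantono and v2's [37] is Chan – Gan (bibliography lines in the `--` comments); REWRITTEN are the abstract, §1.3's status paragraph, §1.4's last clause and
Table 1 (a « Theorem 5.2 » line added, the line for the authors' Conj. 2.2 changed, « Theorem 8.5 » renumbered 9.5 by the inserted Section 5).  WHAT v2 ADDS: a fourth « level of assertion » and a
new Section 5 — p0003:L2-3 "The full statement is Theorem 5.2 in Section 5. The input is the global lifting theorem of R¨ osner and Weissauer for inner forms of GSp4anisotropic at the archimedean place [36, Thm. 11.4],";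
the status table p0007:L8-9 "Theorem 5.2p≥11 Unconditional theorem, via [36, Thm. 11.4]"; the rewritten §1.4 p0003:L43-47 "1.4.Relation to prior work.The transfer and Arthur-type framework used here rests on pub- lished work on the compact inner form and its transfer to GSp4[36, 44, 14, 42]. The parahoric data that identify the type-Va contribution come from [34, Table A.15]. Ibukiyama’s dimension identity supplies the unconditional count underlying the degree bookkeeping [21, Thm. 3.1]; the multiplicity assertion for the general-type rows is proved in Section 5 via [36, Thm. 11.4], while the"
[Saito–Kurokawa and Yoshida rows remain conj…al outside the certified range] ([36] = Rösner – Weissauer, [44] = van Hoften = row C90, [14] = Dummigan – Pacetti – Rama –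
Tornaría = row C244's input, [42] = Schmidt = row C180; bibliography lines in the `--` comments); the status paragraph (v1: « Of these three components, only the first is
unconditional for all p ») now reads p0003:L39 "Of these four components, the first and the fourth are unconditional for allp; the second is a" [conj. …] (in full in
the `--` comment).  THE INPUT OF THEOREM 5.2: [36, Thm. 11.4] = M. Rösner – R. Weissauer, J. Number Theory 263 (2024) 79–138 = arXiv:2103.14715 = the census's CONTROL
row C18 / E4 (`DOWNSTREAM.md` `[g2]`: « gives an INDEPENDENT proof in the cohomological case »; the held corpus TeX `paper:arxiv-2103.14715`, three chunk files staged by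
this unit as `paper-arxiv-2103.14715/`: p0026:L19 "We thus attempt not to use Arthur's classification." after "This classification has not been fully proven, although important progress has been made by Gee and Taïbi [Gee_Taibi] and others. However, their proof is this still conditional on other results announced by Arthur [Arthur13_Book]."
and p0028:L10 "Since we are only concerned with the cohomological spectrum, we think it may therefore be useful to give in that cohomological setting an independent proof that does not use announced,"
p0028:L11 "but not yet available results on twisted weighted endoscopy."; its Theorem 11.4, p0031:L64-66 "Theorem 11.4. Let $G$ be an inner form of $H=\GSp(4)$ that is anisotropic at the archimedean place. Let $\pi$ be an irreducible automorphic representation of $G(\A)$."),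
with [39] = Gan – Tantono, Amer. J. Math. 136 (2014) (the local Langlands correspondence for inner forms of GSp(4): local, Arthur-free).  TYPED HERE: `Consumers137.DangTypeVa`
= Theorem 5.2 with Corollary 5.3 (v2) and the PREMISE-FREE edge `E_DangTypeVa` — the register's standing treatment of a statement whose printed inputs are a control row and
Arthur-free published work (as tranche 118's `E_HanzerBorel`, tranche 119's `E_IchinoPrasannaHodgeVoR_i`); `Implications137`; `dangTypeVa_inherits_nothing`,
`c251_two_text_states` (v1's Theorem 2.4 from its four typed premises through tranche 100's `dang_of_rows`, beside v2's Theorem 5.2 from nothing), `c251_v2_of_leaves`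
(the pair from the book's inputs through tranche 100's `dang_of_leaves`), `hundredthirtyseventh_of_inputs`.  NOT TYPED: Conj. 2.2's remaining rows (Saito–Kurokawa, Yoshida:
the authors' own conj., not a consumer statement); Theorem 2.3 (the certified finite verification 11 ≤ p ≤ 149: computer-assisted, Arthur-free); Theorem 2.1 (unchanged,
Arthur-free, recorded by tranche 100).  Reused declarations: `Consumers100` / `Implications100` / `dang_of_rows` / `dang_of_leaves` (tranche 100, `Downstream30.lean`),
`Implications98` (tranche 98, `Downstream29.lean`), `Implications28` (`Downstream5.lean`), `Implications20` and `Implications19` (`Downstream3.lean`), `Implications` / `BookInputs` (`Downstream.lean`); all on the import chain of `…Downstream33`.  No new import. -/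

/-- Row C251 in its arXiv v2 text state (2026-08-24), as an arbitrary assignment of a truth value: the register records which typed input the TEXT invokes for the new
§5 theorem (none inside the three DAGs), never the truth of the field. [cite: Arthur2013, downstream register of the cell, hundred-and-thirty-seventh tranche (structure only)] -/
structure Consumers137 where
  /-- C251 in arXiv v2, THEOREM 5.2 WITH COROLLARY 5.3 AS PRINTED (H. T. Dang, arXiv:2608.14145v2, §5 « The occurrence theorem for the type-Va block »; `arxiv-pdf-2608.14145v2/`; G = GU₂(B), B the definite quaternion algebra of discriminant p, M_{0,0}(U_pr(p)) the principal-genus space of §4, R(π) the Atkin–Lehner involution, ξ, λ as in Remark 4.6): p0015:L32-36 "Theorem 5.2(Occurrence and sign splitting for type Va).Letp≥11and letΠbe an irreducible automorphic representation ofG(A)of general type contributing toM 0,0(Upr(p))whose local com- ponentΠ plies in theL-packet attached by Gan–Tantono to a parameter of typeVa; the packet is{Π+ p,Π−" p0015:L36-50 "p,Π− p}withΠ− p∼=(ξ◦λ)⊗Π+ p, denoted{Va G, χ0⊗Va G}in[36, Table 3]. WriteΠ±for the representations with the same components asΠaway frompand withp-componentΠ± p, and V[Π]⊂M 0,0(Upr(p))for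 the sum of the corresponding isotypic subspaces. Then: (a)BothΠ+andΠ−are automorphic, each with multiplicity one, and they exhaust the weak equivalence class ofΠ. (b)V[Π] = (Π+ p)U1,p⊕(Π− p)U1,p. The two summands areR(π)-stable of equal dimensiond p(Π) := dim(Π+ p)U1,p≥1, and the multiplicities of theR(π)-eigenvalues+1and−1on the two sum- mands are interchanged. In particulardimV[Π] = 2d p(Π), the eigenvalues+1and−1of" p0015:L51-52 "R(π)onV[Π]each occur with multiplicityd p(Π), andTr R(π)|V[Π]" (a control byte of the extraction omitted) p0015:L53-58 "= 0. (c)EveryT(n)withp∤nacts onV[Π]by a single scalar; in particular the eigensystems in V[Π]agree at every suchT(n)and are separated only byR(π). The contribution of the weak packet ofΠtocharpolyB 2(2)is(x−λ 2(Π))2dp(Π)for the commonB 2(2)-eigenvalueλ 2(Π)of Proposition 4.4, and the total type-Va contribution tocharpolyB 2(2)is an exact square on whichR(π)has trace zero and equal±1eigenvalue multiplicities." p0016:L2-5 "(d)Conversely, every cuspidal automorphic representationΠ′ofGSp4(A)of general type, cohomo- logical of weight(3,0), unramified outsidep, whosep-component lies in the packet{Va,Va∗}, is a lifting fromGof the above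 kind, and the induced correspondence of parameters between suchΠ′and the weak packets in(a)is a bijection." with Corollary 5.3, p0016:L47-49 "Corollary 5.3.For every primep≥11, the contribution tocharpolyB 2(2)of the general-type eigensystems whose local component atpis of typeVais an exact square, andR(π)splits it into +1and−1eigenspaces of equal dimension; itsR(π)-trace vanishes." (its second sentence, naming the paper's Conj. 2.2 (iii), is in the `--` comment). [cite: Dang2026RichelotBrandt, Thm 5.2, Cor. 5.3 (arXiv v2, 2026-08-24)] -/
  DangTypeVa : Prop

-- Verbatim lines of `arxiv-pdf-2608.14145v2/` kept out of the docstrings by the register's lint (sentences naming a conj. or an open question), and bibliography entries.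
--   title p0001:L1-2 "A STRUCTURAL TRACE IDENTITY AND CERTIFIED SPECTRA FOR THE RICHELOT–BRANDT GRAPH"; abstract p0001:L11-17 "plicity conjectures: charpolyB 2(2) factors into Eisenstein, Saito–Kurokawa, opposite-sign Yoshida, type-Va, and general-type blocks with specifiedR(π)-signs. The type-Va clause is a theorem for every prime: by the global lifting theorem of R¨ osner and Weissauer for inner forms anisotropic at the archimedean place, the weak packet of a general-type representation of GU 2(B) is the full product of its localL-packets, each member occurring with multiplicity one, so both members of every type-Va pair occur and the type-Va block is an exact square split evenly byR(π). For the Saito–Kurokawa and Yoshida blocks the refinement remains conjectural."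
--   the four levels p0002:L3-12 "appear: (i) anunconditional theoremon the total signed trace, valid for every primep≥7 (Theorem 2.1); (ii)eigenvalue laws derived from published transfer results, valid for everyp≥11, which say nothing new about which parameters occur (Theorem 2.4); (iii) aconjectural refinementpredicting the individual multiplicities andR-signs, in particular the type-V a split, for everyp≥11 (Conjecture 2.2); (iv) afinite, computer-assisted verificationof (iii), valid only for the thirty-one primes 11≤p≤149 (Theorem 2.3). Nothing in (i) or (ii) implies (iii) beyond the range certified by (iv); the multiplicity statement for p >149 remains open."
--   §1.3 (iv) p0003:L26-28 "(iv) The occurrence theorem for the type-Va block (Section 5): by the global lifting theorem of R¨ osner and Weissauer, both members of every type-Va pair occur with multiplicity one, so the square and sign assertions of Conjecture 2.2(iii) are theorems for every prime."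
--   status paragraph p0003:L39-42 "Of these four components, the first and the fourth are unconditional for allp; the second is a conjecture whose remaining content is the Saito–Kurokawa and Yoshida rows and the identification of the block degrees; the third certifies the full conjecture in a finite, explicitly bounded range and does not constitute a proof beyond it."
--   §1.4, end of the sentence quoted in the tranche docstring, p0003:L47-48 "multiplicity assertion for the general-type rows is proved in Section 5 via [36, Thm. 11.4], while the Saito–Kurokawa and Yoshida rows remain conjectural outside the certified range."
--   table p0007:L10-11 "Conjecture 2.2p≥11 Type-Va clause proved (Theo- rem 5.2); remaining rows conjec-"; §5 opening p0015:L2-6 "5.The occurrence theorem for the type-Va block This section proves the occurrence half of Conjecture 2.2(iii). The input is the global lifting theorem of R¨ osner and Weissauer for inner forms of GSp4that are anisotropic at the archimedean place [36, Thm. 11.4]. Applied toG= GU 2(B) at trivial weight, it shows that the weak packet of a general-type automorphic representation is the full product of its localL-packets and that every"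
--   Lemma 5.1 p0015:L12-17 "Lemma 5.1.The groupG= GU 2(B)satisfies the standing hypotheses of[36,§1]: its center is Z∼=Gm, soH1(Q, Z) = 1, and its derived group is an inner form ofSp4, hence simply connected. The real groupG(R)is anisotropic modulo center. Consequently Conjecture 7.5 of[36]holds for G, the virtual multiplicities of[36,§9]are cuspidal multiplicities, and[36, Thm. 11.4]applies to every automorphic representation ofG(A)of general type with trivial archimedean component. No regularity hypothesis on the weight is required."
--   Corollary 5.3, second sentence p0016:L49-52 "This establishes the square and sign assertions of Conjecture 2.2(iii). Identifying this square with the residual factorVa p(x)2of(7) amounts to the remaining rows of Table 4, that is, to the Saito–Kurokawa and Yoshida entries of the principal column together with the local fixed-vector statements of Remarks 5.4 and 5.5."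
--   §7 p0026:L38-40 "furnish Ihara pairs: pairs of Hecke eigensystems agreeing at everyT(n)withp∤n, separated only by R(π)into opposite Atkin–Lehner signs. This is unconditional (Theorem 5.2). That the number of such pairs equalsdeg Va pis part of Conjecture 2.2 and holds at the certified primes by Theorem 2.3."
--   bibliography p0036:L16-17 "[36] M. R¨ osner, R. Weissauer,Global liftings between inner forms ofGSp(4), J. Number Theory263(2024), 79–138; arXiv:2103.14715." / p0036:L22-23 "[39] W. T. Gan, W. Tantono,The local Langlands conjecture forGSp(4), II: The case of inner forms, Amer. J. Math. 136(2014), 761–805."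
--   / p0036:L30-31 "[44] P. van Hoften,A geometric Jacquet–Langlands correspondence for paramodular Siegel threefolds, Math. Z.299 (2021), 2029–2061." / p0036:L27 "[42] R. Schmidt,Packet structure and paramodular forms, Trans. Amer. Math. Soc.370(2018), 3085–3112."
--   / p0035:L28-29 "[14] N. Dummigan, A. Pacetti, G. Rama, G. Tornar´ ıa,Quinary forms and paramodular forms, Math. Comp.93 (2024), no. 348, 1805–1858." / p0036:L24-25 "[40] T. Gee, O. Ta¨ ıbi,Arthur’s multiplicity formula forGSp4and restriction toSp4, J.´Ec. polytech. Math.6(2019), 469–535."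
--   / p0036:L18-19 "[37] P.-S. Chan, W. T. Gan,The local Langlands conjecture forGSp(4)III: stability and twisted endoscopy, J. Number Theory146(2015), 69–133." — v1's numbering (down-g39's `paper-arxiv-2608.14145/` p0031:L50-56, quoted by tranche 100): [36] Rösner – Weissauer, [37] Schmidt, [38] Shimura, [39] van Hoften.
-- Rösner – Weissauer (`paper-arxiv-2103.14715/`, held corpus TeX), the control row's own sentences on [Art04] / Gee – Taïbi: p0028:L3 "The automorphic spectrum of $\GSp(4)$ has been described in the terms of Arthur's classification in [Arthur_classification_04]." / p0028:L8 "However, as indicated on page 924 in loc. cit, their proof depends on a result announced by Chaudouard and Laumon [Choudouard-Laumon], which is not yet available. In this sense, the classification of the automorphic spectrum is thus still conditional."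

/-- C251 v2's THEOREM 5.2 / COROLLARY 5.3 ⇐ NOTHING INSIDE THE THREE DAGs — the places (`arxiv-pdf-2608.14145v2/`): the proof of (a), p0016:L6-14 "Proof.(a) By Lemma 5.1, [36, Thm. 11.4] applies to Π. Assertion 1 of that theorem gives multiplicity one for every automorphic representation weakly equivalent to Π, and assertion 2 identifies the set of these representations with the product of the localL-packets of the components of Π, the local packets corresponding to the local Langlands parameters. The archimedean packet is the singleton consisting of the trivial representation, the packet at everyq̸=pis the singleton containing the unramified member, and the packet atpis{Π+ p,Π− p}, of cardinality two [39, Main Thm. (ii), §7.2]. Hence the weak equivalence class of Π is{Π+,Π−}, both automorphic with multiplicity one." and of (b), p0016:L15-19 "Corollary 11.6 of [36], which lists both Va Gandχ 0⊗Va Gamong the local types of general-type representations of inner forms, records the same conclusion. (b) Multiplicity one givesV[Π] = (Π+ p)U1,p⊕(Π− p)U1,p, withB 2(2) andR(π) acting through Π±" — [36] = Rösner – Weissauer, J. Number Theory 263 (2024) = the census's CONTROL row C18 / E4, whose text declares (`paper-arxiv-2103.14715/` p0026:L19) "We thus attempt not to use Arthur's classification." and offers (p0028:L10) "an independent proof that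 does not use announced," (p0028:L11) "but not yet available results on twisted weighted endoscopy." — an Arthur-free published input by the register's standing reading of C18 (a control, never typed; so read where rows invoke it: tranche 98's C244 « [RW21] », tranche 100's C251 v1 « [36] », tranche 127's C62 v4 « [39, Theorem 11.4] »); [39] = Gan – Tantono, Amer. J. Math. 136 (2014): the local Langlands correspondence for inner forms of GSp(4), Arthur-free and local.  The authors' own word (status table, p0007:L8-9): « Unconditional theorem, via [36, Thm. 11.4] ».  Hence NO premise: neither the book, nor Mok, nor KMSW, nor a register row is invoked for Theorem 5.2 — in contrast with the same text's Theorem 2.4 (`Consumers100.DangRB` ⇐ book ∧ C90 ∧ C244 ∧ C180, tranche 100). [cite: Dang2026RichelotBrandt, Thm 5.2 proof (arXiv v2 p0016:L6-19), status table (p0007:L8-9); RosnerWeissauer2024, Thm 11.4 (as [36]); GanTantono2014, Main Thm (ii) (as [39])] -/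
def E_DangTypeVa (c₁₃₇ : Consumers137) : Prop := c₁₃₇.DangTypeVa

/-- The hundred-and-thirty-seventh tranche of implications: the one premise-free edge of row C251's v2 theorem. [cite: Dang2026RichelotBrandt, Thm 5.2, Cor. 5.3 (the edge's source in its own docstring)] -/
structure Implications137 (c₁₃₇ : Consumers137) : Prop where
  dangTypeVa : E_DangTypeVa c₁₃₇

/-- C251 v2's Theorem 5.2 INHERITS NOTHING from the three DAGs as typed: its edge has no premise. [cite: Dang2026RichelotBrandt, Thm 5.2 (bookkeeping proved here)] -/
theorem dangTypeVa_inherits_nothing {c₁₃₇ : Consumers137} (X : Implications137 c₁₃₇) : c₁₃₇.DangTypeVa := X.dangTypeVa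

/-- BOTH TYPED STATEMENTS OF ROW C251 AFTER THE REPLACEMENT, SIDE BY SIDE: v1's Theorem 2.4 with Proposition 4.4 (`Consumers100.DangRB`, re-found verbatim in v2) from its
four typed premises — the book at every rank, row C90, row C244, row C180 — through tranche 100's `dang_of_rows`, AND v2's Theorem 5.2 with Corollary 5.3 from nothing.  The
replacement ADDS an Arthur-free theorem; it does not change the typed statement or the suppliers of the Arthur-dependent one. [cite: Dang2026RichelotBrandt, Thm 2.4 (v1 = v2) and Thm 5.2 (v2) (bookkeeping proved here)] -/
theorem c251_two_text_states {ν : Nodes} {c₁₉ : Consumers19} {c₂₁ : Consumers21} {c₂₈ : Consumers28} {c₉₈ : Consumers98} {c₁₀₀ : Consumers100} {c₁₃₇ : Consumers137}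
    (X₁₀₀ : Implications100 ν c₁₉ c₂₁ c₂₈ c₉₈ c₁₀₀) (X : Implications137 c₁₃₇) (hν : ∀ N, ν.Everything N) (h₉₀ : c₂₈.VanHoften) (h₂₄₄ : c₉₈.DPRTjl)
    (h₁₈₀ : c₁₉.SchmidtParamodular) : c₁₀₀.DangRB ∧ c₁₃₇.DangTypeVa :=
  ⟨dang_of_rows X₁₀₀ hν h₉₀ h₂₄₄ h₁₈₀, X.dangTypeVa⟩

/-- THE PAIR FROM THE BOOK's INPUTS: v1's Theorem 2.4 through tranche 100's `dang_of_leaves` (the book directly, C90 through tranche 28 and row A4, C244 through tranche 98,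
C180 through tranche 19 — `BookInputs` in full; nothing of Mok 2015 or KMSW) and v2's Theorem 5.2 for free. [cite: Dang2026RichelotBrandt, Thms 2.4, 5.2 (bookkeeping proved here)] -/
theorem c251_v2_of_leaves {ν : Nodes} {μ : Mok2015.Nodes} {κ : KMSW2014.Nodes} {c : Consumers} {c₁₉ : Consumers19} {c₂₀ : Consumers20} {c₂₁ : Consumers21}
    {c₂₈ : Consumers28} {c₂₉ : Consumers29} {c₉₈ : Consumers98} {c₁₀₀ : Consumers100} {c₁₃₇ : Consumers137}
    (X₁₀₀ : Implications100 ν c₁₉ c₂₁ c₂₈ c₉₈ c₁₀₀) (X₉₈ : Implications98 ν c c₁₉ c₂₀ c₂₁ c₂₈ c₂₉ c₉₈) (R : Implications28 ν μ κ c c₁₉ c₂₈)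
    (V : Implications20 ν c₁₉ c₂₀) (Y : Implications19 ν μ κ c₁₉) (I : Implications ν μ κ c) (A : BookInputs ν) (X : Implications137 c₁₃₇) :
    c₁₀₀.DangRB ∧ c₁₃₇.DangTypeVa :=
  ⟨dang_of_leaves X₁₀₀ X₉₈ R V Y I A, X.dangTypeVa⟩

/-- C251 v2 IN CONDITIONAL FORM, 2026: Theorem 5.2 is conditional on NOTHING in the three DAGs (the edge has no premise), while Theorem 2.4 stays, through tranche 100's
`dang_conditional_form`, conditional on the book's 2024–2026 preprint layer and on the general and the non-standard weighted fundamental lemmas — the typed form of the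
v2 status table's two lines « Theorem 2.4 … Derived from published transfer and classification results » / « Theorem 5.2 … Unconditional theorem, via [36, Thm. 11.4] ».
[cite: Dang2026RichelotBrandt, status table (arXiv v2 p0007:L6-9) (bookkeeping proved here)] -/
theorem c251_v2_conditional_form {ν : Nodes} {μ : Mok2015.Nodes} {κ : KMSW2014.Nodes} {c : Consumers} {c₁₉ : Consumers19} {c₂₀ : Consumers20} {c₂₁ : Consumers21}
    {c₂₈ : Consumers28} {c₂₉ : Consumers29} {c₉₈ : Consumers98} {c₁₀₀ : Consumers100} {c₁₃₇ : Consumers137}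
    (X₁₀₀ : Implications100 ν c₁₉ c₂₁ c₂₈ c₉₈ c₁₀₀) (X₉₈ : Implications98 ν c c₁₉ c₂₀ c₂₁ c₂₈ c₂₉ c₉₈) (R : Implications28 ν μ κ c c₁₉ c₂₈)
    (V : Implications20 ν c₁₉ c₂₀) (Y : Implications19 ν μ κ c₁₉) (I : Implications ν μ κ c) (B : ν.BookEdges) (S : ν.SupplyEdges) (P : ν.PublishedLeaves)
    (X : Implications137 c₁₃₇) :
    c₁₃₇.DangTypeVa ∧ (ν.PreprintLeaves2026 → ν.WFL_general → ν.WFL_nonstandard → c₁₀₀.DangRB) :=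
  ⟨X.dangTypeVa, dang_conditional_form X₁₀₀ X₉₈ R V Y I B S P⟩

/-- THE WHOLE HUNDRED-AND-THIRTY-SEVENTH TRANCHE FROM NO INPUT AT ALL: its one field is premise-free. [cite: Dang2026RichelotBrandt, Thm 5.2, Cor. 5.3 (bookkeeping proved here)] -/
theorem hundredthirtyseventh_of_inputs {c₁₃₇ : Consumers137} (X : Implications137 c₁₃₇) : c₁₃₇.DangTypeVa := X.dangTypeVa

end Downstream

end Literature.NumberTheory.Automorphic.Arthur2013
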